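import Mathlib
import Literature.Analysis.Convex.PrimalDualHybridGradient
import HarnessLib

/-!
# The primal–dual algorithm with linesearch (Malitsky–Pock 2018): adaptive steps WITH a proof

Topic `Literature/Analysis/Convex` (companion of `PrimalDualHybridGradient.lean` — Chambolle–Pock
PDHG with FIXED steps `τσ‖K‖² < 1` — and of `RelaxedPDHG.lean`, whose variable-step theorem
[GoldsteinEtAl2013, Thm 1] needs bounded steps with SUMMABLE relative changes). Namespace
`Literature.Analysis.Convex.LinesearchPDHG`. Everything PROVED; no named facts (D-0026).

Source. Y. Malitsky, T. Pock, *A first-order primal-dual algorithm with linesearch*, SIAM J. Optim.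
28 (2018) 411–432, doi:10.1137/16M1092015 = arXiv:1608.08883 [MalitskyPock2018] (held:
`paper:arxiv-1608.08883`; the statements below were typed from the arXiv LaTeX source, §2
"Linesearch": Algorithm 1, Lemma 1, Theorem 1, Theorem 2; equation numbers (3) = prox
characterization, (6) = the linesearch test, (8)–(14) = the displays of the proof of Theorem 1,
(15)–(17) = those of Theorem 2, in the order printed).

THE PRINTED STATEMENTS (§1–§2). Problem (1): `min_x max_y ⟨Kx, y⟩ + g(x) − f*(y)`, `K` bounded
linear between finite-dimensional Hilbert spaces, `g`, `f*` proper convex l.s.c., a saddle point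
exists. **Algorithm 1 (PDAL).** Choose `x^0 ∈ X`, `y^1 ∈ Y`, `τ_0 > 0`, `μ ∈ (0,1)`, `δ ∈ (0,1)`,
`β > 0`; `θ_0 = 1`. Step 1: `x^k = prox_{τ_{k−1} g}(x^{k−1} − τ_{k−1} K* y^k)`. Step 2: choose any
`τ_k ∈ [τ_{k−1}, τ_{k−1} √(1 + θ_{k−1})]` and run the linesearch: 2.a `θ_k = τ_k / τ_{k−1}`,
`x̄^k = x^k + θ_k (x^k − x^{k−1})`, `y^{k+1} = prox_{β τ_k f*}(y^k + β τ_k K x̄^k)`; 2.b break if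
`√β τ_k ‖K* y^{k+1} − K* y^k‖ ≤ δ ‖y^{k+1} − y^k‖` (6), otherwise `τ_k := τ_k μ` and go to 2.a.
**Lemma 1.** (i) The linesearch always terminates. (ii) There is `τ > 0` with `τ_k > τ` for all
`k`. (iii) There is `θ > 0` with `θ_k ≤ θ` for all `k` (proof: `θ_k ≤ (1 + √5)/2`). **Theorem 1.**
`(x^k, y^k)` is bounded and all its cluster points are solutions of (1); if moreover `g|_{dom g}` is
continuous and `(τ_k)` is bounded from above, the whole sequence converges to a solution of (1).
**Theorem 2 (ergodic convergence).** For any saddle point `(x̂, ŷ)`,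
`𝒢_{x̂,ŷ}(X^N, Y^N) ≤ (½‖x^1 − x̂‖² + (1/2β)‖y^1 − ŷ‖² + τ_1 θ_1 P_{x̂,ŷ}(x^0)) / s_N`, where
`s_N = Σ_{k=1}^N τ_k`, `X^N = (τ_1 θ_1 x^0 + Σ_{k=1}^N τ_k x̄^k)/(τ_1 θ_1 + s_N)`,
`Y^N = Σ_{k=1}^N τ_k y^k / s_N` (see `yErg` for the index of this last average),
`P_{x̂,ŷ}(x) = g(x) − g(x̂) + ⟨K* ŷ, x − x̂⟩ ≥ 0`, `D_{x̂,ŷ}(y) = f*(y) − f*(ŷ) − ⟨K x̂, y − ŷ⟩ ≥ 0`,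
`𝒢 = P + D` the primal–dual gap (§1 (4)–(5)).

WHAT IS TYPED HERE. `g : X → ℝ` and `fs = f* : Y → ℝ` are real-valued and their effective domains
are carried as sets `C ⊂ X`, `D ⊂ Y` (so `g + ι_C`, `f* + ι_D` of the paper); proximal steps enter
ONLY through the characterization (3), `IsProxPt` / `IsProxOn`, hence any realisation is covered.
* `lagr`, `pgap`, `dgap`, `IsSaddleOn` — (1), (4), (5); `one_step` — the one-step inequality (13)
  for arbitrary `(x̂, ŷ) ∈ C × D`, from the three prox inequalities (8)–(9), the regrouping (10)–(12)
  and Cauchy–Schwarz with the test (6) (`extrapolated_prox_ineq`, `cross_term_le`).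
* `IsLinesearchRun K g fs C D β δ x y τ` — the hypotheses satisfied by the iterates of Algorithm 1
  (dual iterates indexed so that `y k = y^{k+1}`; `theta`, `xbar`); on such a run:
  `theta_le_goldenRatio` (Lemma 1 (iii)), `step_le` (13), `lyap_succ_add_diss_le` (14),
  `norm_sub_sq_le` (boundedness), `tendsto_diss`, **`isSaddleOn_of_tendsto`** (Theorem 1, first
  part: cluster points of `(x^{k+1}, y^{k+1})` are saddle points — for `C`, `D` closed, `g`, `f*`
  lower semicontinuous on them, steps bounded below), **`tendsto_iterates`** (Theorem 1, second part:
  convergence, for `g` continuous on `C` and steps bounded above), **`ergodic_gap_le`** (Theorem 2,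
  with `xErg`, `yErg`, `stepSum`; `xErg_mem`, `yErg_mem`).
* Algorithm 1 itself with backtracking by `μ`: `lsDual`, `lsTest` (6), `lsCount`, `lsStep`, `lsSeq`,
  `lsX/lsY/lsTau`, trial-step policies `IsTrialPolicy` (`isTrialPolicy_max`, `_const`, `_capped`);
  `lsTest_of_le` + `exists_lsTest` (Lemma 1 (i)), **`isLinesearchRun_lsSeq`** (the algorithm
  produces a run), `le_lsTau` / `exists_le_lsTau` (Lemma 1 (ii): `τ_k ≥ min(τ_0, δμ/(√β‖K‖))`),
  `lsTau_le_of_capped`, **`tendsto_lsSeq`** (Theorem 1 for the algorithm).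
* The conic kernel of PDLP-type solvers: `isProxOn_proj_linear` (`prox = P_C(· − τc)`, Remark 2),
  `isSaddleOn_linear_iff` (saddle points = zeros of the tree's conic KKT operator),
  **`tendsto_lsSeq_conic`** — PDAL with projections converges to a saddle point of
  `⟨c,x⟩ + ⟨Kx,y⟩ − ⟨b,y⟩` on `C × D` with NO a-priori step bound `τσ‖K‖² < 1`.
* The cost of the linesearch (the a-priori bounds of the remark after Lemma 1): `lsN` (rejected
  trial steps of one linesearch), `lsTotal` (their total over the first `N` iterations,
  `sum_lsN_add_one`: those iterations make `N + lsTotal` passes through Step 2.a);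
  `lsN_le_of_le` / `lsN_le_logb` (one linesearch, steps below `τmax`, any trial policy: at most
  `⌈log_μ(δ/(√β‖K‖τmax(1+√5)/2))⌉` rejections — printed for "maximally increase");
  `lsTau_const_eq`, `lsTotal_const_le` / `lsTotal_const_le_logb` ("never increase": the TOTAL number
  of rejections over the whole run is at most `⌈log_μ(δ/(√β‖K‖τ_0))⌉`); `lsTotal_log_le` (any trial
  policy: `S_N log(1/μ) ≤ log(τ_0/τlo) + N log((1+√5)/2)`, a consequence of Lemma 1 (ii)–(iii)).
* Theorem 3 (variable ratios `β_k`, i.e. an adaptive primal–dual step RATIO on top of the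
  linesearch): `IsLinesearchRunVar` (iteration `k+1` uses `βs (k+1)`), the slack factors
  `ratio βs k = max(1, β_k/β_{k+1})` and their products `prodRatio`, the engine
  `IsLinesearchRunVar.lyap_succ_add_diss_le` (`a_{k+1} + diss_k ≤ r_k a_k`, (18)–(20) in one line),
  `IsLinesearchRunVar.isSaddleOn_of_tendsto` / `.tendsto_iterates` (bounded slack products), and
  **`IsLinesearchRunVar.tendsto_iterates_of_monotone_or_antitone`** = Theorem 3 as printed
  (monotone `β_k ∈ [βmin, βmax]`; `prodRatio_eq_one_of_monotone`, `prodRatio_eq_of_antitone`).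

Reading for the certified-SDP kernels (why this file exists): among adaptive step rules for PDHG,
THIS is the printed one with a convergence proof; PDLP's adaptive rule has none (its authors say so:
Applegate et al., *PDLP*, Math. Program. Comput. 2026 = arXiv:2501.07018, §3), and
[GoldsteinEtAl2013, Thm 1] (`RelaxedPDHG.tendsto_varPdhgIter`) needs summable step variation.

Deviations, all harmless and flagged at the declarations: (a) we assume `x^0 ∈ dom g` (the paper
allows any `x^0 ∈ X`, with `g(x^0) = +∞` making the first inequality vacuous); (b) in the cluster-point
argument we pass to the limit in the primal prox inequality at index `k_i` rather than `k_i + 1`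
(equivalent under the theorem's hypotheses; needed as such when `(τ_k)` is unbounded); (c) Theorem
2's dual average is taken over `y^{k+1}` (`k = 1..N`), which is what the printed proof ((17) applied
to the terms `D(y^{k+1})` of `ε_k`) establishes — the printed statement writes `y^k`.

Deliberately NOT here: the ergodic rate under variable `β_k` (not printed), §3 (accelerated versions
under strong convexity), §4 (the three-function problem with a smooth term), §5 (numerics); infinite
dimensions; a
concrete backtracking construction with a `β_k` schedule (Theorem 3 is typed over runs, which covers
any state-dependent choice of `β_k` whose realised sequence is monotone and bounded).
-/

namespace Literature.Analysis.Convex.LinesearchPDHG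

open _root_.Filter _root_.Topology Finset
open scoped RealInnerProductSpace

variable {X Y : Type*} [NormedAddCommGroup X] [InnerProductSpace ℝ X] [CompleteSpace X]
  [NormedAddCommGroup Y] [InnerProductSpace ℝ Y] [CompleteSpace Y]

/-! ### The saddle-point problem `min_x max_y ⟪Kx, y⟫ + g(x) − f*(y)` and its gap functions -/

/-- The convex–concave saddle function `L(x, y) = ⟪Kx, y⟫ + g(x) − f*(y)` of problem (1.1)
(here `fs` stands for `f*`; `g`, `f*` are real-valued on their effective domains `C`, `D`, which are
carried as sets). [cite: MalitskyPock2018, §1 (1)] -/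
def lagr (K : X →L[ℝ] Y) (g : X → ℝ) (fs : Y → ℝ) (x : X) (y : Y) : ℝ :=
  ⟪K x, y⟫ + g x - fs y

/-- The primal gap function `P_{x̂,ŷ}(x) = g(x) − g(x̂) + ⟪K* ŷ, x − x̂⟫` (written with
`⟪K* ŷ, x − x̂⟫ = ⟪K(x − x̂), ŷ⟫`). [cite: MalitskyPock2018, §1 (4)] -/
def pgap (K : X →L[ℝ] Y) (g : X → ℝ) (xh : X) (yh : Y) (x : X) : ℝ :=
  g x - g xh + ⟪K (x - xh), yh⟫

/-- The dual gap function `D_{x̂,ŷ}(y) = f*(y) − f*(ŷ) − ⟪K x̂, y − ŷ⟫`.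
[cite: MalitskyPock2018, §1 (5)] -/
def dgap (K : X →L[ℝ] Y) (fs : Y → ℝ) (xh : X) (yh : Y) (y : Y) : ℝ :=
  fs y - fs yh - ⟪K xh, y - yh⟫

/-- `(x̂, ŷ)` is a saddle point of `L` on `C × D`: `x̂ ∈ C`, `ŷ ∈ D` and
`L(x̂, y) ≤ L(x̂, ŷ) ≤ L(x, ŷ)` for all `x ∈ C`, `y ∈ D`. [cite: MalitskyPock2018, §1 (standing assumption: (1) has a saddle point)] -/
def IsSaddleOn (K : X →L[ℝ] Y) (g : X → ℝ) (fs : Y → ℝ) (C : Set X) (D : Set Y) (xh : X) (yh : Y) :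
    Prop :=
  xh ∈ C ∧ yh ∈ D ∧ (∀ x ∈ C, lagr K g fs xh yh ≤ lagr K g fs x yh) ∧
    ∀ y ∈ D, lagr K g fs xh y ≤ lagr K g fs xh yh

omit [CompleteSpace X] [CompleteSpace Y] in
/-- `P_{x̂,ŷ} ≥ 0` on `C` at a saddle point (this is the right saddle inequality).
[cite: MalitskyPock2018, §1 (4)] -/
theorem pgap_nonneg {K : X →L[ℝ] Y} {g : X → ℝ} {fs : Y → ℝ} {C : Set X} {D : Set Y} {xh : X}
    {yh : Y} (h : IsSaddleOn K g fs C D xh yh) {x : X} (hx : x ∈ C) : 0 ≤ pgap K g xh yh x := by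
  have h1 := h.2.2.1 x hx
  simp only [lagr, pgap, map_sub, inner_sub_left] at h1 ⊢
  linarith

omit [CompleteSpace X] [CompleteSpace Y] in
/-- `D_{x̂,ŷ} ≥ 0` on `D` at a saddle point (the left saddle inequality).
[cite: MalitskyPock2018, §1 (5)] -/
theorem dgap_nonneg {K : X →L[ℝ] Y} {g : X → ℝ} {fs : Y → ℝ} {C : Set X} {D : Set Y} {xh : X}
    {yh : Y} (h : IsSaddleOn K g fs C D xh yh) {y : Y} (hy : y ∈ D) : 0 ≤ dgap K fs xh yh y := by
  have h1 := h.2.2.2 y hy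
  simp only [lagr, dgap, inner_sub_right] at h1 ⊢
  linarith

omit [CompleteSpace X] [CompleteSpace Y] in
/-- `P_{x̂,ŷ}(x̂) = 0`. [cite: MalitskyPock2018, §1 (4)] -/
@[simp] theorem pgap_self (K : X →L[ℝ] Y) (g : X → ℝ) (xh : X) (yh : Y) : pgap K g xh yh xh = 0 := by
  simp [pgap]

omit [CompleteSpace X] [CompleteSpace Y] in
/-- `D_{x̂,ŷ}(ŷ) = 0`. [cite: MalitskyPock2018, §1 (5)] -/
@[simp] theorem dgap_self (K : X →L[ℝ] Y) (fs : Y → ℝ) (xh : X) (yh : Y) : dgap K fs xh yh yh = 0 := by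
  simp [dgap]

/-! ### Proximal maps, as used by the algorithm -/

/-- `j` is the proximal map of `τ (g + ι_C)`: `j u ∈ C` and the characteristic inequality (1.3)
`⟪j u − u, x − j u⟫ ≥ τ (g(j u) − g(x))` holds for every `x ∈ C`.
[cite: MalitskyPock2018, §1 (3)] -/
def IsProxOn (C : Set X) (g : X → ℝ) (τ : ℝ) (j : X → X) : Prop :=
  ∀ u, j u ∈ C ∧ ∀ x ∈ C, τ * (g (j u) - g x) ≤ ⟪j u - u, x - j u⟫

omit [CompleteSpace X] in
/-- The cosine rule `2⟪a − b, c − a⟫ = ‖b − c‖² − ‖a − b‖² − ‖a − c‖²`.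
[cite: MalitskyPock2018, §1 (cosine rule)] -/
theorem two_inner_sub_sub (a b c : X) :
    2 * ⟪a - b, c - a⟫ = ‖b - c‖ ^ 2 - ‖a - b‖ ^ 2 - ‖a - c‖ ^ 2 := by
  have h1 : b - c = -((a - b) + (c - a)) := by abel
  have h2 : a - c = -(c - a) := by abel
  rw [h1, norm_neg, norm_add_sq_real, h2, norm_neg]
  ring

/-! ### The one-step inequality of the linesearch (proof of Theorem 1, (8)–(13)) -/

/-- The extrapolated primal inequality (9): adding `θ_k`× and `θ_k²`× the characteristic
inequalities of `x^k = prox_{τ_{k−1} g}(x^{k−1} − τ_{k−1} K* y^k)` tested at `x^{k+1}` and at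
`x^{k−1}` gives, with `x̄^k = x^k + θ_k (x^k − x^{k−1})` and `τ_k = θ_k τ_{k−1}`,
`⟪x̄^k − x^k + τ_k K* y^k, x^{k+1} − x̄^k⟫ ≥ τ_k ((1 + θ_k) g(x^k) − g(x^{k+1}) − θ_k g(x^{k−1}))`
(`p = x^{k−1}`, `q = x^k`, `r = x^{k+1}`, `u = y^k`). [cite: MalitskyPock2018, Thm 1 (proof, (9))] -/
theorem extrapolated_prox_ineq (K : X →L[ℝ] Y) (g : X → ℝ) {τp τ θ : ℝ} (hθ : 0 ≤ θ)
    (hτθ : τ = θ * τp) {p q r : X} {u : Y}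
    (hq1 : τp * (g q - g r) ≤ ⟪q - (p - τp • K.adjoint u), r - q⟫)
    (hq2 : τp * (g q - g p) ≤ ⟪q - (p - τp • K.adjoint u), p - q⟫) :
    τ * ((1 + θ) * g q - g r - θ * g p) ≤
      ⟪(q + θ • (q - p)) - q, r - (q + θ • (q - p))⟫ + τ * ⟪K (r - (q + θ • (q - p))), u⟫ := by
  set xb : X := q + θ • (q - p) with hxb
  have e_q : q - (p - τp • K.adjoint u) = (q - p) + τp • K.adjoint u := by abel
  rw [e_q] at hq1 hq2
  have hxbq : xb - q = θ • (q - p) := by rw [hxb]; abel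
  have hqxb : q - xb = θ • (p - q) := by
    rw [hxb, smul_sub, smul_sub]; abel
  have h1 := mul_le_mul_of_nonneg_left hq1 hθ
  have h2 := mul_le_mul_of_nonneg_left hq2 (mul_nonneg hθ hθ)
  have ea : θ • ((q - p) + τp • K.adjoint u) = (xb - q) + τ • K.adjoint u := by
    rw [smul_add, smul_smul, ← hτθ, hxbq]
  have i1 : θ * ⟪(q - p) + τp • K.adjoint u, r - q⟫ = ⟪(xb - q) + τ • K.adjoint u, r - q⟫ := by
    rw [← real_inner_smul_left, ea]
  have i2 : θ * θ * ⟪(q - p) + τp • K.adjoint u, p - q⟫ =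
      ⟪(xb - q) + τ • K.adjoint u, q - xb⟫ := by
    rw [mul_assoc, ← real_inner_smul_right, ← real_inner_smul_left, ea, hqxb]
  have i3 : ⟪(xb - q) + τ • K.adjoint u, r - q⟫ + ⟪(xb - q) + τ • K.adjoint u, q - xb⟫ =
      ⟪xb - q, r - xb⟫ + τ * ⟪K (r - xb), u⟫ := by
    rw [← inner_add_right, show (r - q) + (q - xb) = r - xb by abel, inner_add_left,
      real_inner_smul_left, ContinuousLinearMap.adjoint_inner_left,
      real_inner_comm (K (r - xb)) u]
  have lhs : θ * (τp * (g q - g r)) + θ * θ * (τp * (g q - g p)) =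
      τ * ((1 + θ) * g q - g r - θ * g p) := by rw [hτθ]; ring
  linarith [h1, h2, i1, i2, i3, lhs]

/-- The Cauchy–Schwarz step of the proof of Theorem 1: under the linesearch test (6)
`√β τ_k ‖K*(y^{k+1} − y^k)‖ ≤ δ ‖y^{k+1} − y^k‖`,
`τ_k ⟪K*(y^{k+1} − y^k), x̄^k − x^{k+1}⟫ ≤ ½‖x^{k+1} − x̄^k‖² + (δ²/2β)‖y^{k+1} − y^k‖²`.
[cite: MalitskyPock2018, Thm 1 (proof, display after (12))] -/
theorem cross_term_le (K : X →L[ℝ] Y) {β δ τ : ℝ} (hβ : 0 < β) (hτ : 0 ≤ τ) (e : X) {u v : Y}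
    (hcrit : Real.sqrt β * τ * ‖K.adjoint (v - u)‖ ≤ δ * ‖v - u‖) :
    τ * ⟪K e, v - u⟫ ≤ ‖e‖ ^ 2 / 2 + δ ^ 2 / (2 * β) * ‖v - u‖ ^ 2 := by
  have hsβ : 0 < Real.sqrt β := Real.sqrt_pos.2 hβ
  have h1 : τ * ⟪K e, v - u⟫ ≤ ‖e‖ * (τ * ‖K.adjoint (v - u)‖) := by
    rw [← ContinuousLinearMap.adjoint_inner_right]
    have h := real_inner_le_norm e (K.adjoint (v - u))
    have h' := mul_le_mul_of_nonneg_left h hτ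
    linarith [h']
  have h2 : τ * ‖K.adjoint (v - u)‖ ≤ δ / Real.sqrt β * ‖v - u‖ := by
    rw [div_mul_eq_mul_div, le_div_iff₀ hsβ]
    linarith [hcrit]
  have h3 : ‖e‖ * (τ * ‖K.adjoint (v - u)‖) ≤ ‖e‖ * (δ / Real.sqrt β * ‖v - u‖) :=
    mul_le_mul_of_nonneg_left h2 (norm_nonneg _)
  have h4 : ‖e‖ * (δ / Real.sqrt β * ‖v - u‖) ≤ ‖e‖ ^ 2 / 2 + (δ / Real.sqrt β * ‖v - u‖) ^ 2 / 2 := by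
    nlinarith [sq_nonneg (‖e‖ - δ / Real.sqrt β * ‖v - u‖)]
  have h5 : (δ / Real.sqrt β * ‖v - u‖) ^ 2 / 2 = δ ^ 2 / (2 * β) * ‖v - u‖ ^ 2 := by
    rw [mul_pow, div_pow, Real.sq_sqrt hβ.le]; ring
  linarith [h1, h3, h4, h5]

/-- **The key one-step inequality of PDAL** ([MalitskyPock2018, proof of Thm 1, (13)] = the display
following "from which we derive that"). Data of one iteration `k ≥ 1` of Algorithm 1:
`p = x^{k−1} ∈ C`, `q = x^k = prox_{τ_{k−1} g}(x^{k−1} − τ_{k−1} K* y^k)`, `u = y^k`, the accepted step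
`τ = τ_k = θ_k τ_{k−1}` (`τp = τ_{k−1}`, `θ = θ_k ≥ 0`), the extrapolation `x̄^k = q + θ (q − p)`,
`v = y^{k+1} = prox_{βτ f*}(y^k + βτ K x̄^k)` satisfying the linesearch test (6)
`√β τ ‖K*(y^{k+1} − y^k)‖ ≤ δ ‖y^{k+1} − y^k‖`, and `r = x^{k+1} = prox_{τ g}(x^k − τ K* y^{k+1})`;
the three prox steps enter only through their characteristic inequalities (1.3) tested at `r`, `p`,
`x̂`, `ŷ`. Then for EVERY `(x̂, ŷ)` (a saddle point is not needed at this stage):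
`τ_k ((1 + θ_k) P(x^k) − θ_k P(x^{k−1}) + D(y^{k+1}))`
`≤ ½(‖x^k − x̂‖² − ‖x^{k+1} − x̂‖²) + (1/2β)(‖y^k − ŷ‖² − ‖y^{k+1} − ŷ‖²) − ½‖x̄^k − x^k‖² − ((1−δ²)/2β) ‖y^{k+1} − y^k‖²`.
[cite: MalitskyPock2018, Thm 1 (proof, (8)–(13))] -/
theorem one_step (K : X →L[ℝ] Y) (g : X → ℝ) (fs : Y → ℝ) {β δ τp τ θ : ℝ} (hβ : 0 < β)
    (hτp : 0 < τp) (hθ : 0 ≤ θ) (hτθ : τ = θ * τp) {p q r xh : X} {u v yh : Y}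
    (hq1 : τp * (g q - g r) ≤ ⟪q - (p - τp • K.adjoint u), r - q⟫)
    (hq2 : τp * (g q - g p) ≤ ⟪q - (p - τp • K.adjoint u), p - q⟫)
    (hr : τ * (g r - g xh) ≤ ⟪r - (q - τ • K.adjoint v), xh - r⟫)
    (hv : (β * τ) * (fs v - fs yh) ≤
      ⟪v - (u + (β * τ) • K (q + θ • (q - p))), yh - v⟫)
    (hcrit : Real.sqrt β * τ * ‖K.adjoint (v - u)‖ ≤ δ * ‖v - u‖) :
    τ * ((1 + θ) * pgap K g xh yh q - θ * pgap K g xh yh p + dgap K fs xh yh v) ≤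
      (‖q - xh‖ ^ 2 - ‖r - xh‖ ^ 2) / 2 + (‖u - yh‖ ^ 2 - ‖v - yh‖ ^ 2) / (2 * β)
        - ‖(q + θ • (q - p)) - q‖ ^ 2 / 2 - (1 - δ ^ 2) / (2 * β) * ‖v - u‖ ^ 2 := by
  have h32 := extrapolated_prox_ineq K g hθ hτθ hq1 hq2
  have hτ0 : 0 ≤ τ := by rw [hτθ]; exact mul_nonneg hθ hτp.le
  have cs := cross_term_le K hβ hτ0 ((q + θ • (q - p)) - r) hcrit
  set xb : X := q + θ • (q - p) with hxb
  -- the two remaining prox inequalities, expanded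
  have e_r : ⟪r - (q - τ • K.adjoint v), xh - r⟫ = ⟪r - q, xh - r⟫ + τ * ⟪K (xh - r), v⟫ := by
    have : r - (q - τ • K.adjoint v) = (r - q) + τ • K.adjoint v := by abel
    rw [this, inner_add_left, real_inner_smul_left, ContinuousLinearMap.adjoint_inner_left,
      real_inner_comm (K (xh - r)) v]
  have e_v : ⟪v - (u + (β * τ) • K xb), yh - v⟫ = ⟪v - u, yh - v⟫ - (β * τ) * ⟪K xb, yh - v⟫ := by
    have : v - (u + (β * τ) • K xb) = (v - u) - (β * τ) • K xb := by abel
    rw [this, inner_sub_left, real_inner_smul_left]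
  rw [e_r] at hr
  have hv' : τ * (fs v - fs yh) ≤ ⟪v - u, yh - v⟫ / β - τ * ⟪K xb, yh - v⟫ := by
    have h := hv
    rw [e_v] at h
    have h2 : β * (τ * (fs v - fs yh) + τ * ⟪K xb, yh - v⟫) ≤ ⟪v - u, yh - v⟫ := by
      have : β * (τ * (fs v - fs yh) + τ * ⟪K xb, yh - v⟫) =
          β * τ * (fs v - fs yh) + β * τ * ⟪K xb, yh - v⟫ := by ring
      rw [this]
      linarith [h]
    rw [le_sub_iff_add_le, le_div_iff₀ hβ,
      show (τ * (fs v - fs yh) + τ * ⟪K xb, yh - v⟫) * β =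
        β * (τ * (fs v - fs yh) + τ * ⟪K xb, yh - v⟫) from mul_comm _ _]
    exact h2
  -- regrouping of the `K`-terms (the identity (10) of the paper)
  have eK : τ * ⟪K (xh - r), v⟫ - τ * ⟪K xb, yh - v⟫ + τ * ⟪K (r - xb), u⟫ =
      τ * ⟪K (xb - r), v - u⟫ - τ * ⟪K (xb - xh), yh⟫ + τ * ⟪K xh, v - yh⟫ := by
    simp only [map_sub, inner_sub_left, inner_sub_right]
    ring
  -- the gap combination (11)–(12)
  have eε : (1 + θ) * pgap K g xh yh q - θ * pgap K g xh yh p + dgap K fs xh yh v =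
      ((1 + θ) * g q - θ * g p - g xh + (fs v - fs yh)) +
        (⟪K (xb - xh), yh⟫ - ⟪K xh, v - yh⟫) := by
    simp only [pgap, dgap, hxb, map_sub, map_add, map_smul, inner_sub_left, inner_add_left,
      real_inner_smul_left]
    ring
  rw [eε]
  have key : τ * (((1 + θ) * g q - θ * g p - g xh + (fs v - fs yh)) +
      (⟪K (xb - xh), yh⟫ - ⟪K xh, v - yh⟫)) ≤
      ⟪r - q, xh - r⟫ + ⟪v - u, yh - v⟫ / β + ⟪xb - q, r - xb⟫ + τ * ⟪K (xb - r), v - u⟫ := by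
    have ex : τ * (((1 + θ) * g q - θ * g p - g xh + (fs v - fs yh)) +
        (⟪K (xb - xh), yh⟫ - ⟪K xh, v - yh⟫)) =
        τ * (g r - g xh) + τ * (fs v - fs yh) + τ * ((1 + θ) * g q - g r - θ * g p) +
          (τ * ⟪K (xb - xh), yh⟫ - τ * ⟪K xh, v - yh⟫) := by ring
    rw [ex]
    linarith [hr, hv', h32, eK]
  -- cosine rules (three times) and the Cauchy–Schwarz bound
  have c1 := two_inner_sub_sub r q xh
  have c2 := two_inner_sub_sub v u yh
  have c3 := two_inner_sub_sub xb q r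
  have n1 : ‖q - r‖ = ‖r - q‖ := norm_sub_rev q r
  rw [n1] at c3
  have fin : ⟪r - q, xh - r⟫ + ⟪v - u, yh - v⟫ / β + ⟪xb - q, r - xb⟫ + τ * ⟪K (xb - r), v - u⟫ ≤
      (‖q - xh‖ ^ 2 - ‖r - xh‖ ^ 2) / 2 + (‖u - yh‖ ^ 2 - ‖v - yh‖ ^ 2) / (2 * β)
        - ‖xb - q‖ ^ 2 / 2 - (1 - δ ^ 2) / (2 * β) * ‖v - u‖ ^ 2 := by
    have hA1 : ⟪r - q, xh - r⟫ = (‖q - xh‖ ^ 2 - ‖r - q‖ ^ 2 - ‖r - xh‖ ^ 2) / 2 := by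
      linarith [c1]
    have hA2 : ⟪v - u, yh - v⟫ / β =
        (‖u - yh‖ ^ 2 - ‖v - yh‖ ^ 2) / (2 * β) - ‖v - u‖ ^ 2 / (2 * β) := by
      have : ⟪v - u, yh - v⟫ = (‖u - yh‖ ^ 2 - ‖v - u‖ ^ 2 - ‖v - yh‖ ^ 2) / 2 := by
        linarith [c2]
      rw [this, div_div]
      ring
    have hA3 : ⟪xb - q, r - xb⟫ = (‖r - q‖ ^ 2 - ‖xb - q‖ ^ 2 - ‖xb - r‖ ^ 2) / 2 := by
      linarith [c3]
    have e2 : (1 - δ ^ 2) / (2 * β) * ‖v - u‖ ^ 2 =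
        ‖v - u‖ ^ 2 / (2 * β) - δ ^ 2 / (2 * β) * ‖v - u‖ ^ 2 := by ring
    rw [hA1, hA2, hA3, e2]
    linarith [cs]
  exact key.trans fin

/-! ### Algorithm 1 (PDAL) as a run: the hypotheses satisfied by its iterates

We index the dual iterates from `0`: `y k` below is the paper's `y^{k+1}` (so `y 0 = y¹` is the
initial dual point and `(x (k+1), y k) = (x^{k+1}, y^{k+1})`); `τ k = τ_k`, `theta τ k = θ_k`
(`θ_0 = 1`, `θ_k = τ_k / τ_{k−1}`), `xbar x τ k = x̄^k = x^k + θ_k (x^k − x^{k−1})` (`x̄^0` is never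
used and set to `x^0`). -/

/-- `p` is the proximal point `prox_{τ(g + ι_C)}(u)`, through its characterization (3):
`p ∈ C` and `τ (g(p) − g(x)) ≤ ⟪p − u, x − p⟫` for all `x ∈ C`. [cite: MalitskyPock2018, §1 (3)] -/
def IsProxPt (C : Set X) (g : X → ℝ) (τ : ℝ) (u p : X) : Prop :=
  p ∈ C ∧ ∀ x ∈ C, τ * (g p - g x) ≤ ⟪p - u, x - p⟫

omit [CompleteSpace X] in
/-- A proximal map produces proximal points. [cite: MalitskyPock2018, §1 (3)] -/
theorem IsProxOn.isProxPt {C : Set X} {g : X → ℝ} {τ : ℝ} {j : X → X} (h : IsProxOn C g τ j)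
    (u : X) : IsProxPt C g τ u (j u) :=
  h u

/-- The ratios `θ_k = τ_k / τ_{k−1}`, `θ_0 = 1`. [cite: MalitskyPock2018, §2 Algorithm 1 (Step 2.a)] -/
noncomputable def theta (τ : ℕ → ℝ) : ℕ → ℝ
  | 0 => 1
  | k + 1 => τ (k + 1) / τ k

/-- The extrapolated points `x̄^k = x^k + θ_k (x^k − x^{k−1})` (`k ≥ 1`; `x̄^0 := x^0` is unused).
[cite: MalitskyPock2018, §2 Algorithm 1 (Step 2.a)] -/
noncomputable def xbar (x : ℕ → X) (τ : ℕ → ℝ) : ℕ → X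
  | 0 => x 0
  | k + 1 => x (k + 1) + theta τ (k + 1) • (x (k + 1) - x k)

/-- `θ_0 = 1`. [cite: MalitskyPock2018, §2 Algorithm 1 (Initialization)] -/
@[simp] theorem theta_zero (τ : ℕ → ℝ) : theta τ 0 = 1 := rfl

/-- `θ_k = τ_k / τ_{k−1}`. [cite: MalitskyPock2018, §2 Algorithm 1 (Step 2.a)] -/
theorem theta_succ (τ : ℕ → ℝ) (k : ℕ) : theta τ (k + 1) = τ (k + 1) / τ k := rfl

omit [CompleteSpace X] in
/-- `x̄^k = x^k + θ_k (x^k − x^{k−1})`. [cite: MalitskyPock2018, §2 Algorithm 1 (Step 2.a)] -/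
theorem xbar_succ (x : ℕ → X) (τ : ℕ → ℝ) (k : ℕ) :
    xbar x τ (k + 1) = x (k + 1) + theta τ (k + 1) • (x (k + 1) - x k) := rfl

/-- `s_N = Σ_{k=1}^N τ_k`. [cite: MalitskyPock2018, Thm 2] -/
noncomputable def stepSum (τ : ℕ → ℝ) (N : ℕ) : ℝ := ∑ i ∈ Finset.range N, τ (i + 1)

/-- The primal ergodic point `X^N = (τ_1 θ_1 x^0 + Σ_{k=1}^N τ_k x̄^k) / (τ_1 θ_1 + s_N)`.
[cite: MalitskyPock2018, Thm 2] -/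
noncomputable def xErg (x : ℕ → X) (τ : ℕ → ℝ) (N : ℕ) : X :=
  (τ 1 * theta τ 1 + stepSum τ N)⁻¹ •
    ((τ 1 * theta τ 1) • x 0 + ∑ i ∈ Finset.range N, τ (i + 1) • xbar x τ (i + 1))

/-- The dual ergodic point `Y^N = (Σ_{k=1}^N τ_k y^{k+1}) / s_N` (here `y k = y^{k+1}`). NOTE: the
printed statement of Theorem 2 has `y^k` in this average; its proof (the term `D(y^{k+1})` of `ε_k`,
summed in (15)–(17)) yields the bound for the average of the `y^{k+1}`, which is what we formalize.
[cite: MalitskyPock2018, Thm 2] -/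
noncomputable def yErg (y : ℕ → Y) (τ : ℕ → ℝ) (N : ℕ) : Y :=
  (stepSum τ N)⁻¹ • ∑ i ∈ Finset.range N, τ (i + 1) • y (i + 1)

/-- The regrouped Jensen weights of the proof of Theorem 2: the coefficient of `P(x^{i+1})` in
`Σ_{k=1}^N ε_k`, namely `τ_{i+1}(1 + θ_{i+1}) − τ_{i+2} θ_{i+2}` for `i + 1 < N` and
`τ_N (1 + θ_N)` for `i + 1 = N`. [cite: MalitskyPock2018, Thm 2 (proof, (16))] -/
noncomputable def ergWeight (τ : ℕ → ℝ) (N i : ℕ) : ℝ :=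
  τ (i + 1) * (1 + theta τ (i + 1)) - if i + 1 < N then τ (i + 2) * theta τ (i + 2) else 0

/-- Reindexing: `Σ_{i<M+1} f(i) = f(0) + Σ_{i<M+1} [i+1 < M+1] f(i+1)`.
[cite: MalitskyPock2018, Thm 2 (proof, (16))] -/
theorem sum_range_succ_eq_ite {M' : Type*} [AddCommMonoid M'] (f : ℕ → M') (M : ℕ) :
    ∑ i ∈ Finset.range (M + 1), f i =
      f 0 + ∑ i ∈ Finset.range (M + 1), (if i + 1 < M + 1 then f (i + 1) else 0) := by
  rw [Finset.sum_range_succ' f (M), Finset.sum_range_succ, if_neg (lt_irrefl _), add_zero, add_comm]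
  congr 1
  refine Finset.sum_congr rfl fun i hi => ?_
  rw [if_pos (by simpa using Finset.mem_range.1 hi)]

/-- **A run of the primal–dual algorithm with linesearch** (Algorithm 1 = PDAL) with parameters
`β > 0` (the ratio `σ/τ`), `δ ∈ (0,1)`: sequences `x^k` (`k ≥ 0`), `y^{k+1} = y k` (`k ≥ 0`) and
accepted steps `τ_k > 0` such that
* Step 1: `x^{k+1} = prox_{τ_k g}(x^k − τ_k K* y^{k+1})`;
* Step 2: `τ_{k+1} ≤ τ_k √(1 + θ_k)` (the trial interval; the linesearch only decreases the trial
  step), `y^{k+2} = prox_{β τ_{k+1} f*}(y^{k+1} + β τ_{k+1} K x̄^{k+1})`, and the accepted step passes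
  the linesearch test (6) `√β τ_{k+1} ‖K* y^{k+2} − K* y^{k+1}‖ ≤ δ ‖y^{k+2} − y^{k+1}‖`.
We also record `x^0 ∈ dom g = C` (the paper allows any `x^0 ∈ X`, reading `g(x^0) = +∞`; with `g`
real-valued on `C` we start in `C`). The prox steps are recorded through the characterization (3)
(`IsProxPt`), so ANY realisation of the proximal maps and ANY trial-step policy / backtracking
outcome is covered; `linesearchRun_isRun` below shows that Algorithm 1 with backtracking by the
factor `μ` produces such a run. [cite: MalitskyPock2018, §2 Algorithm 1] -/
structure IsLinesearchRun (K : X →L[ℝ] Y) (g : X → ℝ) (fs : Y → ℝ) (C : Set X) (D : Set Y)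
    (β δ : ℝ) (x : ℕ → X) (y : ℕ → Y) (τ : ℕ → ℝ) : Prop where
  /-- the accepted steps are positive -/
  pos : ∀ k, 0 < τ k
  /-- `x^0 ∈ dom g` -/
  init : x 0 ∈ C
  /-- Step 1: `x^{k+1} = prox_{τ_k g}(x^k − τ_k K* y^{k+1})` -/
  primal : ∀ k, IsProxPt C g (τ k) (x k - τ k • K.adjoint (y k)) (x (k + 1))
  /-- Step 2: the accepted step lies below the trial interval `τ_{k+1} ≤ τ_k √(1 + θ_k)` -/
  trial : ∀ k, τ (k + 1) ≤ τ k * Real.sqrt (1 + theta τ k)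
  /-- Step 2.a: `y^{k+2} = prox_{β τ_{k+1} f*}(y^{k+1} + β τ_{k+1} K x̄^{k+1})` -/
  dual : ∀ k, IsProxPt D fs (β * τ (k + 1)) (y k + (β * τ (k + 1)) • K (xbar x τ (k + 1)))
    (y (k + 1))
  /-- Step 2.b: the accepted step passes the linesearch test (6) -/
  crit : ∀ k, Real.sqrt β * τ (k + 1) * ‖K.adjoint (y (k + 1) - y k)‖ ≤ δ * ‖y (k + 1) - y k‖

namespace IsLinesearchRun

variable {K : X →L[ℝ] Y} {g : X → ℝ} {fs : Y → ℝ} {C : Set X} {D : Set Y} {β δ : ℝ}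
  {x : ℕ → X} {y : ℕ → Y} {τ : ℕ → ℝ}

/-- `θ_k > 0`. [cite: MalitskyPock2018, Lemma 1] -/
theorem theta_pos (hpos : ∀ k, 0 < τ k) (k : ℕ) : 0 < theta τ k := by
  cases k with
  | zero => simp
  | succ k => rw [theta_succ]; exact div_pos (hpos _) (hpos _)

/-- `θ_{k+1} τ_k = τ_{k+1}`. [cite: MalitskyPock2018, §2 Algorithm 1 (Step 2.a)] -/
theorem theta_succ_mul (hpos : ∀ k, 0 < τ k) (k : ℕ) : theta τ (k + 1) * τ k = τ (k + 1) := by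
  rw [theta_succ, div_mul_cancel₀ _ (hpos k).ne']

/-- **Lemma 1 (iii)**: `θ_k ≤ (1 + √5)/2` (the golden ratio) for every `k`, because `θ_0 = 1` and
`θ_k ≤ √(1 + θ_{k−1})`. [cite: MalitskyPock2018, Lemma 1 (iii)] -/
theorem theta_le_goldenRatio (hpos : ∀ k, 0 < τ k)
    (htrial : ∀ k, τ (k + 1) ≤ τ k * Real.sqrt (1 + theta τ k)) (k : ℕ) :
    theta τ k ≤ Real.goldenRatio := by
  induction k with
  | zero => simp only [theta_zero]; exact Real.one_lt_goldenRatio.le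
  | succ k ih =>
      have h1 : theta τ (k + 1) ≤ Real.sqrt (1 + theta τ k) := by
        rw [theta_succ, div_le_iff₀ (hpos k), mul_comm]
        exact htrial k
      refine h1.trans ?_
      rw [Real.sqrt_le_left Real.goldenRatio_pos.le, Real.goldenRatio_sq]
      linarith

/-- `θ_{k+1} τ_{k+1} ≤ (1 + θ_k) τ_k` (from the trial interval). [cite: MalitskyPock2018, Thm 1 (proof, before (14))] -/
theorem theta_mul_le (hpos : ∀ k, 0 < τ k)
    (htrial : ∀ k, τ (k + 1) ≤ τ k * Real.sqrt (1 + theta τ k)) (k : ℕ) :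
    theta τ (k + 1) * τ (k + 1) ≤ (1 + theta τ k) * τ k := by
  have hθ : 0 ≤ 1 + theta τ k := by linarith [theta_pos hpos k]
  have h1 := htrial k
  have h2 : τ (k + 1) ^ 2 ≤ (τ k * Real.sqrt (1 + theta τ k)) ^ 2 :=
    pow_le_pow_left₀ (hpos _).le h1 2
  rw [mul_pow, Real.sq_sqrt hθ] at h2
  rw [theta_succ, div_mul_eq_mul_div, div_le_iff₀ (hpos k)]
  nlinarith [h2]

/-- Every primal iterate lies in `C = dom g`. [cite: MalitskyPock2018, §2 Algorithm 1] -/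
theorem x_mem (h : IsLinesearchRun K g fs C D β δ x y τ) (k : ℕ) : x k ∈ C := by
  cases k with
  | zero => exact h.init
  | succ k => exact (h.primal k).1

/-- Every computed dual iterate `y^{k+2}` lies in `D = dom f*`. [cite: MalitskyPock2018, §2 Algorithm 1] -/
theorem y_succ_mem (h : IsLinesearchRun K g fs C D β δ x y τ) (k : ℕ) : y (k + 1) ∈ D :=
  (h.dual k).1

omit [CompleteSpace X] in
/-- `x̄^{k+1} − x^{k+1} = θ_{k+1} (x^{k+1} − x^k)`. [cite: MalitskyPock2018, §2 Algorithm 1 (Step 2.a)] -/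
theorem xbar_sub (x : ℕ → X) (τ : ℕ → ℝ) (k : ℕ) :
    xbar x τ (k + 1) - x (k + 1) = theta τ (k + 1) • (x (k + 1) - x k) := by
  rw [xbar_succ]; abel

/-- **The one-step inequality (13) along a run**, for every `(x̂, ŷ) ∈ C × D`:
`τ_{k+1} ((1 + θ_{k+1}) P(x^{k+1}) − θ_{k+1} P(x^k) + D(y^{k+2}))`
`≤ ½(‖x^{k+1} − x̂‖² − ‖x^{k+2} − x̂‖²) + (1/2β)(‖y^{k+1} − ŷ‖² − ‖y^{k+2} − ŷ‖²) − ½‖x̄^{k+1} − x^{k+1}‖²`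
`  − ((1−δ²)/2β) ‖y^{k+2} − y^{k+1}‖²`. [cite: MalitskyPock2018, Thm 1 (proof, (13))] -/
theorem step_le (h : IsLinesearchRun K g fs C D β δ x y τ) (hβ : 0 < β) {xh : X} {yh : Y}
    (hxh : xh ∈ C) (hyh : yh ∈ D) (k : ℕ) :
    τ (k + 1) * ((1 + theta τ (k + 1)) * pgap K g xh yh (x (k + 1))
      - theta τ (k + 1) * pgap K g xh yh (x k) + dgap K fs xh yh (y (k + 1))) ≤
      (‖x (k + 1) - xh‖ ^ 2 - ‖x (k + 2) - xh‖ ^ 2) / 2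
        + (‖y k - yh‖ ^ 2 - ‖y (k + 1) - yh‖ ^ 2) / (2 * β)
        - ‖xbar x τ (k + 1) - x (k + 1)‖ ^ 2 / 2
        - (1 - δ ^ 2) / (2 * β) * ‖y (k + 1) - y k‖ ^ 2 := by
  have hθ := (theta_pos h.pos (k + 1)).le
  have hτθ : τ (k + 1) = theta τ (k + 1) * τ k := (theta_succ_mul h.pos k).symm
  have hq := h.primal k
  have hr := h.primal (k + 1)
  have hv := h.dual k
  rw [xbar_succ] at hv ⊢
  exact one_step K g fs hβ (h.pos k) hθ hτθ (hq.2 _ hr.1) (hq.2 _ (h.x_mem k)) (hr.2 _ hxh)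
    (hv.2 _ hyh) (h.crit k)

/-- The Lyapunov sequence of the proof of Theorem 1:
`a_k = ½‖x^{k+1} − x̂‖² + (1/2β)‖y^{k+1} − ŷ‖² + τ_k (1 + θ_k) P_{x̂,ŷ}(x^k)`.
[cite: MalitskyPock2018, Thm 1 (proof, (14) and the sequence a_k)] -/
noncomputable def lyap (K : X →L[ℝ] Y) (g : X → ℝ) (β : ℝ) (x : ℕ → X) (y : ℕ → Y) (τ : ℕ → ℝ)
    (xh : X) (yh : Y) (k : ℕ) : ℝ :=
  ‖x (k + 1) - xh‖ ^ 2 / 2 + ‖y k - yh‖ ^ 2 / (2 * β)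
    + τ k * (1 + theta τ k) * pgap K g xh yh (x k)

/-- The dissipated quantity `½‖x̄^{k+1} − x^{k+1}‖² + ((1−δ²)/2β)‖y^{k+2} − y^{k+1}‖²`.
[cite: MalitskyPock2018, Thm 1 (proof, (14))] -/
noncomputable def diss (β δ : ℝ) (x : ℕ → X) (y : ℕ → Y) (τ : ℕ → ℝ) (k : ℕ) : ℝ :=
  ‖xbar x τ (k + 1) - x (k + 1)‖ ^ 2 / 2 + (1 - δ ^ 2) / (2 * β) * ‖y (k + 1) - y k‖ ^ 2

/-- **(14)**: at a saddle point, `a_{k+1} + ½‖x̄^{k+1} − x^{k+1}‖² + ((1−δ²)/2β)‖y^{k+2} − y^{k+1}‖² ≤ a_k`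
(uses `P, D ≥ 0` and `θ_{k+1}τ_{k+1} ≤ (1 + θ_k)τ_k`). [cite: MalitskyPock2018, Thm 1 (proof, (14))] -/
theorem lyap_succ_add_diss_le (h : IsLinesearchRun K g fs C D β δ x y τ) (hβ : 0 < β) {xh : X}
    {yh : Y} (hs : IsSaddleOn K g fs C D xh yh) (k : ℕ) :
    lyap K g β x y τ xh yh (k + 1) + diss β δ x y τ k ≤ lyap K g β x y τ xh yh k := by
  have hstep := h.step_le hβ hs.1 hs.2.1 k
  have hP : 0 ≤ pgap K g xh yh (x k) := pgap_nonneg hs (h.x_mem k)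
  have hD : 0 ≤ dgap K fs xh yh (y (k + 1)) := dgap_nonneg hs (h.y_succ_mem k)
  have hθτ := theta_mul_le h.pos h.trial k
  have hτ1 := (h.pos (k + 1)).le
  have h1 : τ (k + 1) * theta τ (k + 1) * pgap K g xh yh (x k) ≤
      τ k * (1 + theta τ k) * pgap K g xh yh (x k) := by
    have := mul_le_mul_of_nonneg_right hθτ hP
    nlinarith [this]
  have h2 : 0 ≤ τ (k + 1) * dgap K fs xh yh (y (k + 1)) := mul_nonneg hτ1 hD
  have ek : lyap K g β x y τ xh yh k = ‖x (k + 1) - xh‖ ^ 2 / 2 + ‖y k - yh‖ ^ 2 / (2 * β)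
      + τ k * (1 + theta τ k) * pgap K g xh yh (x k) := rfl
  have ek1 : lyap K g β x y τ xh yh (k + 1) = ‖x (k + 2) - xh‖ ^ 2 / 2
      + ‖y (k + 1) - yh‖ ^ 2 / (2 * β)
      + τ (k + 1) * (1 + theta τ (k + 1)) * pgap K g xh yh (x (k + 1)) := rfl
  have ed : diss β δ x y τ k = ‖xbar x τ (k + 1) - x (k + 1)‖ ^ 2 / 2
      + (1 - δ ^ 2) / (2 * β) * ‖y (k + 1) - y k‖ ^ 2 := rfl
  have e1 : (‖y k - yh‖ ^ 2 - ‖y (k + 1) - yh‖ ^ 2) / (2 * β) =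
      ‖y k - yh‖ ^ 2 / (2 * β) - ‖y (k + 1) - yh‖ ^ 2 / (2 * β) := by ring
  have e2 : τ (k + 1) * ((1 + theta τ (k + 1)) * pgap K g xh yh (x (k + 1))
      - theta τ (k + 1) * pgap K g xh yh (x k) + dgap K fs xh yh (y (k + 1))) =
      τ (k + 1) * (1 + theta τ (k + 1)) * pgap K g xh yh (x (k + 1))
        - τ (k + 1) * theta τ (k + 1) * pgap K g xh yh (x k)
        + τ (k + 1) * dgap K fs xh yh (y (k + 1)) := by ring
  rw [ek, ek1, ed]
  rw [e1, e2] at hstep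
  linarith [hstep, h1, h2]

/-- `a_k ≥ 0` at a saddle point. [cite: MalitskyPock2018, Thm 1 (proof)] -/
theorem lyap_nonneg (h : IsLinesearchRun K g fs C D β δ x y τ) (hβ : 0 < β) {xh : X} {yh : Y}
    (hs : IsSaddleOn K g fs C D xh yh) (k : ℕ) : 0 ≤ lyap K g β x y τ xh yh k := by
  have hP : 0 ≤ pgap K g xh yh (x k) := pgap_nonneg hs (h.x_mem k)
  have hθ := (theta_pos h.pos k).le
  have hτ := (h.pos k).le
  simp only [lyap]
  positivity

omit [CompleteSpace X] [InnerProductSpace ℝ Y] [CompleteSpace Y] in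
/-- The dissipated quantity is nonnegative for `δ ∈ [0, 1]`. [cite: MalitskyPock2018, Thm 1 (proof, (14))] -/
theorem diss_nonneg (hβ : 0 < β) (hδ0 : 0 ≤ δ) (hδ1 : δ ≤ 1) (x : ℕ → X) (y : ℕ → Y) (τ : ℕ → ℝ)
    (k : ℕ) : 0 ≤ diss β δ x y τ k := by
  have : 0 ≤ 1 - δ ^ 2 := by nlinarith
  simp only [diss]
  positivity

/-- `a_k` is nonincreasing, hence `a_k ≤ a_0`. [cite: MalitskyPock2018, Thm 1 (proof, after (14))] -/
theorem lyap_le_lyap_zero (h : IsLinesearchRun K g fs C D β δ x y τ) (hβ : 0 < β) (hδ0 : 0 ≤ δ)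
    (hδ1 : δ ≤ 1) {xh : X} {yh : Y} (hs : IsSaddleOn K g fs C D xh yh) (k : ℕ) :
    lyap K g β x y τ xh yh k ≤ lyap K g β x y τ xh yh 0 := by
  induction k with
  | zero => exact le_rfl
  | succ k ih =>
      exact (le_of_add_le_of_nonneg_left (h.lyap_succ_add_diss_le hβ hs k)
        (diss_nonneg hβ hδ0 hδ1 x y τ k)).trans ih

/-- The dissipation is summable: `Σ_{k<N} (½‖x̄^{k+1} − x^{k+1}‖² + ((1−δ²)/2β)‖y^{k+2} − y^{k+1}‖²) ≤ a_0`.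
[cite: MalitskyPock2018, Thm 1 (proof, after (14))] -/
theorem sum_diss_le (h : IsLinesearchRun K g fs C D β δ x y τ) (hβ : 0 < β) {xh : X} {yh : Y}
    (hs : IsSaddleOn K g fs C D xh yh) (N : ℕ) :
    ∑ k ∈ Finset.range N, diss β δ x y τ k ≤ lyap K g β x y τ xh yh 0 := by
  have htel : ∀ N, ∑ k ∈ Finset.range N, diss β δ x y τ k ≤
      lyap K g β x y τ xh yh 0 - lyap K g β x y τ xh yh N := by
    intro N
    induction N with
    | zero => simp
    | succ N ih =>
        rw [Finset.sum_range_succ]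
        linarith [h.lyap_succ_add_diss_le hβ hs N]
  linarith [htel N, h.lyap_nonneg hβ hs N]

/-- **Theorem 1 (boundedness)**: `‖x^{k+1} − x̂‖² ≤ 2a_0` and `‖y^{k+1} − ŷ‖² ≤ 2β a_0` for every
`k`, at any saddle point `(x̂, ŷ)`. [cite: MalitskyPock2018, Thm 1] -/
theorem norm_sub_sq_le (h : IsLinesearchRun K g fs C D β δ x y τ) (hβ : 0 < β) (hδ0 : 0 ≤ δ)
    (hδ1 : δ ≤ 1) {xh : X} {yh : Y} (hs : IsSaddleOn K g fs C D xh yh) (k : ℕ) :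
    ‖x (k + 1) - xh‖ ^ 2 ≤ 2 * lyap K g β x y τ xh yh 0 ∧
      ‖y k - yh‖ ^ 2 ≤ 2 * β * lyap K g β x y τ xh yh 0 := by
  have h1 := h.lyap_le_lyap_zero hβ hδ0 hδ1 hs k
  have hP : 0 ≤ pgap K g xh yh (x k) := pgap_nonneg hs (h.x_mem k)
  have hθ := (theta_pos h.pos k).le
  have hτ := (h.pos k).le
  have hPt : 0 ≤ τ k * (1 + theta τ k) * pgap K g xh yh (x k) := by positivity
  have ek : lyap K g β x y τ xh yh k = ‖x (k + 1) - xh‖ ^ 2 / 2 + ‖y k - yh‖ ^ 2 / (2 * β)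
      + τ k * (1 + theta τ k) * pgap K g xh yh (x k) := rfl
  have hyn : 0 ≤ ‖y k - yh‖ ^ 2 / (2 * β) := by positivity
  have hxn : 0 ≤ ‖x (k + 1) - xh‖ ^ 2 / 2 := by positivity
  constructor
  · linarith
  · have hy : ‖y k - yh‖ ^ 2 / (2 * β) ≤ lyap K g β x y τ xh yh 0 := by linarith
    have := (div_le_iff₀ (by positivity : (0:ℝ) < 2 * β)).1 hy
    linarith

/-- The dissipation tends to zero: `‖x̄^{k+1} − x^{k+1}‖ → 0` and `‖y^{k+2} − y^{k+1}‖ → 0`.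
[cite: MalitskyPock2018, Thm 1 (proof, after (14))] -/
theorem tendsto_diss (h : IsLinesearchRun K g fs C D β δ x y τ) (hβ : 0 < β) (hδ0 : 0 ≤ δ)
    (hδ1 : δ < 1) {xh : X} {yh : Y} (hs : IsSaddleOn K g fs C D xh yh) :
    Tendsto (fun k => xbar x τ (k + 1) - x (k + 1)) atTop (𝓝 0) ∧
      Tendsto (fun k => y (k + 1) - y k) atTop (𝓝 0) := by
  have hsum : Summable fun k => diss β δ x y τ k :=
    summable_of_sum_range_le (fun k => diss_nonneg hβ hδ0 hδ1.le x y τ k) (h.sum_diss_le hβ hs)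
  have h0 := hsum.tendsto_atTop_zero
  have hc : 0 < (1 - δ ^ 2) / (2 * β) := by
    have : 0 < 1 - δ ^ 2 := by nlinarith
    positivity
  constructor
  · have h1 : Tendsto (fun k => ‖xbar x τ (k + 1) - x (k + 1)‖ ^ 2) atTop (𝓝 0) := by
      refine squeeze_zero (fun k => by positivity) (fun k => ?_) (h0.const_mul 2 |>.trans_eq ?_)
      · simp only [diss]
        have : 0 ≤ (1 - δ ^ 2) / (2 * β) * ‖y (k + 1) - y k‖ ^ 2 := by positivity
        linarith
      · simp
    have h2 := h1.sqrt
    rw [Real.sqrt_zero] at h2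
    rw [tendsto_zero_iff_norm_tendsto_zero]
    simpa [Real.sqrt_sq (norm_nonneg _)] using h2
  · have h1 : Tendsto (fun k => ‖y (k + 1) - y k‖ ^ 2) atTop (𝓝 0) := by
      refine squeeze_zero (fun k => by positivity) (fun k => ?_)
        (h0.const_mul ((1 - δ ^ 2) / (2 * β))⁻¹ |>.trans_eq ?_)
      · simp only [diss]
        rw [← div_le_iff₀' (inv_pos.2 hc), div_inv_eq_mul, mul_comm]
        have : 0 ≤ ‖xbar x τ (k + 1) - x (k + 1)‖ ^ 2 / 2 := by positivity
        linarith
      · simp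
    have h2 := h1.sqrt
    rw [Real.sqrt_zero] at h2
    rw [tendsto_zero_iff_norm_tendsto_zero]
    simpa [Real.sqrt_sq (norm_nonneg _)] using h2

/-! ### Theorem 1: cluster points are saddle points; convergence of the whole sequence -/

omit [CompleteSpace X] in
/-- `(x^{k+1} − x^k)/τ_k = (x̄^{k+1} − x^{k+1})/τ_{k+1}`. [cite: MalitskyPock2018, Thm 1 (proof, after (14))] -/
theorem inv_smul_sub_eq (hpos : ∀ k, 0 < τ k) (x : ℕ → X) (k : ℕ) :
    (τ k)⁻¹ • (x (k + 1) - x k) = (τ (k + 1))⁻¹ • (xbar x τ (k + 1) - x (k + 1)) := by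
  rw [xbar_sub, theta_succ, smul_smul, div_eq_mul_inv, ← mul_assoc, inv_mul_cancel₀ (hpos _).ne',
    one_mul]

/-- `(x^{k+1} − x^k)/τ_k → 0` when the steps are bounded below (Lemma 1 (ii)) and
`‖x̄^{k+1} − x^{k+1}‖ → 0`. [cite: MalitskyPock2018, Thm 1 (proof, after (14))] -/
theorem tendsto_inv_smul_sub (h : IsLinesearchRun K g fs C D β δ x y τ) (hβ : 0 < β) (hδ0 : 0 ≤ δ)
    (hδ1 : δ < 1) {xh : X} {yh : Y} (hs : IsSaddleOn K g fs C D xh yh) {τlo : ℝ} (hτlo : 0 < τlo)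
    (hlo : ∀ k, τlo ≤ τ k) :
    Tendsto (fun k => (τ k)⁻¹ • (x (k + 1) - x k)) atTop (𝓝 0) := by
  have hd := (h.tendsto_diss hβ hδ0 hδ1 hs).1
  rw [tendsto_zero_iff_norm_tendsto_zero] at hd ⊢
  refine squeeze_zero (fun k => norm_nonneg _) (fun k => ?_) (hd.const_mul τlo⁻¹ |>.trans_eq ?_)
  · rw [inv_smul_sub_eq h.pos, norm_smul, Real.norm_eq_abs, abs_inv, abs_of_pos (h.pos _)]
    exact mul_le_mul_of_nonneg_right ((inv_le_inv₀ (h.pos _) hτlo).2 (hlo _)) (norm_nonneg _)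
  · simp

/-- `x^{k+1} − x^k → 0` when the steps are bounded below and above.
[cite: MalitskyPock2018, Thm 1 (proof, last paragraph)] -/
theorem tendsto_sub (h : IsLinesearchRun K g fs C D β δ x y τ) (hβ : 0 < β) (hδ0 : 0 ≤ δ)
    (hδ1 : δ < 1) {xh : X} {yh : Y} (hs : IsSaddleOn K g fs C D xh yh) {τlo τhi : ℝ}
    (hτlo : 0 < τlo) (hlo : ∀ k, τlo ≤ τ k) (hhi : ∀ k, τ k ≤ τhi) :
    Tendsto (fun k => x (k + 1) - x k) atTop (𝓝 0) := by
  have h1 := h.tendsto_inv_smul_sub hβ hδ0 hδ1 hs hτlo hlo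
  rw [tendsto_zero_iff_norm_tendsto_zero] at h1 ⊢
  refine squeeze_zero (fun k => norm_nonneg _) (fun k => ?_) (h1.const_mul τhi |>.trans_eq ?_)
  · rw [norm_smul, Real.norm_eq_abs, abs_inv, abs_of_pos (h.pos _)]
    have hτk := h.pos k
    calc ‖x (k + 1) - x k‖ = τ k * ((τ k)⁻¹ * ‖x (k + 1) - x k‖) := by
          rw [← mul_assoc, mul_inv_cancel₀ hτk.ne', one_mul]
      _ ≤ τhi * ((τ k)⁻¹ * ‖x (k + 1) - x k‖) :=
          mul_le_mul_of_nonneg_right (hhi k) (by positivity)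
  · simp

/-- Passing to the limit in an inequality whose left side is only lower semicontinuous:
if `G − ε < g_n` eventually for every `ε > 0`, `b_n → L` and `g_n − c ≤ b_n`, then `G − c ≤ L`.
[cite: MalitskyPock2018, Thm 1 (proof, "passing to the limit")] -/
theorem sub_le_of_eventually_lt {gseq b : ℕ → ℝ} {G c L : ℝ}
    (hg : ∀ ε > 0, ∀ᶠ n in atTop, G - ε < gseq n) (hb : Tendsto b atTop (𝓝 L))
    (hle : ∀ n, gseq n - c ≤ b n) : G - c ≤ L := by
  refine le_of_forall_pos_lt_add fun ε hε => ?_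
  have h1 := hg (ε / 2) (by positivity)
  have h2 : ∀ᶠ n in atTop, b n < L + ε / 2 := hb.eventually (gt_mem_nhds (by linarith))
  obtain ⟨n, hn1, hn2⟩ := (h1.and h2).exists
  linarith [hle n]

omit [InnerProductSpace ℝ X] [CompleteSpace X] in
/-- A function continuous on `C` is lower semicontinuous on `C` (the hypothesis of Theorem 1 for `g`
implies the standing one). [cite: MalitskyPock2018, Thm 1 (hypotheses)] -/
theorem lowerSemicontinuousOn_of_continuousOn {f : X → ℝ} {C : Set X} (hf : ContinuousOn f C) :
    LowerSemicontinuousOn f C :=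
  fun x hx _ hy => (hf x hx).tendsto.eventually (lt_mem_nhds hy)

/-- **Theorem 1 (first part): every cluster point of the PDAL iterates `(x^k, y^k)` is a saddle
point.** Hypotheses: `β > 0`, `δ ∈ [0,1)`, a saddle point exists (standing assumption), `C = dom g`
and `D = dom f*` closed with `g`, `f*` lower semicontinuous on them (standing assumption: proper
l.s.c.), and the accepted steps bounded below `τ_k ≥ τlo > 0` (Lemma 1 (ii) — automatic for the
backtracking linesearch, `linesearchRun_tau_ge`). [cite: MalitskyPock2018, Thm 1] -/
theorem isSaddleOn_of_tendsto (h : IsLinesearchRun K g fs C D β δ x y τ) (hβ : 0 < β) (hδ0 : 0 ≤ δ)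
    (hδ1 : δ < 1) (hsad : ∃ xh yh, IsSaddleOn K g fs C D xh yh) {τlo : ℝ} (hτlo : 0 < τlo)
    (hlo : ∀ k, τlo ≤ τ k) (hC : IsClosed C) (hD : IsClosed D) (hg : LowerSemicontinuousOn g C)
    (hfs : LowerSemicontinuousOn fs D) {xs : X} {ys : Y} {φ : ℕ → ℕ} (hφ : StrictMono φ)
    (hlim : Tendsto (fun n => (x (φ n + 1), y (φ n))) atTop (𝓝 (xs, ys))) :
    IsSaddleOn K g fs C D xs ys := by
  obtain ⟨xh, yh, hs⟩ := hsad
  obtain ⟨hdx, hdy⟩ := h.tendsto_diss hβ hδ0 hδ1 hs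
  have hx : Tendsto (fun n => x (φ n + 1)) atTop (𝓝 xs) := by
    simpa [Function.comp_def] using (continuous_fst.tendsto _).comp hlim
  have hy : Tendsto (fun n => y (φ n)) atTop (𝓝 ys) := by
    simpa [Function.comp_def] using (continuous_snd.tendsto _).comp hlim
  have hφt := hφ.tendsto_atTop
  -- shifted sequences converge to the same limits
  have hy1 : Tendsto (fun n => y (φ n + 1)) atTop (𝓝 ys) := by
    have := hy.add (hdy.comp hφt)
    simpa [Function.comp_def] using this
  have hxb : Tendsto (fun n => xbar x τ (φ n + 1)) atTop (𝓝 xs) := by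
    have := hx.add (hdx.comp hφt)
    simpa [Function.comp_def] using this
  -- membership of the limits
  have hxsC : xs ∈ C := hC.mem_of_tendsto hx (Eventually.of_forall fun n => h.x_mem _)
  have hysD : ys ∈ D := hD.mem_of_tendsto hy1 (Eventually.of_forall fun n => h.y_succ_mem _)
  -- within-set convergence
  have hxC : Tendsto (fun n => x (φ n + 1)) atTop (𝓝[C] xs) :=
    tendsto_nhdsWithin_iff.2 ⟨hx, Eventually.of_forall fun n => h.x_mem _⟩
  have hyD : Tendsto (fun n => y (φ n + 1)) atTop (𝓝[D] ys) :=
    tendsto_nhdsWithin_iff.2 ⟨hy1, Eventually.of_forall fun n => h.y_succ_mem _⟩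
  -- the vanishing increments
  have hix : Tendsto (fun n => (τ (φ n))⁻¹ • (x (φ n + 1) - x (φ n))) atTop (𝓝 0) :=
    (h.tendsto_inv_smul_sub hβ hδ0 hδ1 hs hτlo hlo).comp hφt
  have hiy : Tendsto (fun n => (β * τ (φ n + 1))⁻¹ • (y (φ n + 1) - y (φ n))) atTop (𝓝 0) := by
    have hd : Tendsto (fun n => y (φ n + 1) - y (φ n)) atTop (𝓝 0) := hdy.comp hφt
    rw [tendsto_zero_iff_norm_tendsto_zero] at hd ⊢
    refine squeeze_zero (fun n => norm_nonneg _) (fun n => ?_)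
      (hd.const_mul (β * τlo)⁻¹ |>.trans_eq (by simp))
    have hp : 0 < β * τ (φ n + 1) := mul_pos hβ (h.pos _)
    rw [norm_smul, Real.norm_eq_abs, abs_inv, abs_of_pos hp]
    exact mul_le_mul_of_nonneg_right
      ((inv_le_inv₀ hp (mul_pos hβ hτlo)).2 (mul_le_mul_of_nonneg_left (hlo _) hβ.le))
      (norm_nonneg _)
  refine ⟨hxsC, hysD, fun x' hx' => ?_, fun y' hy' => ?_⟩
  · -- the primal saddle inequality `L(xs, ys) ≤ L(x', ys)`
    have hle : ∀ n, g (x (φ n + 1)) - g x' ≤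
        ⟪(τ (φ n))⁻¹ • (x (φ n + 1) - x (φ n)), x' - x (φ n + 1)⟫
          + ⟪K.adjoint (y (φ n)), x' - x (φ n + 1)⟫ := by
      intro n
      have hp := (h.primal (φ n)).2 x' hx'
      have hτ := h.pos (φ n)
      have e : x (φ n + 1) - (x (φ n) - τ (φ n) • K.adjoint (y (φ n))) =
          (x (φ n + 1) - x (φ n)) + τ (φ n) • K.adjoint (y (φ n)) := by abel
      rw [e, inner_add_left, real_inner_smul_left] at hp
      rw [real_inner_smul_left]
      have hne := hτ.ne'
      have h3 := mul_le_mul_of_nonneg_left hp (inv_pos.2 hτ).le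
      have e1 : (τ (φ n))⁻¹ * (τ (φ n) * (g (x (φ n + 1)) - g x')) = g (x (φ n + 1)) - g x' := by
        rw [← mul_assoc, inv_mul_cancel₀ hne, one_mul]
      have e2 : (τ (φ n))⁻¹ * (⟪x (φ n + 1) - x (φ n), x' - x (φ n + 1)⟫
          + τ (φ n) * ⟪K.adjoint (y (φ n)), x' - x (φ n + 1)⟫) =
          (τ (φ n))⁻¹ * ⟪x (φ n + 1) - x (φ n), x' - x (φ n + 1)⟫
            + ⟪K.adjoint (y (φ n)), x' - x (φ n + 1)⟫ := by
        rw [mul_add, ← mul_assoc _ (τ (φ n)), inv_mul_cancel₀ hne, one_mul]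
      linarith [h3, e1, e2]
    have hb : Tendsto (fun n => ⟪(τ (φ n))⁻¹ • (x (φ n + 1) - x (φ n)), x' - x (φ n + 1)⟫
        + ⟪K.adjoint (y (φ n)), x' - x (φ n + 1)⟫) atTop
        (𝓝 (⟪(0 : X), x' - xs⟫ + ⟪K.adjoint ys, x' - xs⟫)) :=
      (hix.inner (tendsto_const_nhds.sub hx)).add
        (((K.adjoint.continuous.tendsto _).comp hy).inner (tendsto_const_nhds.sub hx))
    rw [inner_zero_left, zero_add] at hb
    have hlsc : ∀ ε > 0, ∀ᶠ n in atTop, g xs - ε < g (x (φ n + 1)) := fun ε hε =>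
      hxC.eventually (hg xs hxsC (g xs - ε) (by linarith))
    have := sub_le_of_eventually_lt hlsc hb hle
    simp only [lagr]
    rw [ContinuousLinearMap.adjoint_inner_left, map_sub, inner_sub_right, real_inner_comm (K x') ys,
      real_inner_comm (K xs) ys] at this
    linarith
  · -- the dual saddle inequality `L(xs, y') ≤ L(xs, ys)`
    have hle : ∀ n, fs (y (φ n + 1)) - fs y' ≤
        ⟪(β * τ (φ n + 1))⁻¹ • (y (φ n + 1) - y (φ n)), y' - y (φ n + 1)⟫
          - ⟪K (xbar x τ (φ n + 1)), y' - y (φ n + 1)⟫ := by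
      intro n
      have hp := (h.dual (φ n)).2 y' hy'
      have hτ : 0 < β * τ (φ n + 1) := mul_pos hβ (h.pos _)
      have e : y (φ n + 1) - (y (φ n) + (β * τ (φ n + 1)) • K (xbar x τ (φ n + 1))) =
          (y (φ n + 1) - y (φ n)) - (β * τ (φ n + 1)) • K (xbar x τ (φ n + 1)) := by abel
      rw [e, inner_sub_left, real_inner_smul_left] at hp
      rw [real_inner_smul_left]
      have hne := hτ.ne'
      have h3 := mul_le_mul_of_nonneg_left hp (inv_pos.2 hτ).le
      have e1 : (β * τ (φ n + 1))⁻¹ * ((β * τ (φ n + 1)) * (fs (y (φ n + 1)) - fs y')) =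
          fs (y (φ n + 1)) - fs y' := by
        rw [← mul_assoc, inv_mul_cancel₀ hne, one_mul]
      have e2 : (β * τ (φ n + 1))⁻¹ * (⟪y (φ n + 1) - y (φ n), y' - y (φ n + 1)⟫
          - (β * τ (φ n + 1)) * ⟪K (xbar x τ (φ n + 1)), y' - y (φ n + 1)⟫) =
          (β * τ (φ n + 1))⁻¹ * ⟪y (φ n + 1) - y (φ n), y' - y (φ n + 1)⟫
            - ⟪K (xbar x τ (φ n + 1)), y' - y (φ n + 1)⟫ := by
        rw [mul_sub, ← mul_assoc _ (β * τ (φ n + 1)), inv_mul_cancel₀ hne, one_mul]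
      linarith [h3, e1, e2]
    have hb : Tendsto (fun n => ⟪(β * τ (φ n + 1))⁻¹ • (y (φ n + 1) - y (φ n)), y' - y (φ n + 1)⟫
        - ⟪K (xbar x τ (φ n + 1)), y' - y (φ n + 1)⟫) atTop
        (𝓝 (⟪(0 : Y), y' - ys⟫ - ⟪K xs, y' - ys⟫)) :=
      (hiy.inner (tendsto_const_nhds.sub hy1)).sub
        (((K.continuous.tendsto _).comp hxb).inner (tendsto_const_nhds.sub hy1))
    rw [inner_zero_left, zero_sub] at hb
    have hlsc : ∀ ε > 0, ∀ᶠ n in atTop, fs ys - ε < fs (y (φ n + 1)) := fun ε hε =>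
      hyD.eventually (hfs ys hysD (fs ys - ε) (by linarith))
    have := sub_le_of_eventually_lt hlsc hb hle
    simp only [lagr]
    rw [inner_sub_right] at this
    linarith

/-- **Theorem 1 (second part): convergence of the whole sequence.** In finite dimensions, if in
addition `g` is continuous on `C = dom g` and the accepted steps are bounded above, `τ_k ≤ τhi`,
then the PDAL iterates `(x^{k+1}, y^{k+1})` converge to a saddle point.
[cite: MalitskyPock2018, Thm 1] -/
theorem tendsto_iterates [FiniteDimensional ℝ X] [FiniteDimensional ℝ Y]
    (h : IsLinesearchRun K g fs C D β δ x y τ) (hβ : 0 < β) (hδ0 : 0 ≤ δ) (hδ1 : δ < 1)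
    (hsad : ∃ xh yh, IsSaddleOn K g fs C D xh yh) {τlo τhi : ℝ} (hτlo : 0 < τlo)
    (hlo : ∀ k, τlo ≤ τ k) (hhi : ∀ k, τ k ≤ τhi) (hC : IsClosed C) (hD : IsClosed D)
    (hg : ContinuousOn g C) (hfs : LowerSemicontinuousOn fs D) :
    ∃ xs ys, IsSaddleOn K g fs C D xs ys ∧
      Tendsto (fun k => (x (k + 1), y k)) atTop (𝓝 (xs, ys)) := by
  obtain ⟨xh, yh, hs⟩ := hsad
  set z : ℕ → X × Y := fun k => (x (k + 1), y k) with hz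
  -- boundedness
  set a0 := lyap K g β x y τ xh yh 0 with ha0
  have ha0nn : 0 ≤ a0 := h.lyap_nonneg hβ hs 0
  set R : ℝ := Real.sqrt (2 * a0) + Real.sqrt (2 * β * a0) with hR
  have hmem : ∀ k, z k ∈ Metric.closedBall ((xh, yh) : X × Y) R := fun k => by
    obtain ⟨h1, h2⟩ := h.norm_sub_sq_le hβ hδ0 hδ1.le hs k
    rw [Metric.mem_closedBall, dist_eq_norm]
    have e1 : ‖x (k + 1) - xh‖ ≤ Real.sqrt (2 * a0) := Real.le_sqrt_of_sq_le h1
    have e2 : ‖y k - yh‖ ≤ Real.sqrt (2 * β * a0) := Real.le_sqrt_of_sq_le h2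
    calc ‖z k - (xh, yh)‖ = max ‖x (k + 1) - xh‖ ‖y k - yh‖ := rfl
      _ ≤ R := max_le (e1.trans (le_add_of_nonneg_right (Real.sqrt_nonneg _)))
          (e2.trans (le_add_of_nonneg_left (Real.sqrt_nonneg _)))
  obtain ⟨zs, -, φ, hφ, hlim⟩ := tendsto_subseq_of_bounded Metric.isBounded_closedBall hmem
  have hlim' : Tendsto (fun n => (x (φ n + 1), y (φ n))) atTop (𝓝 (zs.1, zs.2)) := by
    simpa [hz, Function.comp_def] using hlim
  -- the cluster point is a saddle point
  have hss : IsSaddleOn K g fs C D zs.1 zs.2 :=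
    h.isSaddleOn_of_tendsto hβ hδ0 hδ1 ⟨xh, yh, hs⟩ hτlo hlo hC hD
      (lowerSemicontinuousOn_of_continuousOn hg) hfs hφ hlim'
  -- the Lyapunov sequence towards it is nonincreasing and tends to zero along `φ`
  set a : ℕ → ℝ := lyap K g β x y τ zs.1 zs.2 with ha
  have hanti : Antitone a := antitone_nat_of_succ_le fun k =>
    le_of_add_le_of_nonneg_left (h.lyap_succ_add_diss_le hβ hss k)
      (diss_nonneg hβ hδ0 hδ1.le x y τ k)
  have hann : ∀ k, 0 ≤ a k := fun k => h.lyap_nonneg hβ hss k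
  have hx : Tendsto (fun n => x (φ n + 1)) atTop (𝓝 zs.1) := by
    simpa [Function.comp_def] using (continuous_fst.tendsto _).comp hlim'
  have hy : Tendsto (fun n => y (φ n)) atTop (𝓝 zs.2) := by
    simpa [Function.comp_def] using (continuous_snd.tendsto _).comp hlim'
  have hx0 : Tendsto (fun n => x (φ n)) atTop (𝓝 zs.1) := by
    have hd := (h.tendsto_sub hβ hδ0 hδ1 hs hτlo hlo hhi).comp hφ.tendsto_atTop
    have := hx.sub hd
    simpa [Function.comp_def] using this
  have hPlim : Tendsto (fun n => pgap K g zs.1 zs.2 (x (φ n))) atTop (𝓝 0) := by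
    have hxC : Tendsto (fun n => x (φ n)) atTop (𝓝[C] zs.1) :=
      tendsto_nhdsWithin_iff.2 ⟨hx0, Eventually.of_forall fun n => h.x_mem _⟩
    have hgl : Tendsto (fun n => g (x (φ n))) atTop (𝓝 (g zs.1)) :=
      (hg zs.1 hss.1).tendsto.comp hxC
    have hin : Tendsto (fun n => ⟪K (x (φ n) - zs.1), zs.2⟫) atTop (𝓝 ⟪K (zs.1 - zs.1), zs.2⟫) :=
      ((K.continuous.tendsto _).comp (hx0.sub tendsto_const_nhds)).inner tendsto_const_nhds
    rw [sub_self, map_zero, inner_zero_left] at hin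
    have := (hgl.sub tendsto_const_nhds (b := g zs.1)).add hin
    simpa [pgap] using this
  have haφ : Tendsto (fun n => a (φ n)) atTop (𝓝 0) := by
    -- the three summands tend to zero
    have h1 : Tendsto (fun n => ‖x (φ n + 1) - zs.1‖ ^ 2 / 2) atTop (𝓝 0) := by
      have := ((continuous_norm.tendsto _).comp (hx.sub tendsto_const_nhds (b := zs.1))).pow 2
      simpa using this.div_const 2
    have h2 : Tendsto (fun n => ‖y (φ n) - zs.2‖ ^ 2 / (2 * β)) atTop (𝓝 0) := by
      have := ((continuous_norm.tendsto _).comp (hy.sub tendsto_const_nhds (b := zs.2))).pow 2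
      simpa using this.div_const (2 * β)
    have h3 : Tendsto (fun n => τ (φ n) * (1 + theta τ (φ n)) * pgap K g zs.1 zs.2 (x (φ n)))
        atTop (𝓝 0) := by
      have hM : ∀ n, |τ (φ n) * (1 + theta τ (φ n))| ≤ τhi * (1 + Real.goldenRatio) := fun n => by
        have hθ := theta_le_goldenRatio h.pos h.trial (φ n)
        have hθ0 := (theta_pos h.pos (φ n)).le
        have hτ0 := (h.pos (φ n)).le
        rw [abs_of_nonneg (mul_nonneg hτ0 (by linarith))]
        exact mul_le_mul (hhi _) (by linarith) (by linarith) ((h.pos 0).le.trans (hhi 0))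
      rw [tendsto_zero_iff_norm_tendsto_zero] at hPlim ⊢
      refine squeeze_zero (fun n => norm_nonneg _) (fun n => ?_)
        (hPlim.const_mul (τhi * (1 + Real.goldenRatio)) |>.trans_eq (by simp))
      rw [Real.norm_eq_abs, abs_mul, Real.norm_eq_abs]
      exact mul_le_mul_of_nonneg_right (hM n) (abs_nonneg _)
    have := (h1.add h2).add h3
    simpa [ha, lyap] using this
  have ha0lim : Tendsto a atTop (𝓝 0) := by
    rw [Metric.tendsto_atTop]
    intro ε hε
    obtain ⟨n, hn⟩ := (Metric.tendsto_atTop.mp haφ) ε hε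
    refine ⟨φ n, fun k hk => ?_⟩
    have h1 := hn n le_rfl
    rw [Real.dist_eq, sub_zero, abs_of_nonneg (hann _)] at h1 ⊢
    exact lt_of_le_of_lt (hanti hk) h1
  -- conclude
  refine ⟨zs.1, zs.2, hss, ?_⟩
  have hbd : ∀ k, ‖x (k + 1) - zs.1‖ ^ 2 ≤ 2 * a k ∧ ‖y k - zs.2‖ ^ 2 ≤ 2 * β * a k := fun k => by
    have hP : 0 ≤ pgap K g zs.1 zs.2 (x k) := pgap_nonneg hss (h.x_mem k)
    have hθ := (theta_pos h.pos k).le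
    have hτ := (h.pos k).le
    have hPt : 0 ≤ τ k * (1 + theta τ k) * pgap K g zs.1 zs.2 (x k) := by positivity
    have ek : a k = ‖x (k + 1) - zs.1‖ ^ 2 / 2 + ‖y k - zs.2‖ ^ 2 / (2 * β)
        + τ k * (1 + theta τ k) * pgap K g zs.1 zs.2 (x k) := rfl
    have hyn : 0 ≤ ‖y k - zs.2‖ ^ 2 / (2 * β) := by positivity
    have hxn : 0 ≤ ‖x (k + 1) - zs.1‖ ^ 2 / 2 := by positivity
    constructor
    · linarith
    · have hy' : ‖y k - zs.2‖ ^ 2 / (2 * β) ≤ a k := by linarith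
      have := (div_le_iff₀ (by positivity : (0:ℝ) < 2 * β)).1 hy'
      linarith
  rw [tendsto_iff_norm_sub_tendsto_zero]
  have e1 : Tendsto (fun k => ‖x (k + 1) - zs.1‖) atTop (𝓝 0) := by
    have hsq : Tendsto (fun k => ‖x (k + 1) - zs.1‖ ^ 2) atTop (𝓝 0) :=
      squeeze_zero (fun k => by positivity) (fun k => (hbd k).1)
        (by simpa using ha0lim.const_mul 2)
    simpa [Real.sqrt_sq (norm_nonneg _)] using hsq.sqrt
  have e2 : Tendsto (fun k => ‖y k - zs.2‖) atTop (𝓝 0) := by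
    have hsq : Tendsto (fun k => ‖y k - zs.2‖ ^ 2) atTop (𝓝 0) :=
      squeeze_zero (fun k => by positivity) (fun k => (hbd k).2)
        (by simpa using ha0lim.const_mul (2 * β))
    simpa [Real.sqrt_sq (norm_nonneg _)] using hsq.sqrt
  have hmax := e1.max e2
  simpa [Prod.norm_def] using hmax

/-! ### Theorem 2: the ergodic `O(1/N)` rate of the primal–dual gap -/

/-- Summing (13) over `k = 1, …, N` (here `i = k − 1 < N`) and dropping the dissipation:
`Σ ε_k ≤ ½‖x^1 − x̂‖² − ½‖x^{N+1} − x̂‖² + (1/2β)(‖y^1 − ŷ‖² − ‖y^{N+1} − ŷ‖²)` (15), for every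
`(x̂, ŷ) ∈ C × D`. [cite: MalitskyPock2018, Thm 2 (proof, (15))] -/
theorem sum_step_le (h : IsLinesearchRun K g fs C D β δ x y τ) (hβ : 0 < β) (hδ0 : 0 ≤ δ)
    (hδ1 : δ ≤ 1) {xh : X} {yh : Y} (hxh : xh ∈ C) (hyh : yh ∈ D) (N : ℕ) :
    ∑ i ∈ Finset.range N, τ (i + 1) * ((1 + theta τ (i + 1)) * pgap K g xh yh (x (i + 1))
      - theta τ (i + 1) * pgap K g xh yh (x i) + dgap K fs xh yh (y (i + 1))) ≤
      ‖x 1 - xh‖ ^ 2 / 2 - ‖x (N + 1) - xh‖ ^ 2 / 2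
        + (‖y 0 - yh‖ ^ 2 / (2 * β) - ‖y N - yh‖ ^ 2 / (2 * β)) := by
  induction N with
  | zero => simp
  | succ N ih =>
      rw [Finset.sum_range_succ]
      have hs := h.step_le hβ hxh hyh N
      have hd := diss_nonneg hβ hδ0 hδ1 x y τ N
      have e1 : (‖y N - yh‖ ^ 2 - ‖y (N + 1) - yh‖ ^ 2) / (2 * β) =
          ‖y N - yh‖ ^ 2 / (2 * β) - ‖y (N + 1) - yh‖ ^ 2 / (2 * β) := by ring
      have ed : diss β δ x y τ N = ‖xbar x τ (N + 1) - x (N + 1)‖ ^ 2 / 2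
          + (1 - δ ^ 2) / (2 * β) * ‖y (N + 1) - y N‖ ^ 2 := rfl
      rw [e1] at hs
      rw [show N + 1 + 1 = N + 2 from rfl]
      linarith

/-- The regrouped weights are nonnegative (because `θ_{k+1} τ_{k+1} ≤ (1 + θ_k) τ_k`).
[cite: MalitskyPock2018, Thm 2 (proof, (16))] -/
theorem ergWeight_nonneg (h : IsLinesearchRun K g fs C D β δ x y τ) (N i : ℕ) :
    0 ≤ ergWeight τ N i := by
  unfold ergWeight
  have hτ := (h.pos (i + 1)).le
  have hθ := (theta_pos h.pos (i + 1)).le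
  split_ifs with hi
  · have := theta_mul_le h.pos h.trial (i + 1)
    nlinarith [this]
  · simp only [sub_zero]; positivity

omit [CompleteSpace X] in
/-- The regrouping identity behind (16): for any `f`,
`Σ_{i<N} w_i • f(i+1) = Σ_{i<N} τ_{i+1} ((1 + θ_{i+1}) • f(i+1) − θ_{i+1} • f(i)) + τ_1 θ_1 • f(0)`
(`N ≥ 1`). [cite: MalitskyPock2018, Thm 2 (proof, (16))] -/
theorem sum_ergWeight_smul {M' : Type*} [AddCommGroup M'] [Module ℝ M'] (τ : ℕ → ℝ) (f : ℕ → M')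
    (M : ℕ) :
    ∑ i ∈ Finset.range (M + 1), ergWeight τ (M + 1) i • f (i + 1) =
      ∑ i ∈ Finset.range (M + 1), ((τ (i + 1) * (1 + theta τ (i + 1))) • f (i + 1)
        - (τ (i + 1) * theta τ (i + 1)) • f i) + (τ 1 * theta τ 1) • f 0 := by
  have hre := sum_range_succ_eq_ite (fun i => (τ (i + 1) * theta τ (i + 1)) • f i) M
  simp only [zero_add] at hre
  have e1 : ∀ i ∈ Finset.range (M + 1), ergWeight τ (M + 1) i • f (i + 1) =
      (τ (i + 1) * (1 + theta τ (i + 1))) • f (i + 1)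
        - (if i + 1 < M + 1 then (τ (i + 1 + 1) * theta τ (i + 1 + 1)) • f (i + 1) else 0) := by
    intro i hi
    unfold ergWeight
    rw [sub_smul]
    congr 1
    split_ifs <;> simp
  rw [Finset.sum_congr rfl e1, Finset.sum_sub_distrib, Finset.sum_sub_distrib]
  have e2 : ∑ i ∈ Finset.range (M + 1), (τ (i + 1) * theta τ (i + 1)) • f i =
      (τ (0 + 1) * theta τ (0 + 1)) • f 0 +
        ∑ i ∈ Finset.range (M + 1),
          (if i + 1 < M + 1 then (τ (i + 1 + 1) * theta τ (i + 1 + 1)) • f (i + 1) else 0) := hre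
  simp only [zero_add] at e2
  rw [e2]
  abel

omit [CompleteSpace X] in
/-- `Σ_{i<N} w_i = τ_1 θ_1 + s_N` (`N ≥ 1`). [cite: MalitskyPock2018, Thm 2 (proof, (16))] -/
theorem sum_ergWeight (τ : ℕ → ℝ) (M : ℕ) :
    ∑ i ∈ Finset.range (M + 1), ergWeight τ (M + 1) i = τ 1 * theta τ 1 + stepSum τ (M + 1) := by
  have h1 := sum_ergWeight_smul τ (fun _ => (1 : ℝ)) M
  simp only [smul_eq_mul, mul_one] at h1
  rw [h1, stepSum]
  have : ∀ i ∈ Finset.range (M + 1),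
      τ (i + 1) * (1 + theta τ (i + 1)) - τ (i + 1) * theta τ (i + 1) = τ (i + 1) := by
    intro i _; ring
  rw [Finset.sum_congr rfl this]
  ring

omit [CompleteSpace X] in
/-- `Σ_{i<N} w_i x^{i+1} = τ_1 θ_1 x^0 + Σ_{k=1}^N τ_k x̄^k` (the identity used in (16)).
[cite: MalitskyPock2018, Thm 2 (proof, (16))] -/
theorem sum_ergWeight_smul_x (x : ℕ → X) (τ : ℕ → ℝ) (M : ℕ) :
    ∑ i ∈ Finset.range (M + 1), ergWeight τ (M + 1) i • x (i + 1) =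
      (τ 1 * theta τ 1) • x 0 + ∑ i ∈ Finset.range (M + 1), τ (i + 1) • xbar x τ (i + 1) := by
  rw [sum_ergWeight_smul τ x M]
  have e : ∀ i ∈ Finset.range (M + 1),
      (τ (i + 1) * (1 + theta τ (i + 1))) • x (i + 1) - (τ (i + 1) * theta τ (i + 1)) • x i =
        τ (i + 1) • xbar x τ (i + 1) := by
    intro i _
    rw [xbar_succ]
    module
  rw [Finset.sum_congr rfl e, add_comm]

omit [CompleteSpace X] [CompleteSpace Y] in
/-- The primal gap function is convex on `C` when `g` is. [cite: MalitskyPock2018, §1 (P is convex)] -/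
theorem convexOn_pgap {K : X →L[ℝ] Y} {g : X → ℝ} {C : Set X} (hg : ConvexOn ℝ C g) (xh : X)
    (yh : Y) : ConvexOn ℝ C (pgap K g xh yh) := by
  refine ⟨hg.1, fun u hu v hv a b ha hb hab => ?_⟩
  have h1 := hg.2 hu hv ha hb hab
  simp only [smul_eq_mul] at h1 ⊢
  have e : a • u + b • v - xh = a • (u - xh) + b • (v - xh) := by
    calc a • u + b • v - xh = a • u + b • v - (a + b) • xh := by rw [hab, one_smul]
      _ = a • (u - xh) + b • (v - xh) := by simp only [add_smul, smul_sub]; abel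
  simp only [pgap]
  rw [e, map_add, map_smul, map_smul, inner_add_left, real_inner_smul_left, real_inner_smul_left]
  have e2 : a * g xh + b * g xh = g xh := by rw [← add_mul, hab, one_mul]
  linarith

omit [CompleteSpace X] [CompleteSpace Y] in
/-- The dual gap function is convex on `D` when `f*` is. [cite: MalitskyPock2018, §1 (D is convex)] -/
theorem convexOn_dgap {K : X →L[ℝ] Y} {fs : Y → ℝ} {D : Set Y} (hfs : ConvexOn ℝ D fs) (xh : X)
    (yh : Y) : ConvexOn ℝ D (dgap K fs xh yh) := by
  refine ⟨hfs.1, fun u hu v hv a b ha hb hab => ?_⟩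
  have h1 := hfs.2 hu hv ha hb hab
  simp only [smul_eq_mul] at h1 ⊢
  have e : a • u + b • v - yh = a • (u - yh) + b • (v - yh) := by
    calc a • u + b • v - yh = a • u + b • v - (a + b) • yh := by rw [hab, one_smul]
      _ = a • (u - yh) + b • (v - yh) := by simp only [add_smul, smul_sub]; abel
  simp only [dgap]
  rw [e, inner_add_right, real_inner_smul_right, real_inner_smul_right]
  have e2 : a * fs yh + b * fs yh = fs yh := by rw [← add_mul, hab, one_mul]
  linarith

omit [CompleteSpace X] in
/-- `s_N > 0` for `N ≥ 1`. [cite: MalitskyPock2018, Thm 2] -/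
theorem stepSum_pos (hpos : ∀ k, 0 < τ k) (M : ℕ) : 0 < stepSum τ (M + 1) :=
  Finset.sum_pos (fun i _ => hpos _) ⟨0, by simp⟩

omit [CompleteSpace X] in
/-- `X^N` is the center of mass of `x^1, …, x^N` with the regrouped weights; in particular
`X^N ∈ C`. [cite: MalitskyPock2018, Thm 2 (proof, (16))] -/
theorem centerMass_eq_xErg (x : ℕ → X) (τ : ℕ → ℝ) (M : ℕ) :
    (Finset.range (M + 1)).centerMass (ergWeight τ (M + 1)) (fun i => x (i + 1)) =
      xErg x τ (M + 1) := by
  rw [Finset.centerMass, sum_ergWeight, sum_ergWeight_smul_x, xErg]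

/-- `X^N ∈ C` (`N ≥ 1`). [cite: MalitskyPock2018, Thm 2] -/
theorem xErg_mem (h : IsLinesearchRun K g fs C D β δ x y τ) (hC : Convex ℝ C) (M : ℕ) :
    xErg x τ (M + 1) ∈ C := by
  rw [← centerMass_eq_xErg x τ M]
  refine hC.centerMass_mem (fun i _ => h.ergWeight_nonneg _ _) ?_ (fun i _ => h.x_mem _)
  rw [sum_ergWeight]
  have := stepSum_pos h.pos M
  have : 0 < τ 1 * theta τ 1 := mul_pos (h.pos 1) (theta_pos h.pos 1)
  linarith

/-- `Y^N ∈ D` (`N ≥ 1`). [cite: MalitskyPock2018, Thm 2] -/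
theorem yErg_mem (h : IsLinesearchRun K g fs C D β δ x y τ) (hD : Convex ℝ D) (M : ℕ) :
    yErg y τ (M + 1) ∈ D := by
  have e : yErg y τ (M + 1) =
      (Finset.range (M + 1)).centerMass (fun i => τ (i + 1)) (fun i => y (i + 1)) := rfl
  rw [e]
  exact hD.centerMass_mem (fun i _ => (h.pos _).le) (stepSum_pos h.pos M)
    (fun i _ => h.y_succ_mem _)

/-- **Theorem 2 (ergodic convergence, `O(1/N)` rate).** For a PDAL run with `β > 0`, `δ ∈ [0,1]`,
`g` convex on the convex set `C = dom g`, `f*` convex on the convex `D = dom f*`, any saddle point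
`(x̂, ŷ)` and `N ≥ 1`:
`𝒢_{x̂,ŷ}(X^N, Y^N) = P(X^N) + D(Y^N) ≤ (½‖x^1 − x̂‖² + (1/2β)‖y^1 − ŷ‖² + τ_1 θ_1 P(x^0)) / s_N`,
`s_N = Σ_{k=1}^N τ_k`, with the ergodic points `X^N`, `Y^N` of `xErg`, `yErg` (see the note at `yErg`
on the index of the dual average). Since `τ_k ≥ τlo > 0` (Lemma 1 (ii)), `s_N ≥ N τlo`: the same
`O(1/N)` rate as PDA. [cite: MalitskyPock2018, Thm 2] -/
theorem ergodic_gap_le (h : IsLinesearchRun K g fs C D β δ x y τ) (hβ : 0 < β) (hδ0 : 0 ≤ δ)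
    (hδ1 : δ ≤ 1) (hg : ConvexOn ℝ C g) (hfs : ConvexOn ℝ D fs) {xh : X} {yh : Y}
    (hs : IsSaddleOn K g fs C D xh yh) {N : ℕ} (hN : 0 < N) :
    pgap K g xh yh (xErg x τ N) + dgap K fs xh yh (yErg y τ N) ≤
      (‖x 1 - xh‖ ^ 2 / 2 + ‖y 0 - yh‖ ^ 2 / (2 * β) + τ 1 * theta τ 1 * pgap K g xh yh (x 0))
        / stepSum τ N := by
  obtain ⟨M, rfl⟩ : ∃ M, N = M + 1 := ⟨N - 1, (Nat.succ_pred_eq_of_pos hN).symm⟩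
  have hsN := stepSum_pos h.pos M
  have hτθ : 0 < τ 1 * theta τ 1 := mul_pos (h.pos 1) (theta_pos h.pos 1)
  -- (15): the summed one-step inequality
  have h15 := h.sum_step_le hβ hδ0 hδ1 hs.1 hs.2.1 (M + 1)
  have e15 : ∑ i ∈ Finset.range (M + 1), τ (i + 1) * ((1 + theta τ (i + 1))
      * pgap K g xh yh (x (i + 1)) - theta τ (i + 1) * pgap K g xh yh (x i)
      + dgap K fs xh yh (y (i + 1))) =
      ∑ i ∈ Finset.range (M + 1), τ (i + 1) * ((1 + theta τ (i + 1)) * pgap K g xh yh (x (i + 1))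
        - theta τ (i + 1) * pgap K g xh yh (x i))
      + ∑ i ∈ Finset.range (M + 1), τ (i + 1) * dgap K fs xh yh (y (i + 1)) := by
    rw [← Finset.sum_add_distrib]
    exact Finset.sum_congr rfl fun i _ => by ring
  rw [e15] at h15
  -- (16): Jensen for `P` with the regrouped weights
  have hW : 0 < ∑ i ∈ Finset.range (M + 1), ergWeight τ (M + 1) i := by
    rw [sum_ergWeight]; linarith
  have hJP := (convexOn_pgap (K := K) hg xh yh).map_centerMass_le
    (fun i _ => h.ergWeight_nonneg (M + 1) i) hW (fun i _ => h.x_mem (i + 1))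
  rw [centerMass_eq_xErg x τ M] at hJP
  simp only [Finset.centerMass, Function.comp, smul_eq_mul, sum_ergWeight] at hJP
  have hsumP := sum_ergWeight_smul τ (fun i => pgap K g xh yh (x i)) M
  simp only [smul_eq_mul] at hsumP
  -- so `(τ_1 θ_1 + s_N) P(X^N) ≤ Σ τ((1+θ)P − θP) + τ_1θ_1 P(x^0)`
  have hP1 : (τ 1 * theta τ 1 + stepSum τ (M + 1)) * pgap K g xh yh (xErg x τ (M + 1)) ≤
      ∑ i ∈ Finset.range (M + 1), τ (i + 1) * ((1 + theta τ (i + 1)) * pgap K g xh yh (x (i + 1))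
        - theta τ (i + 1) * pgap K g xh yh (x i)) + τ 1 * theta τ 1 * pgap K g xh yh (x 0) := by
    have hW' : 0 < τ 1 * theta τ 1 + stepSum τ (M + 1) := by linarith
    have := (le_inv_mul_iff₀ hW').1 hJP
    have e : ∑ i ∈ Finset.range (M + 1), ergWeight τ (M + 1) i * pgap K g xh yh (x (i + 1)) =
        ∑ i ∈ Finset.range (M + 1), τ (i + 1) * ((1 + theta τ (i + 1)) * pgap K g xh yh (x (i + 1))
          - theta τ (i + 1) * pgap K g xh yh (x i)) + τ 1 * theta τ 1 * pgap K g xh yh (x 0) := by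
      rw [hsumP]
      congr 1
      refine Finset.sum_congr rfl fun i _ => ?_
      ring
    linarith [this, e]
  -- (17): Jensen for `D` with the weights `τ_k`
  have hJD := (convexOn_dgap (K := K) hfs xh yh).map_centerMass_le
    (t := Finset.range (M + 1)) (w := fun i => τ (i + 1)) (p := fun i => y (i + 1))
    (fun i _ => (h.pos _).le) hsN (fun i _ => h.y_succ_mem i)
  have eY : (Finset.range (M + 1)).centerMass (fun i => τ (i + 1)) (fun i => y (i + 1)) =
      yErg y τ (M + 1) := rfl
  rw [eY] at hJD
  simp only [Finset.centerMass, Function.comp, smul_eq_mul] at hJD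
  have hD1 : stepSum τ (M + 1) * dgap K fs xh yh (yErg y τ (M + 1)) ≤
      ∑ i ∈ Finset.range (M + 1), τ (i + 1) * dgap K fs xh yh (y (i + 1)) := by
    have := (le_inv_mul_iff₀ hsN).1 hJD
    simpa [stepSum] using this
  -- `P(X^N) ≥ 0`
  have hPX : 0 ≤ pgap K g xh yh (xErg x τ (M + 1)) := pgap_nonneg hs (h.xErg_mem hg.1 M)
  have hx2 : 0 ≤ ‖x (M + 1 + 1) - xh‖ ^ 2 / 2 := by positivity
  have hy2 : 0 ≤ ‖y (M + 1) - yh‖ ^ 2 / (2 * β) := by positivity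
  rw [le_div_iff₀ hsN]
  nlinarith [hP1, hD1, h15, hPX, hτθ.le, hx2, hy2]

end IsLinesearchRun

/-! ### Algorithm 1 with backtracking: Lemma 1 (i) the linesearch terminates, (ii) the steps
are bounded below; the resulting sequences form a run -/

section Backtracking

variable (K : X →L[ℝ] Y) (proxG : ℝ → X → X) (proxF : ℝ → Y → Y) (β δ μ : ℝ)

/-- The dual trial point of Step 2.a at trial step `t`: with `θ = t/τ_{k−1}`,
`x̄ = x^k + θ (x^k − x^{k−1})`, `y = prox_{β t f*}(y^k + β t K x̄)` (`xc = x^k`, `xp = x^{k−1}`,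
`yc = y^k`, `τp = τ_{k−1}`). [cite: MalitskyPock2018, §2 Algorithm 1 (Step 2.a)] -/
noncomputable def lsDual (xc xp : X) (yc : Y) (τp t : ℝ) : Y :=
  proxF (β * t) (yc + (β * t) • K (xc + (t / τp) • (xc - xp)))

/-- The linesearch test (6) of Step 2.b at trial step `t`:
`√β t ‖K* y^{k+1} − K* y^k‖ ≤ δ ‖y^{k+1} − y^k‖`. [cite: MalitskyPock2018, §2 Algorithm 1 (Step 2.b, (6))] -/
def lsTest (xc xp : X) (yc : Y) (τp t : ℝ) : Prop :=
  Real.sqrt β * t * ‖K.adjoint (lsDual K proxF β xc xp yc τp t - yc)‖ ≤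
    δ * ‖lsDual K proxF β xc xp yc τp t - yc‖

open Classical in
/-- The number of backtracking steps: the least `i` such that the trial step `t₀ μ^i` passes the
test (6) (`0` if no trial step passes — this never happens, Lemma 1 (i)).
[cite: MalitskyPock2018, §2 Algorithm 1 (Step 2.b)] -/
noncomputable def lsCount (xc xp : X) (yc : Y) (τp t₀ : ℝ) : ℕ :=
  if h : ∃ i : ℕ, lsTest K proxF β δ xc xp yc τp (t₀ * μ ^ i) then Nat.find h else 0

/-- The state after iteration `k` of Algorithm 1: `(x^k, y^{k+1}, τ_k, θ_k)`.
[cite: MalitskyPock2018, §2 Algorithm 1] -/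
structure LSState (X Y : Type*) where
  /-- the primal iterate `x^k` -/
  x : X
  /-- the dual iterate `y^{k+1}` -/
  y : Y
  /-- the accepted step `τ_k` -/
  τ : ℝ
  /-- the ratio `θ_k = τ_k/τ_{k−1}` (`θ_0 = 1`) -/
  θ : ℝ

/-- One iteration of Algorithm 1: Step 1 `x^{k+1} = prox_{τ_k g}(x^k − τ_k K* y^{k+1})`, then
Step 2 with trial step `t₀ = γ(τ_k, θ_k) ∈ [τ_k, τ_k √(1+θ_k)]` (a trial-step policy `γ`),
backtracking `t₀ μ^i` until (6) holds, `τ_{k+1} = t₀ μ^i`, `θ_{k+1} = τ_{k+1}/τ_k`,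
`y^{k+2} = prox_{β τ_{k+1} f*}(y^{k+1} + β τ_{k+1} K x̄^{k+1})`.
[cite: MalitskyPock2018, §2 Algorithm 1] -/
noncomputable def lsStep (γ : ℝ → ℝ → ℝ) (s : LSState X Y) : LSState X Y :=
  let x' := proxG s.τ (s.x - s.τ • K.adjoint s.y)
  let t := γ s.τ s.θ * μ ^ lsCount K proxF β δ μ x' s.x s.y s.τ (γ s.τ s.θ)
  { x := x', y := lsDual K proxF β x' s.x s.y s.τ t, τ := t, θ := t / s.τ }

/-- The states of Algorithm 1 started from `x^0`, `y^1`, `τ_0 > 0`, `θ_0 = 1`.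
[cite: MalitskyPock2018, §2 Algorithm 1 (Initialization)] -/
noncomputable def lsSeq (γ : ℝ → ℝ → ℝ) (x₀ : X) (y₁ : Y) (τ₀ : ℝ) : ℕ → LSState X Y
  | 0 => ⟨x₀, y₁, τ₀, 1⟩
  | k + 1 => lsStep K proxG proxF β δ μ γ (lsSeq γ x₀ y₁ τ₀ k)

/-- A trial-step policy: Step 2 allows any `τ_k ∈ [τ_{k−1}, τ_{k−1} √(1 + θ_{k−1})]`.
[cite: MalitskyPock2018, §2 Algorithm 1 (Step 2)] -/
def IsTrialPolicy (γ : ℝ → ℝ → ℝ) : Prop :=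
  ∀ τ θ : ℝ, 0 < τ → 0 ≤ θ → τ ≤ γ τ θ ∧ γ τ θ ≤ τ * Real.sqrt (1 + θ)

/-- "always start the linesearch from the largest possible step `τ_k = τ_{k−1} √(1+θ_{k−1})`".
[cite: MalitskyPock2018, §2 (after Algorithm 1)] -/
theorem isTrialPolicy_max : IsTrialPolicy fun τ θ => τ * Real.sqrt (1 + θ) :=
  fun τ θ hτ hθ => ⟨le_mul_of_one_le_right hτ.le (Real.one_le_sqrt.2 (by linarith)), le_rfl⟩

/-- "or, the contrary, never increase `τ_k`". [cite: MalitskyPock2018, §2 (after Algorithm 1)] -/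
theorem isTrialPolicy_const : IsTrialPolicy fun τ _ => τ :=
  fun τ θ hτ hθ => ⟨le_rfl, le_mul_of_one_le_right hτ.le (Real.one_le_sqrt.2 (by linarith))⟩

/-- A capped policy `min(τ √(1+θ), max(τ, τmax))`, realising "the boundedness of `(τ_k)` from above
… clearly we can easily bound it in PDAL". [cite: MalitskyPock2018, Thm 1 (remark after the statement)] -/
theorem isTrialPolicy_capped (τmax : ℝ) :
    IsTrialPolicy fun τ θ => min (τ * Real.sqrt (1 + θ)) (max τ τmax) :=
  fun τ θ hτ hθ =>
    ⟨le_min (le_mul_of_one_le_right hτ.le (Real.one_le_sqrt.2 (by linarith))) (le_max_left _ _),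
      min_le_left _ _⟩

variable {K proxG proxF β δ μ}

/-- **Lemma 1 (i), the mechanism**: the test (6) holds for every trial step `t ≥ 0` with
`√β t ‖K‖ ≤ δ` (since `‖K* v‖ ≤ ‖K‖ ‖v‖`). [cite: MalitskyPock2018, Lemma 1 (i)] -/
theorem lsTest_of_le {t : ℝ} (ht : 0 ≤ t) (hK : Real.sqrt β * t * ‖K‖ ≤ δ) (xc xp : X)
    (yc : Y) (τp : ℝ) : lsTest K proxF β δ xc xp yc τp t := by
  unfold lsTest
  set v := lsDual K proxF β xc xp yc τp t - yc
  have h1 : ‖K.adjoint v‖ ≤ ‖K‖ * ‖v‖ := by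
    have := K.adjoint.le_opNorm v
    rwa [K.adjoint.opNorm_eq_of_bounds (norm_nonneg K) (fun w => ?_) (fun N hN hle => ?_)] at this
    · rw [← LinearIsometryEquiv.norm_map ContinuousLinearMap.adjoint K]
      exact (ContinuousLinearMap.adjoint K).le_opNorm w
    · rw [← LinearIsometryEquiv.norm_map ContinuousLinearMap.adjoint K]
      exact ContinuousLinearMap.opNorm_le_bound _ hN hle
  have h2 : 0 ≤ Real.sqrt β * t := mul_nonneg (Real.sqrt_nonneg _) ht
  calc Real.sqrt β * t * ‖K.adjoint v‖ ≤ Real.sqrt β * t * (‖K‖ * ‖v‖) :=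
        mul_le_mul_of_nonneg_left h1 h2
    _ = (Real.sqrt β * t * ‖K‖) * ‖v‖ := by ring
    _ ≤ δ * ‖v‖ := mul_le_mul_of_nonneg_right hK (norm_nonneg _)

/-- **Lemma 1 (i): the linesearch in PDAL always terminates** — for `δ > 0`, `μ ∈ (0,1)` and a
trial step `t₀ ≥ 0` some `t₀ μ^i` passes (6). [cite: MalitskyPock2018, Lemma 1 (i)] -/
theorem exists_lsTest (hδ : 0 < δ) (hμ0 : 0 < μ) (hμ1 : μ < 1) {t₀ : ℝ} (ht₀ : 0 ≤ t₀)
    (xc xp : X) (yc : Y) (τp : ℝ) : ∃ i : ℕ, lsTest K proxF β δ xc xp yc τp (t₀ * μ ^ i) := by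
  by_cases hK : Real.sqrt β * t₀ * ‖K‖ = 0
  · refine ⟨0, lsTest_of_le (by simpa using ht₀) ?_ xc xp yc τp⟩
    rw [pow_zero, mul_one, hK]; exact hδ.le
  · have hpos : 0 < Real.sqrt β * t₀ * ‖K‖ := lt_of_le_of_ne (by positivity) (Ne.symm hK)
    obtain ⟨i, hi⟩ := exists_pow_lt_of_lt_one (div_pos hδ hpos) hμ1
    refine ⟨i, lsTest_of_le (by positivity) ?_ xc xp yc τp⟩
    have : Real.sqrt β * (t₀ * μ ^ i) * ‖K‖ = (Real.sqrt β * t₀ * ‖K‖) * μ ^ i := by ring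
    rw [this]
    exact (le_div_iff₀' hpos).1 hi.le

/-- The accepted trial step passes the test (6). [cite: MalitskyPock2018, Lemma 1 (i)] -/
theorem lsTest_lsCount (hδ : 0 < δ) (hμ0 : 0 < μ) (hμ1 : μ < 1) {t₀ : ℝ} (ht₀ : 0 ≤ t₀)
    (xc xp : X) (yc : Y) (τp : ℝ) :
    lsTest K proxF β δ xc xp yc τp (t₀ * μ ^ lsCount K proxF β δ μ xc xp yc τp t₀) := by
  classical
  have h := exists_lsTest (K := K) (proxF := proxF) (β := β) hδ hμ0 hμ1 ht₀ xc xp yc τp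
  unfold lsCount
  rw [dif_pos h]
  convert Nat.find_spec h

/-- Minimality of the backtracking count: if `i ≥ 1` trial steps were rejected, the last rejected
one `t₀ μ^{i−1}` violates (6), hence `√β t₀ μ^{i−1} ‖K‖ > δ`. [cite: MalitskyPock2018, Lemma 1 (ii)] -/
theorem lt_of_lsCount_eq_succ (hδ : 0 < δ) (hμ0 : 0 < μ) (hμ1 : μ < 1) {t₀ : ℝ}
    (ht₀ : 0 ≤ t₀) (xc xp : X) (yc : Y) (τp : ℝ) {j : ℕ}
    (hj : lsCount K proxF β δ μ xc xp yc τp t₀ = j + 1) : δ < Real.sqrt β * (t₀ * μ ^ j) * ‖K‖ := by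
  classical
  have h := exists_lsTest (K := K) (proxF := proxF) (β := β) hδ hμ0 hμ1 ht₀ xc xp yc τp
  unfold lsCount at hj
  rw [dif_pos h] at hj
  have hmin : ¬ lsTest K proxF β δ xc xp yc τp (t₀ * μ ^ j) := by
    refine Nat.find_min h ?_
    convert Nat.lt_succ_self j using 1
  by_contra hle
  exact hmin (lsTest_of_le (by positivity) (not_lt.1 hle) xc xp yc τp)

variable (K proxG proxF β δ μ) in
/-- The primal iterates `x^k`, dual iterates `y^{k+1}` and steps `τ_k` of Algorithm 1.
[cite: MalitskyPock2018, §2 Algorithm 1] -/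
noncomputable def lsX (γ : ℝ → ℝ → ℝ) (x₀ : X) (y₁ : Y) (τ₀ : ℝ) (k : ℕ) : X :=
  (lsSeq K proxG proxF β δ μ γ x₀ y₁ τ₀ k).x

variable (K proxG proxF β δ μ) in
/-- See `lsX`. [cite: MalitskyPock2018, §2 Algorithm 1] -/
noncomputable def lsY (γ : ℝ → ℝ → ℝ) (x₀ : X) (y₁ : Y) (τ₀ : ℝ) (k : ℕ) : Y :=
  (lsSeq K proxG proxF β δ μ γ x₀ y₁ τ₀ k).y

variable (K proxG proxF β δ μ) in
/-- See `lsX`. [cite: MalitskyPock2018, §2 Algorithm 1] -/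
noncomputable def lsTau (γ : ℝ → ℝ → ℝ) (x₀ : X) (y₁ : Y) (τ₀ : ℝ) (k : ℕ) : ℝ :=
  (lsSeq K proxG proxF β δ μ γ x₀ y₁ τ₀ k).τ

variable {γ : ℝ → ℝ → ℝ} {x₀ : X} {y₁ : Y} {τ₀ : ℝ}

/-- The recursion of `lsSeq`. [cite: MalitskyPock2018, §2 Algorithm 1] -/
theorem lsSeq_succ (k : ℕ) : lsSeq K proxG proxF β δ μ γ x₀ y₁ τ₀ (k + 1) =
    lsStep K proxG proxF β δ μ γ (lsSeq K proxG proxF β δ μ γ x₀ y₁ τ₀ k) := rfl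

/-- Positivity of the steps and of the ratios along Algorithm 1.
[cite: MalitskyPock2018, Lemma 1] -/
theorem lsSeq_pos (hγ : IsTrialPolicy γ) (hμ0 : 0 < μ) (hτ₀ : 0 < τ₀) (k : ℕ) :
    0 < (lsSeq K proxG proxF β δ μ γ x₀ y₁ τ₀ k).τ ∧ 0 < (lsSeq K proxG proxF β δ μ γ x₀ y₁ τ₀ k).θ := by
  induction k with
  | zero => exact ⟨hτ₀, one_pos⟩
  | succ k ih =>
      rw [lsSeq_succ]
      set s := lsSeq K proxG proxF β δ μ γ x₀ y₁ τ₀ k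
      have h1 := (hγ s.τ s.θ ih.1 ih.2.le).1
      have ht : 0 < γ s.τ s.θ * μ ^ lsCount K proxF β δ μ (proxG s.τ (s.x - s.τ • K.adjoint s.y))
          s.x s.y s.τ (γ s.τ s.θ) := mul_pos (ih.1.trans_le h1) (pow_pos hμ0 _)
      exact ⟨ht, div_pos ht ih.1⟩

/-- `θ_k` of the run equals the stored ratio. [cite: MalitskyPock2018, §2 Algorithm 1 (Step 2.a)] -/
theorem theta_lsTau (k : ℕ) :
    theta (lsTau K proxG proxF β δ μ γ x₀ y₁ τ₀) k = (lsSeq K proxG proxF β δ μ γ x₀ y₁ τ₀ k).θ := by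
  cases k with
  | zero => rfl
  | succ k => rfl

/-- **Algorithm 1 with backtracking produces a PDAL run** (so Theorems 1–2 apply to it): given
proximal maps of `τ (g + ι_C)` and `σ (f* + ι_D)`, `β > 0`, `δ > 0`, `μ ∈ (0,1)`, `τ_0 > 0`,
`x^0 ∈ C` and any trial-step policy. [cite: MalitskyPock2018, §2 Algorithm 1, Lemma 1 (i)] -/
theorem isLinesearchRun_lsSeq {g : X → ℝ} {fs : Y → ℝ} {C : Set X} {D : Set Y}
    (hG : ∀ τ, 0 < τ → IsProxOn C g τ (proxG τ)) (hF : ∀ σ, 0 < σ → IsProxOn D fs σ (proxF σ))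
    (hβ : 0 < β) (hδ : 0 < δ) (hμ0 : 0 < μ) (hμ1 : μ < 1) (hγ : IsTrialPolicy γ) (hx₀ : x₀ ∈ C)
    (hτ₀ : 0 < τ₀) :
    IsLinesearchRun K g fs C D β δ (lsX K proxG proxF β δ μ γ x₀ y₁ τ₀)
      (lsY K proxG proxF β δ μ γ x₀ y₁ τ₀) (lsTau K proxG proxF β δ μ γ x₀ y₁ τ₀) where
  pos k := (lsSeq_pos hγ hμ0 hτ₀ k).1
  init := hx₀
  primal k := by
    have hp := lsSeq_pos (K := K) (proxG := proxG) (proxF := proxF) (β := β) (δ := δ) (x₀ := x₀)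
      (y₁ := y₁) hγ hμ0 hτ₀ k
    exact hG _ hp.1 _
  trial k := by
    have hp := lsSeq_pos (K := K) (proxG := proxG) (proxF := proxF) (β := β) (δ := δ) (x₀ := x₀)
      (y₁ := y₁) hγ hμ0 hτ₀ k
    rw [theta_lsTau]
    show (lsSeq K proxG proxF β δ μ γ x₀ y₁ τ₀ (k + 1)).τ ≤ _
    rw [lsSeq_succ]
    set s := lsSeq K proxG proxF β δ μ γ x₀ y₁ τ₀ k
    have h2 := (hγ s.τ s.θ hp.1 hp.2.le).2
    have h0 : 0 ≤ γ s.τ s.θ := (hp.1.le.trans (hγ s.τ s.θ hp.1 hp.2.le).1)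
    exact (mul_le_of_le_one_right h0 (pow_le_one₀ hμ0.le hμ1.le)).trans h2
  dual k := by
    have hp := lsSeq_pos (K := K) (proxG := proxG) (proxF := proxF) (β := β) (δ := δ) (x₀ := x₀)
      (y₁ := y₁) hγ hμ0 hτ₀ (k + 1)
    have e : xbar (lsX K proxG proxF β δ μ γ x₀ y₁ τ₀) (lsTau K proxG proxF β δ μ γ x₀ y₁ τ₀) (k + 1) =
        (lsSeq K proxG proxF β δ μ γ x₀ y₁ τ₀ (k + 1)).x
          + ((lsSeq K proxG proxF β δ μ γ x₀ y₁ τ₀ (k + 1)).τ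
              / (lsSeq K proxG proxF β δ μ γ x₀ y₁ τ₀ k).τ) •
            ((lsSeq K proxG proxF β δ μ γ x₀ y₁ τ₀ (k + 1)).x
              - (lsSeq K proxG proxF β δ μ γ x₀ y₁ τ₀ k).x) := rfl
    show IsProxPt D fs _ _ (lsSeq K proxG proxF β δ μ γ x₀ y₁ τ₀ (k + 1)).y
    rw [e]
    exact hF _ (mul_pos hβ hp.1) _
  crit k := by
    have hp := lsSeq_pos (K := K) (proxG := proxG) (proxF := proxF) (β := β) (δ := δ) (x₀ := x₀)
      (y₁ := y₁) hγ hμ0 hτ₀ k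
    set s := lsSeq K proxG proxF β δ μ γ x₀ y₁ τ₀ k
    have h0 : 0 ≤ γ s.τ s.θ := (hp.1.le.trans (hγ s.τ s.θ hp.1 hp.2.le).1)
    exact lsTest_lsCount hδ hμ0 hμ1 h0 _ s.x s.y s.τ

/-- **Lemma 1 (ii): the steps of Algorithm 1 are bounded below**: for `K ≠ 0`,
`τ_k ≥ min(τ_0, δμ/(√β ‖K‖))` for all `k` (the paper's "w.l.o.g. `τ_0 > δμ/(√β L)`, then
`τ_k > δμ/(√β L)`"). [cite: MalitskyPock2018, Lemma 1 (ii)] -/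
theorem le_lsTau (hβ : 0 < β) (hδ : 0 < δ) (hμ0 : 0 < μ) (hμ1 : μ < 1) (hγ : IsTrialPolicy γ)
    (hτ₀ : 0 < τ₀) (hK : 0 < ‖K‖) (k : ℕ) :
    min τ₀ (δ * μ / (Real.sqrt β * ‖K‖)) ≤ lsTau K proxG proxF β δ μ γ x₀ y₁ τ₀ k := by
  induction k with
  | zero => exact min_le_left _ _
  | succ k ih =>
      have hp := lsSeq_pos (K := K) (proxG := proxG) (proxF := proxF) (β := β) (δ := δ) (x₀ := x₀)
        (y₁ := y₁) hγ hμ0 hτ₀ k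
      show _ ≤ (lsSeq K proxG proxF β δ μ γ x₀ y₁ τ₀ (k + 1)).τ
      rw [lsSeq_succ]
      set s := lsSeq K proxG proxF β δ μ γ x₀ y₁ τ₀ k with hs
      have ihs : min τ₀ (δ * μ / (Real.sqrt β * ‖K‖)) ≤ s.τ := ih
      set x' := proxG s.τ (s.x - s.τ • K.adjoint s.y)
      set t₀ := γ s.τ s.θ
      have ht₀ : s.τ ≤ t₀ := (hγ s.τ s.θ hp.1 hp.2.le).1
      have ht₀0 : 0 ≤ t₀ := hp.1.le.trans ht₀
      show _ ≤ t₀ * μ ^ lsCount K proxF β δ μ x' s.x s.y s.τ t₀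
      rcases hi : lsCount K proxF β δ μ x' s.x s.y s.τ t₀ with _ | j
      · rw [pow_zero, mul_one]; exact ihs.trans ht₀
      · have hlt := lt_of_lsCount_eq_succ hδ hμ0 hμ1 ht₀0 x' s.x s.y s.τ hi
        refine (min_le_right _ _).trans ?_
        have hsβ : 0 < Real.sqrt β * ‖K‖ := mul_pos (Real.sqrt_pos.2 hβ) hK
        rw [div_le_iff₀ hsβ, pow_succ]
        nlinarith [hlt, hμ0]

/-- Lemma 1 (ii), the degenerate case `K = 0`: the test always passes at the first trial, so the
steps never decrease: `τ_k ≥ τ_0`. [cite: MalitskyPock2018, Lemma 1 (ii)] -/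
theorem le_lsTau_of_norm_eq_zero (hδ : 0 < δ) (hμ0 : 0 < μ) (hμ1 : μ < 1)
    (hγ : IsTrialPolicy γ) (hτ₀ : 0 < τ₀) (hK : ‖K‖ = 0) (k : ℕ) :
    τ₀ ≤ lsTau K proxG proxF β δ μ γ x₀ y₁ τ₀ k := by
  induction k with
  | zero => exact le_rfl
  | succ k ih =>
      have hp := lsSeq_pos (K := K) (proxG := proxG) (proxF := proxF) (β := β) (δ := δ) (x₀ := x₀)
        (y₁ := y₁) hγ hμ0 hτ₀ k
      show _ ≤ (lsSeq K proxG proxF β δ μ γ x₀ y₁ τ₀ (k + 1)).τ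
      rw [lsSeq_succ]
      set s := lsSeq K proxG proxF β δ μ γ x₀ y₁ τ₀ k with hs
      have ihs : τ₀ ≤ s.τ := ih
      set x' := proxG s.τ (s.x - s.τ • K.adjoint s.y)
      set t₀ := γ s.τ s.θ
      have ht₀ : s.τ ≤ t₀ := (hγ s.τ s.θ hp.1 hp.2.le).1
      have ht₀0 : 0 ≤ t₀ := hp.1.le.trans ht₀
      show _ ≤ t₀ * μ ^ lsCount K proxF β δ μ x' s.x s.y s.τ t₀
      have h0 : lsCount K proxF β δ μ x' s.x s.y s.τ t₀ = 0 := by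
        classical
        have h := exists_lsTest (K := K) (proxF := proxF) (β := β) hδ hμ0 hμ1 ht₀0 x' s.x s.y s.τ
        unfold lsCount
        rw [dif_pos h]
        have ht : lsTest K proxF β δ x' s.x s.y s.τ (t₀ * μ ^ 0) := by
          refine lsTest_of_le (by simpa using ht₀0) ?_ _ _ _ _
          rw [hK, mul_zero]; exact hδ.le
        have := Nat.find_min' h ht
        omega
      rw [h0, pow_zero, mul_one]
      exact ihs.trans ht₀

/-- **Lemma 1 (ii)**: there is `τ > 0` with `τ_k ≥ τ` for all `k`. [cite: MalitskyPock2018, Lemma 1 (ii)] -/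
theorem exists_le_lsTau (hβ : 0 < β) (hδ : 0 < δ) (hμ0 : 0 < μ) (hμ1 : μ < 1) (hγ : IsTrialPolicy γ)
    (hτ₀ : 0 < τ₀) : ∃ τlo : ℝ, 0 < τlo ∧ ∀ k, τlo ≤ lsTau K proxG proxF β δ μ γ x₀ y₁ τ₀ k := by
  by_cases hK : ‖K‖ = 0
  · exact ⟨τ₀, hτ₀, le_lsTau_of_norm_eq_zero hδ hμ0 hμ1 hγ hτ₀ hK⟩
  · have hK' : 0 < ‖K‖ := lt_of_le_of_ne (norm_nonneg _) (Ne.symm hK)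
    exact ⟨_, lt_min hτ₀ (div_pos (mul_pos hδ hμ0) (mul_pos (Real.sqrt_pos.2 hβ) hK')),
      le_lsTau hβ hδ hμ0 hμ1 hγ hτ₀ hK'⟩

/-- With the capped policy the steps stay below the cap: `τ_k ≤ τmax` whenever `τ_0 ≤ τmax`.
[cite: MalitskyPock2018, Thm 1 (remark after the statement)] -/
theorem lsTau_le_of_capped (hμ0 : 0 < μ) (hμ1 : μ < 1) (hτ₀ : 0 < τ₀) {τmax : ℝ}
    (hcap : τ₀ ≤ τmax) (k : ℕ) :
    lsTau K proxG proxF β δ μ (fun τ θ => min (τ * Real.sqrt (1 + θ)) (max τ τmax)) x₀ y₁ τ₀ k ≤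
      τmax := by
  induction k with
  | zero => exact hcap
  | succ k ih =>
      set γ : ℝ → ℝ → ℝ := fun τ θ => min (τ * Real.sqrt (1 + θ)) (max τ τmax) with hγdef
      have hγ : IsTrialPolicy γ := isTrialPolicy_capped τmax
      have hp := lsSeq_pos (K := K) (proxG := proxG) (proxF := proxF) (β := β) (δ := δ) (x₀ := x₀)
        (y₁ := y₁) hγ hμ0 hτ₀ k
      show (lsSeq K proxG proxF β δ μ γ x₀ y₁ τ₀ (k + 1)).τ ≤ τmax
      rw [lsSeq_succ]
      set s := lsSeq K proxG proxF β δ μ γ x₀ y₁ τ₀ k with hs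
      have ihs : s.τ ≤ τmax := ih
      have ht₀ : γ s.τ s.θ ≤ τmax := (min_le_right _ _).trans (max_le ihs le_rfl)
      have h0 : 0 ≤ γ s.τ s.θ := hp.1.le.trans (hγ s.τ s.θ hp.1 hp.2.le).1
      exact (mul_le_of_le_one_right h0 (pow_le_one₀ hμ0.le hμ1.le)).trans ht₀

/-- **Theorem 1 for Algorithm 1 with backtracking**: in finite dimensions, with proximal maps of
`τ(g + ι_C)`, `σ(f* + ι_D)` (`C`, `D` closed, `g` continuous on `C`, `f*` lower semicontinuous on
`D`), `β > 0`, `δ ∈ (0,1)`, `μ ∈ (0,1)`, `τ_0 > 0`, `x^0 ∈ C`, a trial-step policy keeping the steps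
bounded above, and a saddle point existing, the iterates `(x^{k+1}, y^{k+1})` converge to a saddle
point. [cite: MalitskyPock2018, Thm 1, Lemma 1] -/
theorem tendsto_lsSeq [FiniteDimensional ℝ X] [FiniteDimensional ℝ Y] {g : X → ℝ} {fs : Y → ℝ}
    {C : Set X} {D : Set Y} (hG : ∀ τ, 0 < τ → IsProxOn C g τ (proxG τ))
    (hF : ∀ σ, 0 < σ → IsProxOn D fs σ (proxF σ)) (hβ : 0 < β) (hδ0 : 0 < δ) (hδ1 : δ < 1)
    (hμ0 : 0 < μ) (hμ1 : μ < 1) (hγ : IsTrialPolicy γ) (hx₀ : x₀ ∈ C) (hτ₀ : 0 < τ₀) {τhi : ℝ}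
    (hhi : ∀ k, lsTau K proxG proxF β δ μ γ x₀ y₁ τ₀ k ≤ τhi) (hC : IsClosed C) (hD : IsClosed D)
    (hg : ContinuousOn g C) (hfs : LowerSemicontinuousOn fs D)
    (hsad : ∃ xh yh, IsSaddleOn K g fs C D xh yh) :
    ∃ xs ys, IsSaddleOn K g fs C D xs ys ∧
      Tendsto (fun k => (lsX K proxG proxF β δ μ γ x₀ y₁ τ₀ (k + 1),
        lsY K proxG proxF β δ μ γ x₀ y₁ τ₀ k)) atTop (𝓝 (xs, ys)) := by
  obtain ⟨τlo, hτlo, hlo⟩ := exists_le_lsTau (K := K) (proxG := proxG) (proxF := proxF) (x₀ := x₀)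
    (y₁ := y₁) hβ hδ0 hμ0 hμ1 hγ hτ₀
  exact (isLinesearchRun_lsSeq hG hF hβ hδ0 hμ0 hμ1 hγ hx₀ hτ₀).tendsto_iterates hβ hδ0.le hδ1 hsad
    hτlo hlo hhi hC hD hg hfs

end Backtracking

/-! ### The conic kernel: `g = ⟨c, ·⟩ + ι_C`, `f* = ⟨b, ·⟩ + ι_D` — the proximal maps are
projections, and PDAL converges to a saddle point of `⟨c,x⟩ + ⟨Kx,y⟩ − ⟨b,y⟩` on `C × D` -/

section Conic

open Literature.Analysis.Convex.ConvexMetricProjection (proj proj_mem inner_sub_proj_le_zero)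
open Literature.Analysis.Convex.MonotoneOperator (zer)
open Literature.Analysis.Convex.PrimalDualHybridGradient (conicL kkt shiftOp
  mem_zer_kkt_conic_iff_saddle)
open Literature.Analysis.Convex.DouglasRachford (normalCone)

/-- For `g = ⟨c, ·⟩` on a nonempty closed convex `C`, `u ↦ P_C(u − τ c)` is the proximal map of
`τ (g + ι_C)` (Remark 2, first item, composed with the projection: `prox_{σ f*} u = u − σ c` for
`f* = ⟨c, ·⟩`; with the constraint the prox is the projection of that point).
[cite: MalitskyPock2018, §2 Remark 2] -/
theorem isProxOn_proj_linear {C : Set X} (hCne : C.Nonempty) (hCcl : IsClosed C) (hCc : Convex ℝ C)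
    (c : X) (τ : ℝ) : IsProxOn C (fun x => ⟪c, x⟫) τ (fun u => proj C (u - τ • c)) := by
  intro u
  refine ⟨proj_mem hCne hCcl.isComplete hCc _, fun x hx => ?_⟩
  set p := proj C (u - τ • c) with hp
  show τ * (⟪c, p⟫ - ⟪c, x⟫) ≤ ⟪p - u, x - p⟫
  have h := inner_sub_proj_le_zero hCne hCcl.isComplete hCc (u - τ • c) hx
  rw [← hp] at h
  have e : u - τ • c - p = -(p - u) - τ • c := by abel
  rw [e, inner_sub_left, inner_neg_left, real_inner_smul_left, inner_sub_right c x p] at h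
  linarith

omit [CompleteSpace X] [CompleteSpace Y] in
/-- For linear `g = ⟨c,·⟩`, `f* = ⟨b,·⟩` the saddle function is the tree's conic Lagrangian
`conicL K c b x y = ⟨c,x⟩ + ⟨Kx,y⟩ − ⟨b,y⟩`. [cite: MalitskyPock2018, §1 (1)] -/
theorem lagr_eq_conicL (K : X →L[ℝ] Y) (c : X) (b : Y) (x : X) (y : Y) :
    lagr K (fun x => ⟪c, x⟫) (fun y => ⟪b, y⟫) x y = conicL K c b x y := by
  simp only [lagr, conicL]
  ring

/-- Saddle points of the linear–conic problem on `C × D` are exactly the zeros of the conic KKT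
operator `kkt K (c + N_C) (b + N_D)` of `PrimalDualHybridGradient`. [cite: MalitskyPock2018, §1 (1)] -/
theorem isSaddleOn_linear_iff (K : X →L[ℝ] Y) (C : Set X) (D : Set Y) (c : X) (b : Y) (xs : X)
    (ys : Y) :
    IsSaddleOn K (fun x => ⟪c, x⟫) (fun y => ⟪b, y⟫) C D xs ys ↔
      WithLp.toLp 2 (xs, ys) ∈ zer (kkt K (shiftOp c (normalCone C)) (shiftOp b (normalCone D))) := by
  rw [mem_zer_kkt_conic_iff_saddle]
  simp only [IsSaddleOn, lagr_eq_conicL]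

/-- **PDAL on the conic saddle converges (Theorem 1 + Lemma 1 for the PDLP-type kernel with
linesearch).** Finite-dimensional `X`, `Y`; nonempty closed convex `C`, `D`; the linear–conic saddle
`min_{x ∈ C} max_{y ∈ D} ⟨c,x⟩ + ⟨Kx,y⟩ − ⟨b,y⟩` with a saddle point; Algorithm 1 run with the
projections `x ↦ P_C(x − τ c)`, `y ↦ P_D(y − σ b)` as proximal maps, `β > 0`, `δ ∈ (0,1)`,
`μ ∈ (0,1)`, `τ_0 > 0`, `x^0 ∈ C`, a trial-step policy and steps bounded above: the iterates
`(x^{k+1}, y^{k+1})` converge to a saddle point — with NO a-priori bound `τσ‖K‖² < 1` on the steps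
(compare `PrimalDualHybridGradient.tendsto_pdhgIter_conic`). [cite: MalitskyPock2018, Thm 1, Lemma 1, Remark 2] -/
theorem tendsto_lsSeq_conic [FiniteDimensional ℝ X] [FiniteDimensional ℝ Y] (K : X →L[ℝ] Y)
    {C : Set X} {D : Set Y} (hCne : C.Nonempty) (hCcl : IsClosed C) (hCc : Convex ℝ C)
    (hDne : D.Nonempty) (hDcl : IsClosed D) (hDc : Convex ℝ D) (c : X) (b : Y) {β δ μ τ₀ : ℝ}
    (hβ : 0 < β) (hδ0 : 0 < δ) (hδ1 : δ < 1) (hμ0 : 0 < μ) (hμ1 : μ < 1) {γ : ℝ → ℝ → ℝ}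
    (hγ : IsTrialPolicy γ) {x₀ : X} (hx₀ : x₀ ∈ C) (y₁ : Y) (hτ₀ : 0 < τ₀) {τhi : ℝ}
    (hhi : ∀ k, lsTau K (fun τ u => proj C (u - τ • c)) (fun σ u => proj D (u - σ • b)) β δ μ γ x₀
      y₁ τ₀ k ≤ τhi)
    (hsad : (zer (kkt K (shiftOp c (normalCone C)) (shiftOp b (normalCone D)))).Nonempty) :
    ∃ zs : X × Y, WithLp.toLp 2 zs ∈ zer (kkt K (shiftOp c (normalCone C)) (shiftOp b (normalCone D)))
      ∧ Tendsto (fun k =>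
          (lsX K (fun τ u => proj C (u - τ • c)) (fun σ u => proj D (u - σ • b)) β δ μ γ x₀ y₁ τ₀
              (k + 1),
            lsY K (fun τ u => proj C (u - τ • c)) (fun σ u => proj D (u - σ • b)) β δ μ γ x₀ y₁ τ₀ k))
        atTop (𝓝 zs) := by
  obtain ⟨ps, hps⟩ := hsad
  have hps' : WithLp.toLp 2 ((WithLp.ofLp ps).1, (WithLp.ofLp ps).2) ∈
      zer (kkt K (shiftOp c (normalCone C)) (shiftOp b (normalCone D))) := hps
  rw [← isSaddleOn_linear_iff] at hps'
  have hg : ContinuousOn (fun x : X => ⟪c, x⟫) C := (continuous_const.inner continuous_id).continuousOn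
  have hfs : LowerSemicontinuousOn (fun y : Y => ⟪b, y⟫) D :=
    IsLinesearchRun.lowerSemicontinuousOn_of_continuousOn
      (continuous_const.inner continuous_id).continuousOn
  obtain ⟨xs, ys, hss, hlim⟩ := tendsto_lsSeq (K := K) (y₁ := y₁)
    (fun τ _ => isProxOn_proj_linear hCne hCcl hCc c τ)
    (fun σ _ => isProxOn_proj_linear hDne hDcl hDc b σ) hβ hδ0 hδ1 hμ0 hμ1 hγ hx₀ hτ₀ hhi hCcl hDcl
    hg hfs ⟨_, _, hps'⟩
  exact ⟨(xs, ys), (isSaddleOn_linear_iff K C D c b xs ys).1 hss, hlim⟩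

end Conic

/-! ### Theorem 3: variable ratios `β_k` (adaptive primal–dual step ratio on top of the linesearch)

"PDAL with variable `(β_k)`": iteration `k` uses `β_k` in Step 2 (`σ_k = β_k τ_k` and `√β_k` in the
test (6)). [MalitskyPock2018, Thm 3]: for `(β_k) ⊂ (β_min, β_max)` MONOTONE the statement of
Theorem 1 holds. We prove it through one engine covering both monotone cases: with
`r_k = max(1, β_k/β_{k+1})`, inequality (13) gives `a_{k+1} + diss_k ≤ r_k a_k` for the Lyapunov
sequence `a_k = ½‖x^{k+1} − x̂‖² + (1/2β_k)‖y^{k+1} − ŷ‖² + τ_k(1+θ_k)P(x^k)` ((18) is the case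
`r_k = 1`; (19)–(20) is the case `r_k = β_k/β_{k+1}`, up to the overall factor `β_k`), so everything
goes through as soon as the products `Π_{j<k} r_j` stay bounded — which holds with bound `1` for
nondecreasing `β` and with bound `β_0/β_min` for nonincreasing `β` (and, as the paper remarks at the
end of §2, under summable relative decreases). -/

/-- **A run of PDAL with variable ratios `β_k`** (the dual step of iteration `k+1` uses
`βs (k+1)`; `βs 0` only enters the Lyapunov bookkeeping). [cite: MalitskyPock2018, Thm 3] -/
structure IsLinesearchRunVar (K : X →L[ℝ] Y) (g : X → ℝ) (fs : Y → ℝ) (C : Set X) (D : Set Y)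
    (βs : ℕ → ℝ) (δ : ℝ) (x : ℕ → X) (y : ℕ → Y) (τ : ℕ → ℝ) : Prop where
  /-- the accepted steps are positive -/
  pos : ∀ k, 0 < τ k
  /-- `x^0 ∈ dom g` -/
  init : x 0 ∈ C
  /-- Step 1: `x^{k+1} = prox_{τ_k g}(x^k − τ_k K* y^{k+1})` -/
  primal : ∀ k, IsProxPt C g (τ k) (x k - τ k • K.adjoint (y k)) (x (k + 1))
  /-- Step 2: `τ_{k+1} ≤ τ_k √(1 + θ_k)` -/
  trial : ∀ k, τ (k + 1) ≤ τ k * Real.sqrt (1 + theta τ k)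
  /-- Step 2.a with `β_{k+1}`: `y^{k+2} = prox_{β_{k+1} τ_{k+1} f*}(y^{k+1} + β_{k+1} τ_{k+1} K x̄^{k+1})` -/
  dual : ∀ k, IsProxPt D fs (βs (k + 1) * τ (k + 1))
    (y k + (βs (k + 1) * τ (k + 1)) • K (xbar x τ (k + 1))) (y (k + 1))
  /-- Step 2.b with `β_{k+1}`: `√β_{k+1} τ_{k+1} ‖K*(y^{k+2} − y^{k+1})‖ ≤ δ ‖y^{k+2} − y^{k+1}‖` -/
  crit : ∀ k, Real.sqrt (βs (k + 1)) * τ (k + 1) * ‖K.adjoint (y (k + 1) - y k)‖ ≤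
    δ * ‖y (k + 1) - y k‖

/-- A constant-`β` run is a variable-`β` run. [cite: MalitskyPock2018, Thm 3] -/
theorem IsLinesearchRun.toVar {K : X →L[ℝ] Y} {g : X → ℝ} {fs : Y → ℝ} {C : Set X} {D : Set Y}
    {β δ : ℝ} {x : ℕ → X} {y : ℕ → Y} {τ : ℕ → ℝ} (h : IsLinesearchRun K g fs C D β δ x y τ) :
    IsLinesearchRunVar K g fs C D (fun _ => β) δ x y τ where
  pos := h.pos
  init := h.init
  primal := h.primal
  trial := h.trial
  dual := h.dual
  crit := h.crit

/-- The Lyapunov sequence of Theorem 3: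
`a_k = ½‖x^{k+1} − x̂‖² + (1/2β_k)‖y^{k+1} − ŷ‖² + τ_k(1+θ_k)P(x^k)`. [cite: MalitskyPock2018, Thm 3 (proof, (18))] -/
noncomputable def lyapVar (K : X →L[ℝ] Y) (g : X → ℝ) (βs : ℕ → ℝ) (x : ℕ → X) (y : ℕ → Y)
    (τ : ℕ → ℝ) (xh : X) (yh : Y) (k : ℕ) : ℝ :=
  ‖x (k + 1) - xh‖ ^ 2 / 2 + ‖y k - yh‖ ^ 2 / (2 * βs k)
    + τ k * (1 + theta τ k) * pgap K g xh yh (x k)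

/-- The dissipated quantity with `β_{k+1}`. [cite: MalitskyPock2018, Thm 3 (proof, (18))] -/
noncomputable def dissVar (βs : ℕ → ℝ) (δ : ℝ) (x : ℕ → X) (y : ℕ → Y) (τ : ℕ → ℝ) (k : ℕ) : ℝ :=
  ‖xbar x τ (k + 1) - x (k + 1)‖ ^ 2 / 2 + (1 - δ ^ 2) / (2 * βs (k + 1)) * ‖y (k + 1) - y k‖ ^ 2

/-- The one-step slack factor `r_k = max(1, β_k/β_{k+1})` (`= 1` for nondecreasing `β`,
`= β_k/β_{k+1}` for nonincreasing `β`). [cite: MalitskyPock2018, Thm 3 (proof, (18)–(20))] -/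
noncomputable def ratio (βs : ℕ → ℝ) (k : ℕ) : ℝ := max 1 (βs k / βs (k + 1))

/-- The accumulated slack `p_k = Π_{j<k} r_j`. [cite: MalitskyPock2018, Thm 3 (proof)] -/
noncomputable def prodRatio (βs : ℕ → ℝ) (k : ℕ) : ℝ := ∏ j ∈ Finset.range k, ratio βs j

omit [CompleteSpace X] in
/-- `p_k ≥ 1`. [cite: MalitskyPock2018, Thm 3 (proof)] -/
theorem one_le_prodRatio (βs : ℕ → ℝ) (k : ℕ) : 1 ≤ prodRatio βs k := by
  induction k with
  | zero => simp [prodRatio]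
  | succ k ih =>
      rw [prodRatio, Finset.prod_range_succ, ← prodRatio]
      have hr : 1 ≤ ratio βs k := le_max_left _ _
      nlinarith

omit [CompleteSpace X] in
/-- `p_{k+1} = p_k r_k`. [cite: MalitskyPock2018, Thm 3 (proof)] -/
theorem prodRatio_succ (βs : ℕ → ℝ) (k : ℕ) :
    prodRatio βs (k + 1) = prodRatio βs k * ratio βs k :=
  Finset.prod_range_succ _ _

omit [CompleteSpace X] in
/-- Nondecreasing `β`: `p_k = 1`. [cite: MalitskyPock2018, Thm 3 (proof, first case)] -/
theorem prodRatio_eq_one_of_monotone {βs : ℕ → ℝ} (hmono : Monotone βs) (hpos : ∀ k, 0 < βs k)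
    (k : ℕ) : prodRatio βs k = 1 := by
  refine Finset.prod_eq_one fun j _ => ?_
  exact max_eq_left ((div_le_one (hpos _)).2 (hmono (Nat.le_succ j)))

omit [CompleteSpace X] in
/-- Nonincreasing `β`: `p_k = β_0/β_k`. [cite: MalitskyPock2018, Thm 3 (proof, second case)] -/
theorem prodRatio_eq_of_antitone {βs : ℕ → ℝ} (hanti : Antitone βs) (hpos : ∀ k, 0 < βs k)
    (k : ℕ) : prodRatio βs k = βs 0 / βs k := by
  induction k with
  | zero => simp [prodRatio, (hpos 0).ne']
  | succ k ih =>
      rw [prodRatio_succ, ih, ratio, max_eq_right ((one_le_div (hpos _)).2 (hanti (Nat.le_succ k))),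
        div_mul_div_comm, mul_comm (βs 0) (βs k), mul_div_mul_left _ _ (hpos k).ne']

namespace IsLinesearchRunVar

variable {K : X →L[ℝ] Y} {g : X → ℝ} {fs : Y → ℝ} {C : Set X} {D : Set Y} {βs : ℕ → ℝ} {δ : ℝ}
  {x : ℕ → X} {y : ℕ → Y} {τ : ℕ → ℝ}

/-- Every primal iterate lies in `C`. [cite: MalitskyPock2018, Thm 3] -/
theorem x_mem (h : IsLinesearchRunVar K g fs C D βs δ x y τ) (k : ℕ) : x k ∈ C := by
  cases k with
  | zero => exact h.init
  | succ k => exact (h.primal k).1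

/-- Every computed dual iterate lies in `D`. [cite: MalitskyPock2018, Thm 3] -/
theorem y_succ_mem (h : IsLinesearchRunVar K g fs C D βs δ x y τ) (k : ℕ) : y (k + 1) ∈ D :=
  (h.dual k).1

/-- (13) along a variable-`β` run (with `β = β_{k+1}`). [cite: MalitskyPock2018, Thm 3 (proof)] -/
theorem step_le (h : IsLinesearchRunVar K g fs C D βs δ x y τ) (hβ : ∀ k, 0 < βs k) {xh : X}
    {yh : Y} (hxh : xh ∈ C) (hyh : yh ∈ D) (k : ℕ) :
    τ (k + 1) * ((1 + theta τ (k + 1)) * pgap K g xh yh (x (k + 1))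
      - theta τ (k + 1) * pgap K g xh yh (x k) + dgap K fs xh yh (y (k + 1))) ≤
      (‖x (k + 1) - xh‖ ^ 2 - ‖x (k + 2) - xh‖ ^ 2) / 2
        + (‖y k - yh‖ ^ 2 - ‖y (k + 1) - yh‖ ^ 2) / (2 * βs (k + 1))
        - ‖xbar x τ (k + 1) - x (k + 1)‖ ^ 2 / 2
        - (1 - δ ^ 2) / (2 * βs (k + 1)) * ‖y (k + 1) - y k‖ ^ 2 := by
  have hθ := (IsLinesearchRun.theta_pos h.pos (k + 1)).le
  have hτθ : τ (k + 1) = theta τ (k + 1) * τ k :=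
    (IsLinesearchRun.theta_succ_mul h.pos k).symm
  have hq := h.primal k
  have hr := h.primal (k + 1)
  have hv := h.dual k
  rw [xbar_succ] at hv ⊢
  exact one_step K g fs (hβ _) (h.pos k) hθ hτθ (hq.2 _ hr.1) (hq.2 _ (h.x_mem k)) (hr.2 _ hxh)
    (hv.2 _ hyh) (h.crit k)

/-- **(18)–(20) unified**: `a_{k+1} + diss_k ≤ r_k a_k` at a saddle point.
[cite: MalitskyPock2018, Thm 3 (proof, (18)–(20))] -/
theorem lyap_succ_add_diss_le (h : IsLinesearchRunVar K g fs C D βs δ x y τ) (hβ : ∀ k, 0 < βs k)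
    {xh : X} {yh : Y} (hs : IsSaddleOn K g fs C D xh yh) (k : ℕ) :
    lyapVar K g βs x y τ xh yh (k + 1) + dissVar βs δ x y τ k ≤
      ratio βs k * lyapVar K g βs x y τ xh yh k := by
  have hstep := h.step_le hβ hs.1 hs.2.1 k
  have hP : 0 ≤ pgap K g xh yh (x k) := pgap_nonneg hs (h.x_mem k)
  have hD : 0 ≤ dgap K fs xh yh (y (k + 1)) := dgap_nonneg hs (h.y_succ_mem k)
  have hθτ := IsLinesearchRun.theta_mul_le h.pos h.trial k
  have hτ1 := (h.pos (k + 1)).le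
  have hθ0 := (IsLinesearchRun.theta_pos h.pos k).le
  have hτ0 := (h.pos k).le
  have h1 : τ (k + 1) * theta τ (k + 1) * pgap K g xh yh (x k) ≤
      τ k * (1 + theta τ k) * pgap K g xh yh (x k) := by
    have := mul_le_mul_of_nonneg_right hθτ hP
    nlinarith [this]
  have h2 : 0 ≤ τ (k + 1) * dgap K fs xh yh (y (k + 1)) := mul_nonneg hτ1 hD
  have hr1 : 1 ≤ ratio βs k := le_max_left _ _
  -- the `y`-term: `‖y k − ŷ‖²/(2β_{k+1}) ≤ r_k ‖y k − ŷ‖²/(2β_k)`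
  have hyk : ‖y k - yh‖ ^ 2 / (2 * βs (k + 1)) ≤ ratio βs k * (‖y k - yh‖ ^ 2 / (2 * βs k)) := by
    have hb := hβ k
    have hb1 := hβ (k + 1)
    have hr2 : βs k / βs (k + 1) ≤ ratio βs k := le_max_right _ _
    have e : ‖y k - yh‖ ^ 2 / (2 * βs (k + 1)) = (βs k / βs (k + 1)) * (‖y k - yh‖ ^ 2 / (2 * βs k)) := by
      field_simp
    rw [e]
    exact mul_le_mul_of_nonneg_right hr2 (by positivity)
  -- the other two terms are nonnegative, so multiplying them by `r_k ≥ 1` only helps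
  have hxP : 0 ≤ ‖x (k + 1) - xh‖ ^ 2 / 2 + τ k * (1 + theta τ k) * pgap K g xh yh (x k) := by
    positivity
  have hxP' : ‖x (k + 1) - xh‖ ^ 2 / 2 + τ k * (1 + theta τ k) * pgap K g xh yh (x k) ≤
      ratio βs k * (‖x (k + 1) - xh‖ ^ 2 / 2 + τ k * (1 + theta τ k) * pgap K g xh yh (x k)) :=
    le_mul_of_one_le_left hxP hr1
  have ek : ratio βs k * lyapVar K g βs x y τ xh yh k =
      ratio βs k * (‖x (k + 1) - xh‖ ^ 2 / 2 + τ k * (1 + theta τ k) * pgap K g xh yh (x k))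
        + ratio βs k * (‖y k - yh‖ ^ 2 / (2 * βs k)) := by
    simp only [lyapVar]; ring
  have ek1 : lyapVar K g βs x y τ xh yh (k + 1) = ‖x (k + 2) - xh‖ ^ 2 / 2
      + ‖y (k + 1) - yh‖ ^ 2 / (2 * βs (k + 1))
      + τ (k + 1) * (1 + theta τ (k + 1)) * pgap K g xh yh (x (k + 1)) := rfl
  have ed : dissVar βs δ x y τ k = ‖xbar x τ (k + 1) - x (k + 1)‖ ^ 2 / 2
      + (1 - δ ^ 2) / (2 * βs (k + 1)) * ‖y (k + 1) - y k‖ ^ 2 := rfl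
  have e1 : (‖y k - yh‖ ^ 2 - ‖y (k + 1) - yh‖ ^ 2) / (2 * βs (k + 1)) =
      ‖y k - yh‖ ^ 2 / (2 * βs (k + 1)) - ‖y (k + 1) - yh‖ ^ 2 / (2 * βs (k + 1)) := by ring
  have e2 : τ (k + 1) * ((1 + theta τ (k + 1)) * pgap K g xh yh (x (k + 1))
      - theta τ (k + 1) * pgap K g xh yh (x k) + dgap K fs xh yh (y (k + 1))) =
      τ (k + 1) * (1 + theta τ (k + 1)) * pgap K g xh yh (x (k + 1))
        - τ (k + 1) * theta τ (k + 1) * pgap K g xh yh (x k)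
        + τ (k + 1) * dgap K fs xh yh (y (k + 1)) := by ring
  rw [ek, ek1, ed]
  rw [e1, e2] at hstep
  linarith [hstep, h1, h2, hyk, hxP']

/-- `a_k ≥ 0`. [cite: MalitskyPock2018, Thm 3 (proof)] -/
theorem lyap_nonneg (h : IsLinesearchRunVar K g fs C D βs δ x y τ) (hβ : ∀ k, 0 < βs k) {xh : X}
    {yh : Y} (hs : IsSaddleOn K g fs C D xh yh) (k : ℕ) : 0 ≤ lyapVar K g βs x y τ xh yh k := by
  have hP : 0 ≤ pgap K g xh yh (x k) := pgap_nonneg hs (h.x_mem k)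
  have hθ := (IsLinesearchRun.theta_pos h.pos k).le
  have hτ := (h.pos k).le
  have hb := hβ k
  simp only [lyapVar]
  positivity

omit [CompleteSpace X] [InnerProductSpace ℝ Y] [CompleteSpace Y] in
/-- `diss_k ≥ 0`. [cite: MalitskyPock2018, Thm 3 (proof)] -/
theorem dissVar_nonneg (hβ : ∀ k, 0 < βs k) (hδ0 : 0 ≤ δ) (hδ1 : δ ≤ 1) (x : ℕ → X) (y : ℕ → Y)
    (τ : ℕ → ℝ) (k : ℕ) : 0 ≤ dissVar βs δ x y τ k := by
  have : 0 ≤ 1 - δ ^ 2 := by nlinarith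
  have hb := hβ (k + 1)
  simp only [dissVar]
  positivity

/-- The normalized Lyapunov sequence `ã_k = a_k / p_k` is nonincreasing:
`ã_{k+1} + diss_k / p_{k+1} ≤ ã_k`. [cite: MalitskyPock2018, Thm 3 (proof)] -/
theorem lyapN_succ_le (h : IsLinesearchRunVar K g fs C D βs δ x y τ) (hβ : ∀ k, 0 < βs k)
    {xh : X} {yh : Y} (hs : IsSaddleOn K g fs C D xh yh) (k : ℕ) :
    lyapVar K g βs x y τ xh yh (k + 1) / prodRatio βs (k + 1)
      + dissVar βs δ x y τ k / prodRatio βs (k + 1) ≤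
      lyapVar K g βs x y τ xh yh k / prodRatio βs k := by
  have h1 := h.lyap_succ_add_diss_le hβ hs k
  have hp : 0 < prodRatio βs k := lt_of_lt_of_le one_pos (one_le_prodRatio βs k)
  have hr : 0 < ratio βs k := lt_of_lt_of_le one_pos (le_max_left _ _)
  rw [prodRatio_succ, ← add_div, div_le_div_iff₀ (mul_pos hp hr) hp]
  have := mul_le_mul_of_nonneg_left h1 hp.le
  nlinarith [this]

/-- Boundedness: `a_k ≤ p_k a_0`, and `Σ_{j<k} diss_j ≤ (sup p) · a_0`.
[cite: MalitskyPock2018, Thm 3 (proof)] -/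
theorem lyap_le (h : IsLinesearchRunVar K g fs C D βs δ x y τ) (hβ : ∀ k, 0 < βs k) (hδ0 : 0 ≤ δ)
    (hδ1 : δ ≤ 1) {xh : X} {yh : Y} (hs : IsSaddleOn K g fs C D xh yh) (k : ℕ) :
    lyapVar K g βs x y τ xh yh k / prodRatio βs k ≤ lyapVar K g βs x y τ xh yh 0 ∧
      lyapVar K g βs x y τ xh yh k ≤ prodRatio βs k * lyapVar K g βs x y τ xh yh 0 := by
  have hmono : ∀ k, lyapVar K g βs x y τ xh yh (k + 1) / prodRatio βs (k + 1) ≤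
      lyapVar K g βs x y τ xh yh k / prodRatio βs k := fun k => by
    have := h.lyapN_succ_le hβ hs k
    have hd : 0 ≤ dissVar βs δ x y τ k / prodRatio βs (k + 1) :=
      div_nonneg (dissVar_nonneg hβ hδ0 hδ1 x y τ k)
        (le_trans zero_le_one (one_le_prodRatio βs (k + 1)))
    linarith
  have h1 : lyapVar K g βs x y τ xh yh k / prodRatio βs k ≤ lyapVar K g βs x y τ xh yh 0 := by
    induction k with
    | zero => simp [prodRatio]
    | succ k ih => exact (hmono k).trans ih
  have hp : 0 < prodRatio βs k := lt_of_lt_of_le one_pos (one_le_prodRatio βs k)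
  exact ⟨h1, by rwa [div_le_iff₀ hp, mul_comm] at h1⟩

/-- Summability of the dissipation when the slack products are bounded: `Σ_{j<N} diss_j ≤ M a_0`.
[cite: MalitskyPock2018, Thm 3 (proof)] -/
theorem sum_dissVar_le (h : IsLinesearchRunVar K g fs C D βs δ x y τ) (hβ : ∀ k, 0 < βs k)
    (hδ0 : 0 ≤ δ) (hδ1 : δ ≤ 1) {xh : X} {yh : Y} (hs : IsSaddleOn K g fs C D xh yh) {M : ℝ}
    (hM : ∀ k, prodRatio βs k ≤ M) (N : ℕ) :
    ∑ j ∈ Finset.range N, dissVar βs δ x y τ j ≤ M * lyapVar K g βs x y τ xh yh 0 := by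
  set at_ : ℕ → ℝ := fun k => lyapVar K g βs x y τ xh yh k / prodRatio βs k with hat
  have htel : ∀ N, ∑ j ∈ Finset.range N, dissVar βs δ x y τ j ≤ M * (at_ 0 - at_ N) := by
    intro N
    induction N with
    | zero => simp
    | succ N ih =>
        rw [Finset.sum_range_succ]
        have h1 := h.lyapN_succ_le hβ hs N
        have hp1 : 1 ≤ prodRatio βs (N + 1) := one_le_prodRatio βs (N + 1)
        have hp : 0 < prodRatio βs (N + 1) := lt_of_lt_of_le one_pos hp1
        have hd0 := dissVar_nonneg hβ hδ0 hδ1 x y τ N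
        -- `diss_N ≤ p_{N+1} (ã_N − ã_{N+1}) ≤ M (ã_N − ã_{N+1})`
        have hdiff : 0 ≤ at_ N - at_ (N + 1) := by
          have : dissVar βs δ x y τ N / prodRatio βs (N + 1) ≥ 0 := div_nonneg hd0 hp.le
          simp only [hat]; linarith
        have h2 : dissVar βs δ x y τ N ≤ prodRatio βs (N + 1) * (at_ N - at_ (N + 1)) := by
          rw [← div_le_iff₀' hp]
          simp only [hat]; linarith
        have h3 : prodRatio βs (N + 1) * (at_ N - at_ (N + 1)) ≤ M * (at_ N - at_ (N + 1)) :=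
          mul_le_mul_of_nonneg_right (hM _) hdiff
        linarith
  have hN : 0 ≤ at_ N := div_nonneg (h.lyap_nonneg hβ hs N)
    (le_trans zero_le_one (one_le_prodRatio βs N))
  have hM0 : 0 ≤ M := le_trans (le_trans zero_le_one (one_le_prodRatio βs 0)) (hM 0)
  have := htel N
  have e0 : at_ 0 = lyapVar K g βs x y τ xh yh 0 := by simp [hat, prodRatio]
  rw [e0] at this
  nlinarith [this, hN, hM0]

/-- The dissipation tends to zero (for `β_k ≤ βmax`). [cite: MalitskyPock2018, Thm 3 (proof)] -/
theorem tendsto_diss (h : IsLinesearchRunVar K g fs C D βs δ x y τ) (hβ : ∀ k, 0 < βs k)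
    {βmax : ℝ} (hβmax : ∀ k, βs k ≤ βmax) (hδ0 : 0 ≤ δ) (hδ1 : δ < 1) {xh : X} {yh : Y}
    (hs : IsSaddleOn K g fs C D xh yh) {M : ℝ} (hM : ∀ k, prodRatio βs k ≤ M) :
    Tendsto (fun k => xbar x τ (k + 1) - x (k + 1)) atTop (𝓝 0) ∧
      Tendsto (fun k => y (k + 1) - y k) atTop (𝓝 0) := by
  have hsum : Summable fun k => dissVar βs δ x y τ k :=
    summable_of_sum_range_le (fun k => dissVar_nonneg hβ hδ0 hδ1.le x y τ k)
      (h.sum_dissVar_le hβ hδ0 hδ1.le hs hM)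
  have h0 := hsum.tendsto_atTop_zero
  have hβmax0 : 0 < βmax := (hβ 0).trans_le (hβmax 0)
  have hc : 0 < (1 - δ ^ 2) / (2 * βmax) := by
    have : 0 < 1 - δ ^ 2 := by nlinarith
    positivity
  constructor
  · have h1 : Tendsto (fun k => ‖xbar x τ (k + 1) - x (k + 1)‖ ^ 2) atTop (𝓝 0) := by
      refine squeeze_zero (fun k => by positivity) (fun k => ?_) (h0.const_mul 2 |>.trans_eq ?_)
      · simp only [dissVar]
        have hb := hβ (k + 1)
        have : 0 < 1 - δ ^ 2 := by nlinarith
        have : 0 ≤ (1 - δ ^ 2) / (2 * βs (k + 1)) * ‖y (k + 1) - y k‖ ^ 2 := by positivity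
        linarith
      · simp
    have h2 := h1.sqrt
    rw [Real.sqrt_zero] at h2
    rw [tendsto_zero_iff_norm_tendsto_zero]
    simpa [Real.sqrt_sq (norm_nonneg _)] using h2
  · have h1 : Tendsto (fun k => ‖y (k + 1) - y k‖ ^ 2) atTop (𝓝 0) := by
      refine squeeze_zero (fun k => by positivity) (fun k => ?_)
        (h0.const_mul ((1 - δ ^ 2) / (2 * βmax))⁻¹ |>.trans_eq ?_)
      · simp only [dissVar]
        rw [← div_le_iff₀' (inv_pos.2 hc), div_inv_eq_mul, mul_comm]
        have hb := hβ (k + 1)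
        have hd2 : 0 < 1 - δ ^ 2 := by nlinarith
        have : 0 ≤ ‖xbar x τ (k + 1) - x (k + 1)‖ ^ 2 / 2 := by positivity
        have hcoef : (1 - δ ^ 2) / (2 * βmax) ≤ (1 - δ ^ 2) / (2 * βs (k + 1)) :=
          div_le_div_of_nonneg_left hd2.le (by positivity) (by linarith [hβmax (k + 1)])
        have := mul_le_mul_of_nonneg_right hcoef (sq_nonneg ‖y (k + 1) - y k‖)
        linarith
      · simp
    have h2 := h1.sqrt
    rw [Real.sqrt_zero] at h2
    rw [tendsto_zero_iff_norm_tendsto_zero]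
    simpa [Real.sqrt_sq (norm_nonneg _)] using h2

/-- `(x^{k+1} − x^k)/τ_k → 0` (steps bounded below). [cite: MalitskyPock2018, Thm 3 (proof)] -/
theorem tendsto_inv_smul_sub (h : IsLinesearchRunVar K g fs C D βs δ x y τ) (hβ : ∀ k, 0 < βs k)
    {βmax : ℝ} (hβmax : ∀ k, βs k ≤ βmax) (hδ0 : 0 ≤ δ) (hδ1 : δ < 1) {xh : X} {yh : Y}
    (hs : IsSaddleOn K g fs C D xh yh) {M : ℝ} (hM : ∀ k, prodRatio βs k ≤ M) {τlo : ℝ}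
    (hτlo : 0 < τlo) (hlo : ∀ k, τlo ≤ τ k) :
    Tendsto (fun k => (τ k)⁻¹ • (x (k + 1) - x k)) atTop (𝓝 0) := by
  have hd := (h.tendsto_diss hβ hβmax hδ0 hδ1 hs hM).1
  rw [tendsto_zero_iff_norm_tendsto_zero] at hd ⊢
  refine squeeze_zero (fun k => norm_nonneg _) (fun k => ?_) (hd.const_mul τlo⁻¹ |>.trans_eq ?_)
  · rw [IsLinesearchRun.inv_smul_sub_eq h.pos, norm_smul, Real.norm_eq_abs, abs_inv,
      abs_of_pos (h.pos _)]
    exact mul_le_mul_of_nonneg_right ((inv_le_inv₀ (h.pos _) hτlo).2 (hlo _)) (norm_nonneg _)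
  · simp

/-- `x^{k+1} − x^k → 0` (steps bounded below and above). [cite: MalitskyPock2018, Thm 3 (proof)] -/
theorem tendsto_sub (h : IsLinesearchRunVar K g fs C D βs δ x y τ) (hβ : ∀ k, 0 < βs k)
    {βmax : ℝ} (hβmax : ∀ k, βs k ≤ βmax) (hδ0 : 0 ≤ δ) (hδ1 : δ < 1) {xh : X} {yh : Y}
    (hs : IsSaddleOn K g fs C D xh yh) {M : ℝ} (hM : ∀ k, prodRatio βs k ≤ M) {τlo τhi : ℝ}
    (hτlo : 0 < τlo) (hlo : ∀ k, τlo ≤ τ k) (hhi : ∀ k, τ k ≤ τhi) :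
    Tendsto (fun k => x (k + 1) - x k) atTop (𝓝 0) := by
  have h1 := h.tendsto_inv_smul_sub hβ hβmax hδ0 hδ1 hs hM hτlo hlo
  rw [tendsto_zero_iff_norm_tendsto_zero] at h1 ⊢
  refine squeeze_zero (fun k => norm_nonneg _) (fun k => ?_) (h1.const_mul τhi |>.trans_eq ?_)
  · rw [norm_smul, Real.norm_eq_abs, abs_inv, abs_of_pos (h.pos _)]
    have hτk := h.pos k
    calc ‖x (k + 1) - x k‖ = τ k * ((τ k)⁻¹ * ‖x (k + 1) - x k‖) := by
          rw [← mul_assoc, mul_inv_cancel₀ hτk.ne', one_mul]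
      _ ≤ τhi * ((τ k)⁻¹ * ‖x (k + 1) - x k‖) :=
          mul_le_mul_of_nonneg_right (hhi k) (by positivity)
  · simp

/-- **Theorem 3, first part of the conclusion**: cluster points of the iterates of PDAL with
variable ratios `β_k ∈ [βmin, βmax]` whose slack products are bounded (both monotone cases) are
saddle points. [cite: MalitskyPock2018, Thm 3] -/
theorem isSaddleOn_of_tendsto (h : IsLinesearchRunVar K g fs C D βs δ x y τ) {βmin βmax : ℝ}
    (hβmin : 0 < βmin) (hβlo : ∀ k, βmin ≤ βs k) (hβmax : ∀ k, βs k ≤ βmax) (hδ0 : 0 ≤ δ)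
    (hδ1 : δ < 1) (hsad : ∃ xh yh, IsSaddleOn K g fs C D xh yh) {M : ℝ}
    (hM : ∀ k, prodRatio βs k ≤ M) {τlo : ℝ} (hτlo : 0 < τlo) (hlo : ∀ k, τlo ≤ τ k)
    (hC : IsClosed C) (hD : IsClosed D) (hg : LowerSemicontinuousOn g C)
    (hfs : LowerSemicontinuousOn fs D) {xs : X} {ys : Y} {φ : ℕ → ℕ} (hφ : StrictMono φ)
    (hlim : Tendsto (fun n => (x (φ n + 1), y (φ n))) atTop (𝓝 (xs, ys))) :
    IsSaddleOn K g fs C D xs ys := by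
  have hβ : ∀ k, 0 < βs k := fun k => hβmin.trans_le (hβlo k)
  obtain ⟨xh, yh, hs⟩ := hsad
  obtain ⟨hdx, hdy⟩ := h.tendsto_diss hβ hβmax hδ0 hδ1 hs hM
  have hx : Tendsto (fun n => x (φ n + 1)) atTop (𝓝 xs) := by
    simpa [Function.comp_def] using (continuous_fst.tendsto _).comp hlim
  have hy : Tendsto (fun n => y (φ n)) atTop (𝓝 ys) := by
    simpa [Function.comp_def] using (continuous_snd.tendsto _).comp hlim
  have hφt := hφ.tendsto_atTop
  have hy1 : Tendsto (fun n => y (φ n + 1)) atTop (𝓝 ys) := by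
    have := hy.add (hdy.comp hφt)
    simpa [Function.comp_def] using this
  have hxb : Tendsto (fun n => xbar x τ (φ n + 1)) atTop (𝓝 xs) := by
    have := hx.add (hdx.comp hφt)
    simpa [Function.comp_def] using this
  have hxsC : xs ∈ C := hC.mem_of_tendsto hx (Eventually.of_forall fun n => h.x_mem _)
  have hysD : ys ∈ D := hD.mem_of_tendsto hy1 (Eventually.of_forall fun n => h.y_succ_mem _)
  have hxC : Tendsto (fun n => x (φ n + 1)) atTop (𝓝[C] xs) :=
    tendsto_nhdsWithin_iff.2 ⟨hx, Eventually.of_forall fun n => h.x_mem _⟩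
  have hyD : Tendsto (fun n => y (φ n + 1)) atTop (𝓝[D] ys) :=
    tendsto_nhdsWithin_iff.2 ⟨hy1, Eventually.of_forall fun n => h.y_succ_mem _⟩
  have hix : Tendsto (fun n => (τ (φ n))⁻¹ • (x (φ n + 1) - x (φ n))) atTop (𝓝 0) :=
    (h.tendsto_inv_smul_sub hβ hβmax hδ0 hδ1 hs hM hτlo hlo).comp hφt
  have hiy : Tendsto (fun n => (βs (φ n + 1) * τ (φ n + 1))⁻¹ • (y (φ n + 1) - y (φ n))) atTop
      (𝓝 0) := by
    have hd : Tendsto (fun n => y (φ n + 1) - y (φ n)) atTop (𝓝 0) := hdy.comp hφt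
    rw [tendsto_zero_iff_norm_tendsto_zero] at hd ⊢
    refine squeeze_zero (fun n => norm_nonneg _) (fun n => ?_)
      (hd.const_mul (βmin * τlo)⁻¹ |>.trans_eq (by simp))
    have hp : 0 < βs (φ n + 1) * τ (φ n + 1) := mul_pos (hβ _) (h.pos _)
    rw [norm_smul, Real.norm_eq_abs, abs_inv, abs_of_pos hp]
    exact mul_le_mul_of_nonneg_right
      ((inv_le_inv₀ hp (mul_pos hβmin hτlo)).2
        (mul_le_mul (hβlo _) (hlo _) hτlo.le (hβ _).le))
      (norm_nonneg _)
  refine ⟨hxsC, hysD, fun x' hx' => ?_, fun y' hy' => ?_⟩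
  · have hle : ∀ n, g (x (φ n + 1)) - g x' ≤
        ⟪(τ (φ n))⁻¹ • (x (φ n + 1) - x (φ n)), x' - x (φ n + 1)⟫
          + ⟪K.adjoint (y (φ n)), x' - x (φ n + 1)⟫ := by
      intro n
      have hp := (h.primal (φ n)).2 x' hx'
      have hτ := h.pos (φ n)
      have e : x (φ n + 1) - (x (φ n) - τ (φ n) • K.adjoint (y (φ n))) =
          (x (φ n + 1) - x (φ n)) + τ (φ n) • K.adjoint (y (φ n)) := by abel
      rw [e, inner_add_left, real_inner_smul_left] at hp
      rw [real_inner_smul_left]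
      have hne := hτ.ne'
      have h3 := mul_le_mul_of_nonneg_left hp (inv_pos.2 hτ).le
      have e1 : (τ (φ n))⁻¹ * (τ (φ n) * (g (x (φ n + 1)) - g x')) = g (x (φ n + 1)) - g x' := by
        rw [← mul_assoc, inv_mul_cancel₀ hne, one_mul]
      have e2 : (τ (φ n))⁻¹ * (⟪x (φ n + 1) - x (φ n), x' - x (φ n + 1)⟫
          + τ (φ n) * ⟪K.adjoint (y (φ n)), x' - x (φ n + 1)⟫) =
          (τ (φ n))⁻¹ * ⟪x (φ n + 1) - x (φ n), x' - x (φ n + 1)⟫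
            + ⟪K.adjoint (y (φ n)), x' - x (φ n + 1)⟫ := by
        rw [mul_add, ← mul_assoc _ (τ (φ n)), inv_mul_cancel₀ hne, one_mul]
      linarith [h3, e1, e2]
    have hb : Tendsto (fun n => ⟪(τ (φ n))⁻¹ • (x (φ n + 1) - x (φ n)), x' - x (φ n + 1)⟫
        + ⟪K.adjoint (y (φ n)), x' - x (φ n + 1)⟫) atTop
        (𝓝 (⟪(0 : X), x' - xs⟫ + ⟪K.adjoint ys, x' - xs⟫)) :=
      (hix.inner (tendsto_const_nhds.sub hx)).add
        (((K.adjoint.continuous.tendsto _).comp hy).inner (tendsto_const_nhds.sub hx))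
    rw [inner_zero_left, zero_add] at hb
    have hlsc : ∀ ε > 0, ∀ᶠ n in atTop, g xs - ε < g (x (φ n + 1)) := fun ε hε =>
      hxC.eventually (hg xs hxsC (g xs - ε) (by linarith))
    have := IsLinesearchRun.sub_le_of_eventually_lt hlsc hb hle
    simp only [lagr]
    rw [ContinuousLinearMap.adjoint_inner_left, map_sub, inner_sub_right, real_inner_comm (K x') ys,
      real_inner_comm (K xs) ys] at this
    linarith
  · have hle : ∀ n, fs (y (φ n + 1)) - fs y' ≤
        ⟪(βs (φ n + 1) * τ (φ n + 1))⁻¹ • (y (φ n + 1) - y (φ n)), y' - y (φ n + 1)⟫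
          - ⟪K (xbar x τ (φ n + 1)), y' - y (φ n + 1)⟫ := by
      intro n
      have hp := (h.dual (φ n)).2 y' hy'
      have hτ : 0 < βs (φ n + 1) * τ (φ n + 1) := mul_pos (hβ _) (h.pos _)
      have e : y (φ n + 1) - (y (φ n) + (βs (φ n + 1) * τ (φ n + 1)) • K (xbar x τ (φ n + 1))) =
          (y (φ n + 1) - y (φ n)) - (βs (φ n + 1) * τ (φ n + 1)) • K (xbar x τ (φ n + 1)) := by
        abel
      rw [e, inner_sub_left, real_inner_smul_left] at hp
      rw [real_inner_smul_left]
      have hne := hτ.ne'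
      have h3 := mul_le_mul_of_nonneg_left hp (inv_pos.2 hτ).le
      have e1 : (βs (φ n + 1) * τ (φ n + 1))⁻¹ *
          ((βs (φ n + 1) * τ (φ n + 1)) * (fs (y (φ n + 1)) - fs y')) =
          fs (y (φ n + 1)) - fs y' := by
        rw [← mul_assoc, inv_mul_cancel₀ hne, one_mul]
      have e2 : (βs (φ n + 1) * τ (φ n + 1))⁻¹ * (⟪y (φ n + 1) - y (φ n), y' - y (φ n + 1)⟫
          - (βs (φ n + 1) * τ (φ n + 1)) * ⟪K (xbar x τ (φ n + 1)), y' - y (φ n + 1)⟫) =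
          (βs (φ n + 1) * τ (φ n + 1))⁻¹ * ⟪y (φ n + 1) - y (φ n), y' - y (φ n + 1)⟫
            - ⟪K (xbar x τ (φ n + 1)), y' - y (φ n + 1)⟫ := by
        rw [mul_sub, ← mul_assoc _ (βs (φ n + 1) * τ (φ n + 1)), inv_mul_cancel₀ hne, one_mul]
      linarith [h3, e1, e2]
    have hb : Tendsto (fun n =>
        ⟪(βs (φ n + 1) * τ (φ n + 1))⁻¹ • (y (φ n + 1) - y (φ n)), y' - y (φ n + 1)⟫
        - ⟪K (xbar x τ (φ n + 1)), y' - y (φ n + 1)⟫) atTop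
        (𝓝 (⟪(0 : Y), y' - ys⟫ - ⟪K xs, y' - ys⟫)) :=
      (hiy.inner (tendsto_const_nhds.sub hy1)).sub
        (((K.continuous.tendsto _).comp hxb).inner (tendsto_const_nhds.sub hy1))
    rw [inner_zero_left, zero_sub] at hb
    have hlsc : ∀ ε > 0, ∀ᶠ n in atTop, fs ys - ε < fs (y (φ n + 1)) := fun ε hε =>
      hyD.eventually (hfs ys hysD (fs ys - ε) (by linarith))
    have := IsLinesearchRun.sub_le_of_eventually_lt hlsc hb hle
    simp only [lagr]
    rw [inner_sub_right] at this
    linarith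

/-- **Theorem 3, engine**: convergence of the whole sequence for variable ratios
`β_k ∈ [βmin, βmax]` with bounded slack products `Π_{j<k} max(1, β_j/β_{j+1}) ≤ M` (finite
dimension, `g` continuous on `C`, steps bounded below and above). [cite: MalitskyPock2018, Thm 3] -/
theorem tendsto_iterates [FiniteDimensional ℝ X] [FiniteDimensional ℝ Y]
    (h : IsLinesearchRunVar K g fs C D βs δ x y τ) {βmin βmax : ℝ} (hβmin : 0 < βmin)
    (hβlo : ∀ k, βmin ≤ βs k) (hβmax : ∀ k, βs k ≤ βmax) (hδ0 : 0 ≤ δ) (hδ1 : δ < 1)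
    (hsad : ∃ xh yh, IsSaddleOn K g fs C D xh yh) {M : ℝ} (hM : ∀ k, prodRatio βs k ≤ M)
    {τlo τhi : ℝ} (hτlo : 0 < τlo) (hlo : ∀ k, τlo ≤ τ k) (hhi : ∀ k, τ k ≤ τhi)
    (hC : IsClosed C) (hD : IsClosed D) (hg : ContinuousOn g C) (hfs : LowerSemicontinuousOn fs D) :
    ∃ xs ys, IsSaddleOn K g fs C D xs ys ∧
      Tendsto (fun k => (x (k + 1), y k)) atTop (𝓝 (xs, ys)) := by
  have hβ : ∀ k, 0 < βs k := fun k => hβmin.trans_le (hβlo k)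
  have hβmax0 : 0 < βmax := (hβ 0).trans_le (hβmax 0)
  have hM1 : 1 ≤ M := (one_le_prodRatio βs 0).trans (hM 0)
  obtain ⟨xh, yh, hs⟩ := hsad
  set z : ℕ → X × Y := fun k => (x (k + 1), y k) with hz
  -- boundedness
  set a0 := lyapVar K g βs x y τ xh yh 0 with ha0
  have ha0nn : 0 ≤ a0 := h.lyap_nonneg hβ hs 0
  have hbd0 : ∀ k, ‖x (k + 1) - xh‖ ^ 2 ≤ 2 * (M * a0) ∧ ‖y k - yh‖ ^ 2 ≤ 2 * βmax * (M * a0) :=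
    fun k => by
    have h1 := (h.lyap_le hβ hδ0 hδ1.le hs k).2
    have hpk : prodRatio βs k * a0 ≤ M * a0 := mul_le_mul_of_nonneg_right (hM k) ha0nn
    have hP : 0 ≤ pgap K g xh yh (x k) := pgap_nonneg hs (h.x_mem k)
    have hθ := (IsLinesearchRun.theta_pos h.pos k).le
    have hτ := (h.pos k).le
    have hb := hβ k
    have hPt : 0 ≤ τ k * (1 + theta τ k) * pgap K g xh yh (x k) := by positivity
    have ek : lyapVar K g βs x y τ xh yh k = ‖x (k + 1) - xh‖ ^ 2 / 2 + ‖y k - yh‖ ^ 2 / (2 * βs k)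
        + τ k * (1 + theta τ k) * pgap K g xh yh (x k) := rfl
    have hyn : 0 ≤ ‖y k - yh‖ ^ 2 / (2 * βs k) := by positivity
    have hxn : 0 ≤ ‖x (k + 1) - xh‖ ^ 2 / 2 := by positivity
    constructor
    · linarith
    · have hy' : ‖y k - yh‖ ^ 2 / (2 * βs k) ≤ M * a0 := by linarith
      have h2 := (div_le_iff₀ (by positivity : (0:ℝ) < 2 * βs k)).1 hy'
      have h3 : M * a0 * (2 * βs k) ≤ M * a0 * (2 * βmax) :=
        mul_le_mul_of_nonneg_left (by linarith [hβmax k]) (by nlinarith)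
      linarith
  set R : ℝ := Real.sqrt (2 * (M * a0)) + Real.sqrt (2 * βmax * (M * a0)) with hR
  have hmem : ∀ k, z k ∈ Metric.closedBall ((xh, yh) : X × Y) R := fun k => by
    obtain ⟨h1, h2⟩ := hbd0 k
    rw [Metric.mem_closedBall, dist_eq_norm]
    have e1 : ‖x (k + 1) - xh‖ ≤ Real.sqrt (2 * (M * a0)) := Real.le_sqrt_of_sq_le h1
    have e2 : ‖y k - yh‖ ≤ Real.sqrt (2 * βmax * (M * a0)) := Real.le_sqrt_of_sq_le h2
    calc ‖z k - (xh, yh)‖ = max ‖x (k + 1) - xh‖ ‖y k - yh‖ := rfl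
      _ ≤ R := max_le (e1.trans (le_add_of_nonneg_right (Real.sqrt_nonneg _)))
          (e2.trans (le_add_of_nonneg_left (Real.sqrt_nonneg _)))
  obtain ⟨zs, -, φ, hφ, hlim⟩ := tendsto_subseq_of_bounded Metric.isBounded_closedBall hmem
  have hlim' : Tendsto (fun n => (x (φ n + 1), y (φ n))) atTop (𝓝 (zs.1, zs.2)) := by
    simpa [hz, Function.comp_def] using hlim
  have hss : IsSaddleOn K g fs C D zs.1 zs.2 :=
    h.isSaddleOn_of_tendsto hβmin hβlo hβmax hδ0 hδ1 ⟨xh, yh, hs⟩ hM hτlo hlo hC hD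
      (IsLinesearchRun.lowerSemicontinuousOn_of_continuousOn hg) hfs hφ hlim'
  -- normalized Lyapunov sequence towards the cluster point
  set a : ℕ → ℝ := lyapVar K g βs x y τ zs.1 zs.2 with ha
  set an : ℕ → ℝ := fun k => a k / prodRatio βs k with han
  have hp : ∀ k, 0 < prodRatio βs k := fun k => lt_of_lt_of_le one_pos (one_le_prodRatio βs k)
  have hanti : Antitone an := antitone_nat_of_succ_le fun k => by
    have := h.lyapN_succ_le hβ hss k
    have hd : 0 ≤ dissVar βs δ x y τ k / prodRatio βs (k + 1) :=
      div_nonneg (dissVar_nonneg hβ hδ0 hδ1.le x y τ k) (hp _).le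
    simp only [han]; linarith
  have hann : ∀ k, 0 ≤ a k := fun k => h.lyap_nonneg hβ hss k
  have hannn : ∀ k, 0 ≤ an k := fun k => div_nonneg (hann k) (hp k).le
  have hx : Tendsto (fun n => x (φ n + 1)) atTop (𝓝 zs.1) := by
    simpa [Function.comp_def] using (continuous_fst.tendsto _).comp hlim'
  have hy : Tendsto (fun n => y (φ n)) atTop (𝓝 zs.2) := by
    simpa [Function.comp_def] using (continuous_snd.tendsto _).comp hlim'
  have hx0 : Tendsto (fun n => x (φ n)) atTop (𝓝 zs.1) := by
    have hd := (h.tendsto_sub hβ hβmax hδ0 hδ1 hs hM hτlo hlo hhi).comp hφ.tendsto_atTop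
    have := hx.sub hd
    simpa [Function.comp_def] using this
  have hPlim : Tendsto (fun n => pgap K g zs.1 zs.2 (x (φ n))) atTop (𝓝 0) := by
    have hxC : Tendsto (fun n => x (φ n)) atTop (𝓝[C] zs.1) :=
      tendsto_nhdsWithin_iff.2 ⟨hx0, Eventually.of_forall fun n => h.x_mem _⟩
    have hgl : Tendsto (fun n => g (x (φ n))) atTop (𝓝 (g zs.1)) :=
      (hg zs.1 hss.1).tendsto.comp hxC
    have hin : Tendsto (fun n => ⟪K (x (φ n) - zs.1), zs.2⟫) atTop (𝓝 ⟪K (zs.1 - zs.1), zs.2⟫) :=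
      ((K.continuous.tendsto _).comp (hx0.sub tendsto_const_nhds)).inner tendsto_const_nhds
    rw [sub_self, map_zero, inner_zero_left] at hin
    have := (hgl.sub tendsto_const_nhds (b := g zs.1)).add hin
    simpa [pgap] using this
  have haφ : Tendsto (fun n => a (φ n)) atTop (𝓝 0) := by
    have h1 : Tendsto (fun n => ‖x (φ n + 1) - zs.1‖ ^ 2 / 2) atTop (𝓝 0) := by
      have := ((continuous_norm.tendsto _).comp (hx.sub tendsto_const_nhds (b := zs.1))).pow 2
      simpa using this.div_const 2
    have h2 : Tendsto (fun n => ‖y (φ n) - zs.2‖ ^ 2 / (2 * βs (φ n))) atTop (𝓝 0) := by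
      have h2' : Tendsto (fun n => ‖y (φ n) - zs.2‖ ^ 2) atTop (𝓝 0) := by
        have := ((continuous_norm.tendsto _).comp (hy.sub tendsto_const_nhds (b := zs.2))).pow 2
        simpa using this
      rw [tendsto_zero_iff_norm_tendsto_zero] at h2' ⊢
      refine squeeze_zero (fun n => norm_nonneg _) (fun n => ?_)
        (h2'.const_mul (2 * βmin)⁻¹ |>.trans_eq (by simp))
      have hb := hβ (φ n)
      rw [Real.norm_eq_abs, abs_of_nonneg (by positivity), Real.norm_eq_abs,
        abs_of_nonneg (by positivity), div_eq_inv_mul]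
      exact mul_le_mul_of_nonneg_right
        ((inv_le_inv₀ (by positivity) (by positivity)).2 (by linarith [hβlo (φ n)]))
        (sq_nonneg _)
    have h3 : Tendsto (fun n => τ (φ n) * (1 + theta τ (φ n)) * pgap K g zs.1 zs.2 (x (φ n)))
        atTop (𝓝 0) := by
      have hMul : ∀ n, |τ (φ n) * (1 + theta τ (φ n))| ≤ τhi * (1 + Real.goldenRatio) := fun n => by
        have hθ := IsLinesearchRun.theta_le_goldenRatio h.pos h.trial (φ n)
        have hθ0 := (IsLinesearchRun.theta_pos h.pos (φ n)).le
        have hτ0 := (h.pos (φ n)).le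
        rw [abs_of_nonneg (mul_nonneg hτ0 (by linarith))]
        exact mul_le_mul (hhi _) (by linarith) (by linarith) ((h.pos 0).le.trans (hhi 0))
      rw [tendsto_zero_iff_norm_tendsto_zero] at hPlim ⊢
      refine squeeze_zero (fun n => norm_nonneg _) (fun n => ?_)
        (hPlim.const_mul (τhi * (1 + Real.goldenRatio)) |>.trans_eq (by simp))
      rw [Real.norm_eq_abs, abs_mul, Real.norm_eq_abs]
      exact mul_le_mul_of_nonneg_right (hMul n) (abs_nonneg _)
    have := (h1.add h2).add h3
    simpa [ha, lyapVar] using this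
  have hanφ : Tendsto (fun n => an (φ n)) atTop (𝓝 0) := by
    refine squeeze_zero (fun n => hannn _) (fun n => ?_) haφ
    simp only [han]
    exact div_le_self (hann _) (one_le_prodRatio βs _)
  have han0 : Tendsto an atTop (𝓝 0) := by
    rw [Metric.tendsto_atTop]
    intro ε hε
    obtain ⟨n, hn⟩ := (Metric.tendsto_atTop.mp hanφ) ε hε
    refine ⟨φ n, fun k hk => ?_⟩
    have h1 := hn n le_rfl
    rw [Real.dist_eq, sub_zero, abs_of_nonneg (hannn _)] at h1 ⊢
    exact lt_of_le_of_lt (hanti hk) h1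
  have ha0lim : Tendsto a atTop (𝓝 0) := by
    refine squeeze_zero (fun k => hann k) (fun k => ?_) (han0.const_mul M |>.trans_eq (by simp))
    have e : a k = prodRatio βs k * an k := by
      simp only [han]; rw [mul_div_cancel₀ _ (hp k).ne']
    rw [e]
    exact mul_le_mul_of_nonneg_right (hM k) (hannn k)
  -- conclude
  refine ⟨zs.1, zs.2, hss, ?_⟩
  have hbd : ∀ k, ‖x (k + 1) - zs.1‖ ^ 2 ≤ 2 * a k ∧ ‖y k - zs.2‖ ^ 2 ≤ 2 * βmax * a k := fun k => by
    have hP : 0 ≤ pgap K g zs.1 zs.2 (x k) := pgap_nonneg hss (h.x_mem k)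
    have hθ := (IsLinesearchRun.theta_pos h.pos k).le
    have hτ := (h.pos k).le
    have hb := hβ k
    have hPt : 0 ≤ τ k * (1 + theta τ k) * pgap K g zs.1 zs.2 (x k) := by positivity
    have ek : a k = ‖x (k + 1) - zs.1‖ ^ 2 / 2 + ‖y k - zs.2‖ ^ 2 / (2 * βs k)
        + τ k * (1 + theta τ k) * pgap K g zs.1 zs.2 (x k) := rfl
    have hyn : 0 ≤ ‖y k - zs.2‖ ^ 2 / (2 * βs k) := by positivity
    have hxn : 0 ≤ ‖x (k + 1) - zs.1‖ ^ 2 / 2 := by positivity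
    constructor
    · linarith
    · have hy' : ‖y k - zs.2‖ ^ 2 / (2 * βs k) ≤ a k := by linarith
      have h2 := (div_le_iff₀ (by positivity : (0:ℝ) < 2 * βs k)).1 hy'
      have h3 : a k * (2 * βs k) ≤ a k * (2 * βmax) :=
        mul_le_mul_of_nonneg_left (by linarith [hβmax k]) (hann k)
      linarith
  rw [tendsto_iff_norm_sub_tendsto_zero]
  have e1 : Tendsto (fun k => ‖x (k + 1) - zs.1‖) atTop (𝓝 0) := by
    have hsq : Tendsto (fun k => ‖x (k + 1) - zs.1‖ ^ 2) atTop (𝓝 0) :=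
      squeeze_zero (fun k => by positivity) (fun k => (hbd k).1)
        (by simpa using ha0lim.const_mul 2)
    simpa [Real.sqrt_sq (norm_nonneg _)] using hsq.sqrt
  have e2 : Tendsto (fun k => ‖y k - zs.2‖) atTop (𝓝 0) := by
    have hsq : Tendsto (fun k => ‖y k - zs.2‖ ^ 2) atTop (𝓝 0) :=
      squeeze_zero (fun k => by positivity) (fun k => (hbd k).2)
        (by simpa using ha0lim.const_mul (2 * βmax))
    simpa [Real.sqrt_sq (norm_nonneg _)] using hsq.sqrt
  have hmax := e1.max e2
  simpa [Prod.norm_def] using hmax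

/-- **Theorem 3 (Malitsky–Pock): PDAL with MONOTONE variable ratios `β_k ∈ [βmin, βmax]`,
`0 < βmin`, satisfies the statement of Theorem 1** — here the convergence part: in finite
dimensions, with `g` continuous on `C`, `f*` lower semicontinuous on `D` (both closed), steps
bounded below and above and a saddle point existing, the iterates converge to a saddle point. (The
cluster-point part is `isSaddleOn_of_tendsto` with the same slack bound.) For the kernels: a
monotone (e.g. ratcheted) primal–dual step-ratio schedule ON TOP OF the adaptive linesearch steps
keeps the convergence theorem. [cite: MalitskyPock2018, Thm 3] -/
theorem tendsto_iterates_of_monotone_or_antitone [FiniteDimensional ℝ X] [FiniteDimensional ℝ Y]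
    (h : IsLinesearchRunVar K g fs C D βs δ x y τ) {βmin βmax : ℝ} (hβmin : 0 < βmin)
    (hβlo : ∀ k, βmin ≤ βs k) (hβmax : ∀ k, βs k ≤ βmax) (hmono : Monotone βs ∨ Antitone βs)
    (hδ0 : 0 ≤ δ) (hδ1 : δ < 1) (hsad : ∃ xh yh, IsSaddleOn K g fs C D xh yh) {τlo τhi : ℝ}
    (hτlo : 0 < τlo) (hlo : ∀ k, τlo ≤ τ k) (hhi : ∀ k, τ k ≤ τhi) (hC : IsClosed C)
    (hD : IsClosed D) (hg : ContinuousOn g C) (hfs : LowerSemicontinuousOn fs D) :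
    ∃ xs ys, IsSaddleOn K g fs C D xs ys ∧
      Tendsto (fun k => (x (k + 1), y k)) atTop (𝓝 (xs, ys)) := by
  have hβ : ∀ k, 0 < βs k := fun k => hβmin.trans_le (hβlo k)
  rcases hmono with hm | ha
  · exact h.tendsto_iterates hβmin hβlo hβmax hδ0 hδ1 hsad (M := 1)
      (fun k => (prodRatio_eq_one_of_monotone hm hβ k).le) hτlo hlo hhi hC hD hg hfs
  · refine h.tendsto_iterates hβmin hβlo hβmax hδ0 hδ1 hsad (M := βs 0 / βmin) (fun k => ?_)
      hτlo hlo hhi hC hD hg hfs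
    rw [prodRatio_eq_of_antitone ha hβ k]
    exact div_le_div_of_nonneg_left (hβ 0).le hβmin (hβlo k)

end IsLinesearchRunVar

/-! ### Complements: the gap as a difference of saddle-function values; the rate in terms of `N` -/

section Complements

omit [CompleteSpace X] [CompleteSpace Y] in
/-- `P_{x̂,ŷ}(x) + D_{x̂,ŷ}(y) = L(x, ŷ) − L(x̂, y)`: the primal–dual gap of §1 is the usual gap of
saddle-function values against the saddle point (so Theorem 2 bounds the same quantity as
`PrimalDualHybridGradient.conicL_gap_ergodic_le` does for fixed steps).
[cite: MalitskyPock2018, §1 (4)–(5)] -/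
theorem pgap_add_dgap (K : X →L[ℝ] Y) (g : X → ℝ) (fs : Y → ℝ) (xh : X) (yh : Y) (x : X) (y : Y) :
    pgap K g xh yh x + dgap K fs xh yh y = lagr K g fs x yh - lagr K g fs xh y := by
  simp only [pgap, dgap, lagr, map_sub, inner_sub_left, inner_sub_right]
  ring

namespace IsLinesearchRun

variable {K : X →L[ℝ] Y} {g : X → ℝ} {fs : Y → ℝ} {C : Set X} {D : Set Y} {β δ : ℝ}
  {x : ℕ → X} {y : ℕ → Y} {τ : ℕ → ℝ}

omit [CompleteSpace X] in
/-- `s_N ≥ N τlo` when the steps are bounded below (Lemma 1 (ii)). [cite: MalitskyPock2018, Thm 2 (with Lemma 1 (ii))] -/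
theorem le_stepSum {τlo : ℝ} (hlo : ∀ k, τlo ≤ τ k) (N : ℕ) : (N : ℝ) * τlo ≤ stepSum τ N := by
  unfold stepSum
  have := Finset.sum_le_sum (s := Finset.range N) fun i _ => hlo (i + 1)
  simpa using this

/-- **Theorem 2 in terms of `N`**: with steps bounded below by `τlo > 0` (Lemma 1 (ii)), the
ergodic gap `L(X^N, ŷ) − L(x̂, Y^N)` is at most
`(½‖x^1 − x̂‖² + (1/2β)‖y^1 − ŷ‖² + τ_1 θ_1 P(x^0)) / (N τlo)` — the `O(1/N)` rate "as in
[CP11, CP16, GLYEB15]". [cite: MalitskyPock2018, Thm 2 (and the sentence following its proof)] -/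
theorem lagr_gap_ergodic_le (h : IsLinesearchRun K g fs C D β δ x y τ) (hβ : 0 < β) (hδ0 : 0 ≤ δ)
    (hδ1 : δ ≤ 1) (hg : ConvexOn ℝ C g) (hfs : ConvexOn ℝ D fs) {xh : X} {yh : Y}
    (hs : IsSaddleOn K g fs C D xh yh) {τlo : ℝ} (hτlo : 0 < τlo) (hlo : ∀ k, τlo ≤ τ k) {N : ℕ}
    (hN : 0 < N) :
    lagr K g fs (xErg x τ N) yh - lagr K g fs xh (yErg y τ N) ≤
      (‖x 1 - xh‖ ^ 2 / 2 + ‖y 0 - yh‖ ^ 2 / (2 * β) + τ 1 * theta τ 1 * pgap K g xh yh (x 0))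
        / ((N : ℝ) * τlo) := by
  have h1 := h.ergodic_gap_le hβ hδ0 hδ1 hg hfs hs hN
  rw [pgap_add_dgap] at h1
  have hNτ : 0 < (N : ℝ) * τlo := mul_pos (by exact_mod_cast hN) hτlo
  have hs0 : (N : ℝ) * τlo ≤ stepSum τ N := le_stepSum hlo N
  -- the numerator is nonnegative (it bounds a nonnegative gap times `s_N`)
  obtain ⟨M, rfl⟩ : ∃ M, N = M + 1 := ⟨N - 1, (Nat.succ_pred_eq_of_pos hN).symm⟩
  have hgap : 0 ≤ lagr K g fs (xErg x τ (M + 1)) yh - lagr K g fs xh (yErg y τ (M + 1)) := by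
    rw [← pgap_add_dgap]
    exact add_nonneg (pgap_nonneg hs (h.xErg_mem hg.1 M)) (dgap_nonneg hs (h.yErg_mem hfs.1 M))
  have hsN := stepSum_pos h.pos M
  have hnum : 0 ≤ ‖x 1 - xh‖ ^ 2 / 2 + ‖y 0 - yh‖ ^ 2 / (2 * β)
      + τ 1 * theta τ 1 * pgap K g xh yh (x 0) := by
    have := (le_div_iff₀ hsN).1 h1
    nlinarith
  exact h1.trans (div_le_div_of_nonneg_left hnum hNτ hs0)

end IsLinesearchRun

end Complements

/-! ### How many iterations the linesearch needs: the a-priori bounds (remark after Lemma 1)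

"One might be interested in how many iterations the linesearch needs in order to terminate. Of
course, we can give only a priori upper bounds. Assume that `(τ_k)` is bounded from above by
`τ_max`. Consider in step 2 of Algorithm 1 two opposite ways of choosing step size `τ_k`: maximally
increase it, that is, always set `τ_k = τ_{k−1} √(1 + θ_{k−1})`, or never increase it and set
`τ_k = τ_{k−1}`. If the former case holds, then after `i` iterations of the linesearch we have
`τ_k ≤ τ_{k−1} √(1 + θ_{k−1}) μ^{i−1} ≤ τ_max ((√5 + 1)/2) μ^{i−1}`, where we have used the bound
from Lemma 1 (iii). Hence, if `i − 1 ≥ log_μ (2δ / (L (1 + √5) τ_max))`, then `τ_k ≤ δ/L` and the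
linesearch procedure must terminate. Similarly, if the latter case holds, then after at most
`1 + log_μ (δ / (L τ_max))` iterations the linesearch stops. However, because in this case `(τ_k)`
is nonincreasing, this number is the upper bound for the total number of the linesearch
iterations." [MalitskyPock2018, §2, after the proof of Lemma 1; `L = ‖K‖`.]

What is typed. `lsN … k` is the number of REJECTED trial steps (backtracks `τ := τ μ`) in the
linesearch of iteration `k + 1` of Algorithm 1 (`lsSeq`), so that linesearch makes `lsN … k + 1`
passes through Step 2.a (each pass = one dual prox and one application of `K*`, Remark 1; none of
them an extra matrix–vector product in the affine cases of Remark 2); `lsTotal … N = Σ_{k<N} lsN … k`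
is the total number of backtracks in the first `N` iterations (so those iterations make
`N + lsTotal … N` passes in all, `sum_lsN_add_one`). The sufficient condition for the test (6) is
`√β t ‖K‖ ≤ δ` (`lsTest_of_le`), so the typed thresholds carry the factor `√β` of (6), which the
printed sentence drops (it writes `τ_k ≤ δ/L`); for `β = 1` they coincide.
* `lsN_le_of_le` — ONE linesearch, any trial policy, steps below `τmax`: every trial step is at most
  `τmax (1+√5)/2`, so `lsN … k ≤ i` as soon as `√β ‖K‖ τmax ((1+√5)/2) μ^i ≤ δ` (the printed
  "maximally increase" bound, which is the worst case of Step 2);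
* `lsTau_const_eq` / `lsTotal_const_le` / `lsTotal_const_le_logb` — "never increase": `τ_N = τ_0 μ^{S_N}`
  and the TOTAL number of backtracks `S_N ≤ i` for every `N` as soon as `√β ‖K‖ τ_0 μ^i ≤ δ`, in
  particular `S_N ≤ ⌈log_μ (δ / (√β ‖K‖ τ_0))⌉`;
* `lsTotal_log_le` — any trial policy (a consequence of Lemma 1 (ii)–(iii), recorded for the cost
  accounting of the adaptive kernel; the source prints only the two extreme policies): since
  `τ_{k+1} ≤ τ_k ((1+√5)/2) μ^{n_k}` and `τ_N ≥ τlo > 0`,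
  `S_N · log(1/μ) ≤ log(τ_0/τlo) + N · log((1+√5)/2)` — the linesearch costs at most
  `1 + log((1+√5)/2)/log(1/μ)` passes per iteration on average, plus a constant. -/

section LinesearchCount

variable {K : X →L[ℝ] Y} {proxG : ℝ → X → X} {proxF : ℝ → Y → Y} {β δ μ : ℝ}
  {γ : ℝ → ℝ → ℝ} {x₀ : X} {y₁ : Y} {τ₀ : ℝ}

/-- Minimality of the backtracking count, quantitative form of Lemma 1 (i): if the trial step
`t₀ μ^i` already satisfies the sufficient condition `√β (t₀ μ^i) ‖K‖ ≤ δ` for the test (6), then at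
most `i` trial steps are rejected. [cite: MalitskyPock2018, Lemma 1 (i)] -/
theorem lsCount_le_of_le (hμ0 : 0 < μ) {t₀ : ℝ} (ht₀ : 0 ≤ t₀) (xc xp : X) (yc : Y) (τp : ℝ)
    {i : ℕ} (hi : Real.sqrt β * (t₀ * μ ^ i) * ‖K‖ ≤ δ) :
    lsCount K proxF β δ μ xc xp yc τp t₀ ≤ i := by
  classical
  have ht : lsTest K proxF β δ xc xp yc τp (t₀ * μ ^ i) :=
    lsTest_of_le (by positivity) hi xc xp yc τp
  have h : ∃ i : ℕ, lsTest K proxF β δ xc xp yc τp (t₀ * μ ^ i) := ⟨i, ht⟩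
  unfold lsCount
  rw [dif_pos h]
  exact Nat.find_min' h ht

variable (K proxG proxF β δ μ) in
/-- The number of rejected trial steps (backtracks `τ_{k+1} := τ_{k+1} μ`) in the linesearch of
iteration `k + 1` of Algorithm 1; that linesearch runs `lsN … k + 1` times through Step 2.a.
[cite: MalitskyPock2018, §2 Algorithm 1 (Step 2.b)] -/
noncomputable def lsN (γ : ℝ → ℝ → ℝ) (x₀ : X) (y₁ : Y) (τ₀ : ℝ) (k : ℕ) : ℕ :=
  lsCount K proxF β δ μ
    (proxG (lsSeq K proxG proxF β δ μ γ x₀ y₁ τ₀ k).τ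
      ((lsSeq K proxG proxF β δ μ γ x₀ y₁ τ₀ k).x
        - (lsSeq K proxG proxF β δ μ γ x₀ y₁ τ₀ k).τ • K.adjoint (lsSeq K proxG proxF β δ μ γ x₀ y₁ τ₀ k).y))
    (lsSeq K proxG proxF β δ μ γ x₀ y₁ τ₀ k).x (lsSeq K proxG proxF β δ μ γ x₀ y₁ τ₀ k).y
    (lsSeq K proxG proxF β δ μ γ x₀ y₁ τ₀ k).τ
    (γ (lsSeq K proxG proxF β δ μ γ x₀ y₁ τ₀ k).τ (lsSeq K proxG proxF β δ μ γ x₀ y₁ τ₀ k).θ)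

variable (K proxG proxF β δ μ) in
/-- The total number of backtracks in the first `N` iterations of Algorithm 1 (those iterations
make `N + lsTotal … N` linesearch passes in all). [cite: MalitskyPock2018, §2 (remark after Lemma 1)] -/
noncomputable def lsTotal (γ : ℝ → ℝ → ℝ) (x₀ : X) (y₁ : Y) (τ₀ : ℝ) (N : ℕ) : ℕ :=
  ∑ k ∈ Finset.range N, lsN K proxG proxF β δ μ γ x₀ y₁ τ₀ k

/-- Passes through Step 2.a in the first `N` iterations = `N + (total backtracks)`.
[cite: MalitskyPock2018, §2 (remark after Lemma 1)] -/
theorem sum_lsN_add_one (N : ℕ) :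
    ∑ k ∈ Finset.range N, (lsN K proxG proxF β δ μ γ x₀ y₁ τ₀ k + 1) =
      N + lsTotal K proxG proxF β δ μ γ x₀ y₁ τ₀ N := by
  rw [Finset.sum_add_distrib, Finset.sum_const, Finset.card_range, smul_eq_mul, mul_one, add_comm]
  rfl

/-- The accepted step of iteration `k + 1` is the trial step times `μ^{(number of backtracks)}`:
`τ_{k+1} = γ(τ_k, θ_k) μ^{n_k}`. [cite: MalitskyPock2018, §2 Algorithm 1 (Step 2.b)] -/
theorem lsTau_succ_eq (k : ℕ) :
    lsTau K proxG proxF β δ μ γ x₀ y₁ τ₀ (k + 1) =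
      γ (lsTau K proxG proxF β δ μ γ x₀ y₁ τ₀ k) (lsSeq K proxG proxF β δ μ γ x₀ y₁ τ₀ k).θ *
        μ ^ lsN K proxG proxF β δ μ γ x₀ y₁ τ₀ k := rfl

/-- The trial interval is respected: `τ_{k+1} ≤ τ_k √(1 + θ_k)` along Algorithm 1 (any trial
policy, `μ ∈ (0,1)`). [cite: MalitskyPock2018, §2 Algorithm 1 (Step 2)] -/
theorem lsTau_succ_le (hμ0 : 0 < μ) (hμ1 : μ < 1) (hγ : IsTrialPolicy γ) (hτ₀ : 0 < τ₀) (k : ℕ) :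
    lsTau K proxG proxF β δ μ γ x₀ y₁ τ₀ (k + 1) ≤
      lsTau K proxG proxF β δ μ γ x₀ y₁ τ₀ k *
        Real.sqrt (1 + theta (lsTau K proxG proxF β δ μ γ x₀ y₁ τ₀) k) := by
  have hp := lsSeq_pos (K := K) (proxG := proxG) (proxF := proxF) (β := β) (δ := δ) (x₀ := x₀)
    (y₁ := y₁) hγ hμ0 hτ₀ k
  rw [theta_lsTau, lsTau_succ_eq]
  set s := lsSeq K proxG proxF β δ μ γ x₀ y₁ τ₀ k
  have h2 := (hγ s.τ s.θ hp.1 hp.2.le).2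
  have h0 : 0 ≤ γ s.τ s.θ := hp.1.le.trans (hγ s.τ s.θ hp.1 hp.2.le).1
  exact (mul_le_of_le_one_right h0 (pow_le_one₀ hμ0.le hμ1.le)).trans h2

/-- Lemma 1 (iii) along Algorithm 1: `θ_k ≤ (1 + √5)/2`. [cite: MalitskyPock2018, Lemma 1 (iii)] -/
theorem theta_lsSeq_le_goldenRatio (hμ0 : 0 < μ) (hμ1 : μ < 1) (hγ : IsTrialPolicy γ)
    (hτ₀ : 0 < τ₀) (k : ℕ) :
    (lsSeq K proxG proxF β δ μ γ x₀ y₁ τ₀ k).θ ≤ Real.goldenRatio := by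
  rw [← theta_lsTau]
  exact IsLinesearchRun.theta_le_goldenRatio
    (fun j => (lsSeq_pos (K := K) (proxG := proxG) (proxF := proxF) (β := β) (δ := δ) (x₀ := x₀)
      (y₁ := y₁) hγ hμ0 hτ₀ j).1)
    (fun j => lsTau_succ_le hμ0 hμ1 hγ hτ₀ j) k

/-- Every trial step is at most `τ_k (1 + √5)/2` (since `√(1 + θ_k) ≤ √(1 + (1+√5)/2) = (1+√5)/2`).
[cite: MalitskyPock2018, §2 (remark after Lemma 1)] -/
theorem trial_le_mul_goldenRatio (hμ0 : 0 < μ) (hμ1 : μ < 1) (hγ : IsTrialPolicy γ)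
    (hτ₀ : 0 < τ₀) (k : ℕ) :
    γ (lsTau K proxG proxF β δ μ γ x₀ y₁ τ₀ k) (lsSeq K proxG proxF β δ μ γ x₀ y₁ τ₀ k).θ ≤
      lsTau K proxG proxF β δ μ γ x₀ y₁ τ₀ k * Real.goldenRatio := by
  have hp := lsSeq_pos (K := K) (proxG := proxG) (proxF := proxF) (β := β) (δ := δ) (x₀ := x₀)
    (y₁ := y₁) hγ hμ0 hτ₀ k
  have hθ := theta_lsSeq_le_goldenRatio (K := K) (proxG := proxG) (proxF := proxF) (β := β)
    (δ := δ) (x₀ := x₀) (y₁ := y₁) hμ0 hμ1 hγ hτ₀ k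
  set s := lsSeq K proxG proxF β δ μ γ x₀ y₁ τ₀ k
  have h2 := (hγ s.τ s.θ hp.1 hp.2.le).2
  have hsq : Real.sqrt (1 + s.θ) ≤ Real.goldenRatio := by
    rw [Real.sqrt_le_left Real.goldenRatio_pos.le, Real.goldenRatio_sq]
    linarith
  exact h2.trans (mul_le_mul_of_nonneg_left hsq hp.1.le)

/-- **The a-priori bound on one linesearch** (printed for "maximally increase", the worst case of
Step 2; here for any trial policy): if the steps stay below `τmax`, then for every `i` with
`√β ‖K‖ τmax ((1+√5)/2) μ^i ≤ δ` the linesearch of every iteration rejects at most `i` trial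
steps, i.e. stops after at most `i + 1` passes ("if `i − 1 ≥ log_μ (2δ/(L(1+√5)τ_max))` … the
linesearch procedure must terminate"). [cite: MalitskyPock2018, §2 (remark after Lemma 1)] -/
theorem lsN_le_of_le (hμ0 : 0 < μ) (hμ1 : μ < 1) (hγ : IsTrialPolicy γ) (hτ₀ : 0 < τ₀)
    {τmax : ℝ} (hhi : ∀ k, lsTau K proxG proxF β δ μ γ x₀ y₁ τ₀ k ≤ τmax) {i : ℕ}
    (hi : Real.sqrt β * (τmax * Real.goldenRatio * μ ^ i) * ‖K‖ ≤ δ) (k : ℕ) :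
    lsN K proxG proxF β δ μ γ x₀ y₁ τ₀ k ≤ i := by
  have hp := lsSeq_pos (K := K) (proxG := proxG) (proxF := proxF) (β := β) (δ := δ) (x₀ := x₀)
    (y₁ := y₁) hγ hμ0 hτ₀ k
  have htr := trial_le_mul_goldenRatio (K := K) (proxG := proxG) (proxF := proxF) (β := β)
    (δ := δ) (x₀ := x₀) (y₁ := y₁) hμ0 hμ1 hγ hτ₀ k
  set s := lsSeq K proxG proxF β δ μ γ x₀ y₁ τ₀ k
  have h0 : 0 ≤ γ s.τ s.θ := hp.1.le.trans (hγ s.τ s.θ hp.1 hp.2.le).1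
  refine lsCount_le_of_le hμ0 h0 _ _ _ _ (le_trans ?_ hi)
  have hle : γ s.τ s.θ ≤ τmax * Real.goldenRatio :=
    htr.trans (mul_le_mul_of_nonneg_right (hhi k) Real.goldenRatio_pos.le)
  have hμi : 0 ≤ μ ^ i := pow_nonneg hμ0.le i
  have hβ0 : 0 ≤ Real.sqrt β := Real.sqrt_nonneg β
  gcongr

/-- The threshold exists: with steps below `τmax`, some `i` (depending on `β, δ, μ, τmax, ‖K‖` only)
bounds the number of rejected trial steps of every linesearch. [cite: MalitskyPock2018, §2 (remark after Lemma 1)] -/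
theorem exists_lsN_le (hδ : 0 < δ) (hμ0 : 0 < μ) (hμ1 : μ < 1) (hγ : IsTrialPolicy γ) (hτ₀ : 0 < τ₀)
    {τmax : ℝ} (hhi : ∀ k, lsTau K proxG proxF β δ μ γ x₀ y₁ τ₀ k ≤ τmax) :
    ∃ i : ℕ, ∀ k, lsN K proxG proxF β δ μ γ x₀ y₁ τ₀ k ≤ i := by
  have hτmax : 0 < τmax := hτ₀.trans_le (hhi 0)
  by_cases hc : Real.sqrt β * (τmax * Real.goldenRatio) * ‖K‖ = 0
  · refine ⟨0, fun k => lsN_le_of_le hμ0 hμ1 hγ hτ₀ hhi ?_ k⟩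
    rw [pow_zero, mul_one, hc]; exact hδ.le
  · have hpos : 0 < Real.sqrt β * (τmax * Real.goldenRatio) * ‖K‖ :=
      lt_of_le_of_ne (by positivity) (Ne.symm hc)
    obtain ⟨i, hi⟩ := exists_pow_lt_of_lt_one (div_pos hδ hpos) hμ1
    refine ⟨i, fun k => lsN_le_of_le hμ0 hμ1 hγ hτ₀ hhi ?_ k⟩
    have : Real.sqrt β * (τmax * Real.goldenRatio * μ ^ i) * ‖K‖ =
        (Real.sqrt β * (τmax * Real.goldenRatio) * ‖K‖) * μ ^ i := by ring
    rw [this]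
    exact ((lt_div_iff₀' hpos).1 hi).le

/-! #### "Never increase `τ_k`": the total number of backtracks is bounded -/

/-- Under the policy "never increase" the steps are `τ_N = τ_0 μ^{S_N}`, `S_N` the total number of
backtracks so far. [cite: MalitskyPock2018, §2 (remark after Lemma 1)] -/
theorem lsTau_const_eq (N : ℕ) :
    lsTau K proxG proxF β δ μ (fun τ _ => τ) x₀ y₁ τ₀ N =
      τ₀ * μ ^ lsTotal K proxG proxF β δ μ (fun τ _ => τ) x₀ y₁ τ₀ N := by
  induction N with
  | zero => simp [lsTotal]; rfl
  | succ N ih =>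
      rw [lsTau_succ_eq, lsTotal, Finset.sum_range_succ, pow_add, ← mul_assoc, ← lsTotal, ← ih]

/-- Under "never increase" the steps are nonincreasing. [cite: MalitskyPock2018, §2 (remark after Lemma 1)] -/
theorem lsTau_const_succ_le (hμ0 : 0 < μ) (hμ1 : μ < 1) (hτ₀ : 0 < τ₀) (k : ℕ) :
    lsTau K proxG proxF β δ μ (fun τ _ => τ) x₀ y₁ τ₀ (k + 1) ≤
      lsTau K proxG proxF β δ μ (fun τ _ => τ) x₀ y₁ τ₀ k := by
  have hp := lsSeq_pos (K := K) (proxG := proxG) (proxF := proxF) (β := β) (δ := δ) (x₀ := x₀)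
    (y₁ := y₁) (isTrialPolicy_const) hμ0 hτ₀ k
  rw [lsTau_succ_eq]
  exact mul_le_of_le_one_right hp.1.le (pow_le_one₀ hμ0.le hμ1.le)

/-- **"Never increase": the total number of linesearch backtracks over the WHOLE run is bounded**:
for every `i` with `√β ‖K‖ τ_0 μ^i ≤ δ` and every `N`, `S_N ≤ i` (so the first `N` iterations make at
most `N + i` linesearch passes). Mechanism: at the last iteration that backtracks, the last rejected
trial step `τ_0 μ^{S_N − 1}` violates (6), hence `√β ‖K‖ τ_0 μ^{S_N − 1} > δ` (Lemma 1 (ii)).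
[cite: MalitskyPock2018, §2 (remark after Lemma 1)] -/
theorem lsTotal_const_le (hδ : 0 < δ) (hμ0 : 0 < μ) (hμ1 : μ < 1) (hτ₀ : 0 < τ₀) {i : ℕ}
    (hi : Real.sqrt β * (τ₀ * μ ^ i) * ‖K‖ ≤ δ) (N : ℕ) :
    lsTotal K proxG proxF β δ μ (fun τ _ => τ) x₀ y₁ τ₀ N ≤ i := by
  induction N with
  | zero => simp [lsTotal]
  | succ N ih =>
      have hp := lsSeq_pos (K := K) (proxG := proxG) (proxF := proxF) (β := β) (δ := δ) (x₀ := x₀)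
        (y₁ := y₁) (isTrialPolicy_const) hμ0 hτ₀ N
      rw [lsTotal, Finset.sum_range_succ, ← lsTotal]
      set T := lsTotal K proxG proxF β δ μ (fun τ _ => τ) x₀ y₁ τ₀ N with hT
      rcases hn : lsN K proxG proxF β δ μ (fun τ _ => τ) x₀ y₁ τ₀ N with _ | j
      · simpa using ih
      · -- the last rejected trial step `τ_N μ^j = τ_0 μ^{T+j}` violates the sufficient condition
        have hlt := lt_of_lsCount_eq_succ (K := K) (proxF := proxF) (β := β) hδ hμ0 hμ1 hp.1.le
          _ _ _ _ hn
        have hτN := lsTau_const_eq (K := K) (proxG := proxG) (proxF := proxF) (β := β) (δ := δ)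
          (μ := μ) (x₀ := x₀) (y₁ := y₁) (τ₀ := τ₀) N
        change δ < Real.sqrt β * (lsTau K proxG proxF β δ μ (fun τ _ => τ) x₀ y₁ τ₀ N * μ ^ j) * ‖K‖
          at hlt
        rw [hτN, ← hT] at hlt
        have hlt' : δ < Real.sqrt β * (τ₀ * μ ^ (T + j)) * ‖K‖ := by
          rw [pow_add, ← mul_assoc τ₀]; exact hlt
        by_contra hle
        have hle' : i ≤ T + j := by omega
        have hpow : μ ^ (T + j) ≤ μ ^ i := pow_le_pow_of_le_one hμ0.le hμ1.le hle'
        have hβ0 : 0 ≤ Real.sqrt β := Real.sqrt_nonneg β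
        have : Real.sqrt β * (τ₀ * μ ^ (T + j)) * ‖K‖ ≤ Real.sqrt β * (τ₀ * μ ^ i) * ‖K‖ := by
          gcongr
        linarith

/-- "Never increase", per linesearch: each one rejects at most `i` trial steps ("after at most
`1 + log_μ(δ/(Lτ_max))` iterations the linesearch stops", `τ_max = τ_0` here).
[cite: MalitskyPock2018, §2 (remark after Lemma 1)] -/
theorem lsN_const_le (hδ : 0 < δ) (hμ0 : 0 < μ) (hμ1 : μ < 1) (hτ₀ : 0 < τ₀) {i : ℕ}
    (hi : Real.sqrt β * (τ₀ * μ ^ i) * ‖K‖ ≤ δ) (k : ℕ) :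
    lsN K proxG proxF β δ μ (fun τ _ => τ) x₀ y₁ τ₀ k ≤ i := by
  have h := lsTotal_const_le (K := K) (proxG := proxG) (proxF := proxF) (x₀ := x₀) (y₁ := y₁)
    hδ hμ0 hμ1 hτ₀ hi (k + 1)
  rw [lsTotal, Finset.sum_range_succ] at h
  exact le_of_add_le_right h

/-- The threshold exists: some `i` (depending on `β, δ, μ, τ_0, ‖K‖` only) bounds the total number
of backtracks of "never increase" for all `N`. [cite: MalitskyPock2018, §2 (remark after Lemma 1)] -/
theorem exists_lsTotal_const_le (hδ : 0 < δ) (hμ0 : 0 < μ) (hμ1 : μ < 1) (hτ₀ : 0 < τ₀) :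
    ∃ i : ℕ, ∀ N, lsTotal K proxG proxF β δ μ (fun τ _ => τ) x₀ y₁ τ₀ N ≤ i := by
  by_cases hc : Real.sqrt β * τ₀ * ‖K‖ = 0
  · refine ⟨0, fun N => lsTotal_const_le hδ hμ0 hμ1 hτ₀ ?_ N⟩
    rw [pow_zero, mul_one, hc]; exact hδ.le
  · have hpos : 0 < Real.sqrt β * τ₀ * ‖K‖ := lt_of_le_of_ne (by positivity) (Ne.symm hc)
    obtain ⟨i, hi⟩ := exists_pow_lt_of_lt_one (div_pos hδ hpos) hμ1
    refine ⟨i, fun N => lsTotal_const_le hδ hμ0 hμ1 hτ₀ ?_ N⟩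
    have : Real.sqrt β * (τ₀ * μ ^ i) * ‖K‖ = (Real.sqrt β * τ₀ * ‖K‖) * μ ^ i := by ring
    rw [this]
    exact ((lt_div_iff₀' hpos).1 hi).le

/-- For `μ ∈ (0,1)` and `r > 0`: `μ ^ ⌈log_μ r⌉ ≤ r`. [cite: MalitskyPock2018, §2 (remark after Lemma 1)] -/
theorem pow_natCeil_logb_le (hμ0 : 0 < μ) (hμ1 : μ < 1) {r : ℝ} (hr : 0 < r) :
    μ ^ ⌈Real.logb μ r⌉₊ ≤ r := by
  have h1 : (Real.logb μ r) ≤ (⌈Real.logb μ r⌉₊ : ℝ) := Nat.le_ceil _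
  calc μ ^ ⌈Real.logb μ r⌉₊ = μ ^ ((⌈Real.logb μ r⌉₊ : ℕ) : ℝ) := (Real.rpow_natCast μ _).symm
    _ ≤ μ ^ Real.logb μ r := Real.rpow_le_rpow_of_exponent_ge hμ0 hμ1.le h1
    _ = r := Real.rpow_logb hμ0 hμ1.ne hr

/-- **"Never increase", printed form**: for `K ≠ 0` the total number of backtracks satisfies
`S_N ≤ ⌈log_μ (δ / (√β ‖K‖ τ_0))⌉` for every `N`. [cite: MalitskyPock2018, §2 (remark after Lemma 1)] -/
theorem lsTotal_const_le_logb (hβ : 0 < β) (hδ : 0 < δ) (hμ0 : 0 < μ) (hμ1 : μ < 1) (hτ₀ : 0 < τ₀)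
    (hK : 0 < ‖K‖) (N : ℕ) :
    lsTotal K proxG proxF β δ μ (fun τ _ => τ) x₀ y₁ τ₀ N ≤
      ⌈Real.logb μ (δ / (Real.sqrt β * ‖K‖ * τ₀))⌉₊ := by
  have hc : 0 < Real.sqrt β * ‖K‖ * τ₀ := mul_pos (mul_pos (Real.sqrt_pos.2 hβ) hK) hτ₀
  refine lsTotal_const_le hδ hμ0 hμ1 hτ₀ ?_ N
  have h := pow_natCeil_logb_le hμ0 hμ1 (div_pos hδ hc)
  have e : Real.sqrt β * (τ₀ * μ ^ ⌈Real.logb μ (δ / (Real.sqrt β * ‖K‖ * τ₀))⌉₊) * ‖K‖ =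
      (Real.sqrt β * ‖K‖ * τ₀) * μ ^ ⌈Real.logb μ (δ / (Real.sqrt β * ‖K‖ * τ₀))⌉₊ := by ring
  rw [e]
  exact (le_div_iff₀' hc).1 h

/-- **The a-priori bound on one linesearch, printed form**: for `K ≠ 0`, steps below `τmax`, any
trial policy, every linesearch rejects at most `⌈log_μ (δ / (√β ‖K‖ τmax (1+√5)/2))⌉` trial steps
("if `i − 1 ≥ log_μ (2δ / (L (1+√5) τ_max))`, then … the linesearch procedure must terminate").
[cite: MalitskyPock2018, §2 (remark after Lemma 1)] -/
theorem lsN_le_logb (hβ : 0 < β) (hδ : 0 < δ) (hμ0 : 0 < μ) (hμ1 : μ < 1) (hγ : IsTrialPolicy γ)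
    (hτ₀ : 0 < τ₀) (hK : 0 < ‖K‖) {τmax : ℝ}
    (hhi : ∀ k, lsTau K proxG proxF β δ μ γ x₀ y₁ τ₀ k ≤ τmax) (k : ℕ) :
    lsN K proxG proxF β δ μ γ x₀ y₁ τ₀ k ≤
      ⌈Real.logb μ (δ / (Real.sqrt β * ‖K‖ * τmax * Real.goldenRatio))⌉₊ := by
  have hτmax : 0 < τmax := hτ₀.trans_le (hhi 0)
  have hc : 0 < Real.sqrt β * ‖K‖ * τmax * Real.goldenRatio :=
    mul_pos (mul_pos (mul_pos (Real.sqrt_pos.2 hβ) hK) hτmax) Real.goldenRatio_pos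
  refine lsN_le_of_le hμ0 hμ1 hγ hτ₀ hhi ?_ k
  have h := pow_natCeil_logb_le hμ0 hμ1 (div_pos hδ hc)
  have e : Real.sqrt β * (τmax * Real.goldenRatio *
        μ ^ ⌈Real.logb μ (δ / (Real.sqrt β * ‖K‖ * τmax * Real.goldenRatio))⌉₊) * ‖K‖ =
      (Real.sqrt β * ‖K‖ * τmax * Real.goldenRatio) *
        μ ^ ⌈Real.logb μ (δ / (Real.sqrt β * ‖K‖ * τmax * Real.goldenRatio))⌉₊ := by ring
  rw [e]
  exact (le_div_iff₀' hc).1 h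

/-! #### Any trial policy: the amortised count -/

/-- `τ_N ≤ τ_0 ((1+√5)/2)^N μ^{S_N}` for any trial policy (from `τ_{k+1} = γ(τ_k,θ_k) μ^{n_k}` and
`γ(τ_k, θ_k) ≤ τ_k √(1+θ_k) ≤ τ_k (1+√5)/2`, Lemma 1 (iii)). [cite: MalitskyPock2018, §2 (remark after Lemma 1), Lemma 1 (iii)] -/
theorem lsTau_le_pow_mul_pow (hμ0 : 0 < μ) (hμ1 : μ < 1) (hγ : IsTrialPolicy γ) (hτ₀ : 0 < τ₀)
    (N : ℕ) :
    lsTau K proxG proxF β δ μ γ x₀ y₁ τ₀ N ≤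
      τ₀ * Real.goldenRatio ^ N * μ ^ lsTotal K proxG proxF β δ μ γ x₀ y₁ τ₀ N := by
  induction N with
  | zero => simp [lsTotal]; rfl
  | succ N ih =>
      have htr := trial_le_mul_goldenRatio (K := K) (proxG := proxG) (proxF := proxF) (β := β)
        (δ := δ) (x₀ := x₀) (y₁ := y₁) hμ0 hμ1 hγ hτ₀ N
      rw [lsTau_succ_eq, lsTotal, Finset.sum_range_succ, ← lsTotal]
      set T := lsTotal K proxG proxF β δ μ γ x₀ y₁ τ₀ N
      set n := lsN K proxG proxF β δ μ γ x₀ y₁ τ₀ N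
      have hμn : 0 ≤ μ ^ n := pow_nonneg hμ0.le _
      calc γ (lsTau K proxG proxF β δ μ γ x₀ y₁ τ₀ N) (lsSeq K proxG proxF β δ μ γ x₀ y₁ τ₀ N).θ * μ ^ n
            ≤ (lsTau K proxG proxF β δ μ γ x₀ y₁ τ₀ N * Real.goldenRatio) * μ ^ n :=
              mul_le_mul_of_nonneg_right htr hμn
        _ ≤ (τ₀ * Real.goldenRatio ^ N * μ ^ T * Real.goldenRatio) * μ ^ n := by gcongr
        _ = τ₀ * Real.goldenRatio ^ (N + 1) * μ ^ (T + n) := by ring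

/-- **The amortised linesearch count for any trial policy**: if `τ_k ≥ τlo > 0` for all `k`
(Lemma 1 (ii)), then `S_N · log(1/μ) ≤ log(τ_0/τlo) + N · log((1+√5)/2)` for every `N` — the first `N`
iterations make at most `N (1 + log((1+√5)/2)/log(1/μ)) + log(τ_0/τlo)/log(1/μ)` linesearch passes.
(A consequence of Lemma 1 (ii)–(iii) and the update `τ_{k+1} = γ(τ_k,θ_k) μ^{n_k}`; the source prints
the per-linesearch bound for "maximally increase" and the total bound for "never increase".)
[cite: MalitskyPock2018, §2 (remark after Lemma 1), Lemma 1 (ii)–(iii)] -/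
theorem lsTotal_log_le (hμ0 : 0 < μ) (hμ1 : μ < 1) (hγ : IsTrialPolicy γ) (hτ₀ : 0 < τ₀)
    {τlo : ℝ} (hτlo : 0 < τlo) (hlo : ∀ k, τlo ≤ lsTau K proxG proxF β δ μ γ x₀ y₁ τ₀ k) (N : ℕ) :
    (lsTotal K proxG proxF β δ μ γ x₀ y₁ τ₀ N : ℝ) * Real.log (1 / μ) ≤
      Real.log (τ₀ / τlo) + N * Real.log Real.goldenRatio := by
  have h := (hlo N).trans (lsTau_le_pow_mul_pow (K := K) (proxG := proxG) (proxF := proxF)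
    (β := β) (δ := δ) (x₀ := x₀) (y₁ := y₁) hμ0 hμ1 hγ hτ₀ N)
  set S := lsTotal K proxG proxF β δ μ γ x₀ y₁ τ₀ N
  have hφ := Real.goldenRatio_pos
  have hlog := Real.log_le_log hτlo h
  rw [Real.log_mul (mul_pos hτ₀ (pow_pos hφ N)).ne' (pow_pos hμ0 S).ne',
    Real.log_mul hτ₀.ne' (pow_pos hφ N).ne', Real.log_pow, Real.log_pow] at hlog
  rw [Real.log_div hτ₀.ne' hτlo.ne', one_div, Real.log_inv]
  linarith

/-- The amortised count with the constant of Lemma 1 (ii): for `K ≠ 0` and any trial policy,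
`S_N · log(1/μ) ≤ log(τ_0 / min(τ_0, δμ/(√β‖K‖))) + N · log((1+√5)/2)`.
[cite: MalitskyPock2018, §2 (remark after Lemma 1), Lemma 1 (ii)–(iii)] -/
theorem lsTotal_log_le' (hβ : 0 < β) (hδ : 0 < δ) (hμ0 : 0 < μ) (hμ1 : μ < 1) (hγ : IsTrialPolicy γ)
    (hτ₀ : 0 < τ₀) (hK : 0 < ‖K‖) (N : ℕ) :
    (lsTotal K proxG proxF β δ μ γ x₀ y₁ τ₀ N : ℝ) * Real.log (1 / μ) ≤
      Real.log (τ₀ / min τ₀ (δ * μ / (Real.sqrt β * ‖K‖))) + N * Real.log Real.goldenRatio :=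
  lsTotal_log_le hμ0 hμ1 hγ hτ₀
    (lt_min hτ₀ (div_pos (mul_pos hδ hμ0) (mul_pos (Real.sqrt_pos.2 hβ) hK)))
    (le_lsTau hβ hδ hμ0 hμ1 hγ hτ₀ hK) N

end LinesearchCount

end Literature.Analysis.Convex.LinesearchPDHG
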